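import Summits.AtomisticToContinuum.Crystallization.Theses.ReggeStarCoercivity
import Literature.MathematicalPhysics.StatisticalMechanics.LennardJonesClusters
import Summits.AtomisticToContinuum.Crystallization.Theorems.DefectFreeCrystallizes.Negative.PredicateAPI
import Literature.MathematicalPhysics.StatisticalMechanics.BarlowStacking
import Literature.MathematicalPhysics.StatisticalMechanics.MuGroundStateConfiguration
import Literature.MathematicalPhysics.StatisticalMechanics.CrystallizationLocalLimit
import Literature.MathematicalPhysics.StatisticalMechanics.BarlowCoordination
import Literature.Geometry.DiscreteGeometry.LayerShellPatterns
import Mathlib.NumberTheory.Padics.PadicVal.Basic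
import Summits.AtomisticToContinuum.Crystallization.Theorems.DefectFreeCrystallizes.Negative.TypeGap
import Summits.AtomisticToContinuum.Crystallization.Theorems.DefectFreeCrystallizes.Negative.IcosahedralShellsCharged
import Summits.AtomisticToContinuum.Crystallization.Theorems.DefectFreeCrystallizes.Negative.StrainBlindness
import Summits.AtomisticToContinuum.Crystallization.Theorems.DefectFreeCrystallizes.Negative.FccBall

/-!
# Disproof of `DefectFreeCrystallizes` — findings (standing crux disprover; gen 3, cycle 3, v14)

Crux `ReggeStarCoercivity.DefectFreeCrystallizes` (item stmt-AtomisticToContinuum-13603, rank 5):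
`ZeroDefectDensity → IsCrystallizing lennardJones 3`, where `ZeroDefectDensity` (= item 13604 verbatim)
says: along EVERY sequence of Lennard-Jones ground states `x N` (one for each `N`), the fraction of
sites whose recentred `6/5`-shell, rescaled by some `a ∈ [9/10, 11/10]`, is NOT `1/20`-matched after a
linear isometry to the fcc (cuboctahedron) or hcp (anticuboctahedron) kissing pattern tends to `0`.

VERDICT SO FAR: **resists** — no refutation is possible without first PROVING `ZeroDefectDensity`
(open, XL) and then DISPROVING Blanc–Lewin crystallization for Lennard-Jones in `ℝ³` (open):
`not_crux_iff`. Everything in this file is `lean check` rc 0, sorry-free, axioms standard.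

LANDED under `Summits/AtomisticToContinuum/Crystallization/Theorems/DefectFreeCrystallizes/Negative/`
(importable; `--supports` 13603): `TypeGap.lean` (p71052, §4), `IcosahedralShellsCharged.lean`
(p71123, §5), `StrainBlindness.lean` (p71155, §6; pure-proof form with `uniax` inlined),
`PredicateAPI.lean` (§2–§3 + corollaries; proposal id in the disprover's NOTES).
Gen 3: `FccBall.lean` (p75966, review-queued: the fcc-lattice ball, §7) and — once it is in the tree —
`SqueezeWindowNeedsMinimality.lean` (¬`SqueezeWindow`-without-`IsGroundState`, §7).

## Findings (index)

* §8 (v14, NEW) **THE LOAD-BEARING THEOREM, KERNEL-CHECKED**: `WithoutGroundStates.not_defectFreeCrystallizesWithoutGroundStates :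
  ∀ δ ≤ 1, ¬ DefectFreeCrystallizesWithoutGroundStates δ` — the crux with `IsGroundState lennardJones (x N)` replaced by
  `Injective (x N) ∧ δ-separated` (defect clause and `IsCrystallizing` conclusion VERBATIM, per sequence) is FALSE, while
  `WithoutGroundStates.defectFreeCrystallizes_of_without : (∀ δ, 0 < δ → δ ≤ 1 → DFCWGS δ) → DefectFreeCrystallizes`.  Witness:
  lexicographically filled boxes of the unit Barlow stacking of the RULER (2-adic) Hägg word (`StackingBlocks.block rulerHagg N`:
  injective, `1`-separated, `defects/N → 0`); a periodic local limit would (`VagueToMatching.eventually_ballMatch`, covering radius,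
  `bulk_of_dense`, vertical period, `StackingShift.periodic_of_selfmatch`) make the ruler word periodic on `4p + 1` consecutive layers,
  contradicting `RulerHagg.rulerHagg_periodic_stretch_lt`.  ≈ 1800 lines, sorry-free, axioms {propext, Classical.choice, Quot.sound};
  being landed as `Theorems/DefectFreeCrystallizes/Negative/{VagueToMatching, RulerHagg, StackingShift, StackingBlocks,
  StackingBlocksInterior, StackingBlocksDefects, WithoutGroundStates, WithoutGroundStatesRefuted}.lean` (the copies in §8 live under
  `…Cruxes.DefectFreeCrystallizes.Disproof.*` so the names never collide; v15 will import the landed files instead).  CONSEQUENCE FOR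
  EVERY LINE: some stub must consume `IsGroundState` beyond separation + injectivity + zero defect density (gen-2 `octet-cell-squeeze`
  does so at `stub_windowPinning` / `stub_squeeze`; `SqueezeWindow` itself is false without it — `Negative/SqueezeWindowNeedsMinimality`,
  p78202, ACCEPTED).
* §7 note (v14): the gen-2 skeleton (02:13Z) RETIRED `StrainLandscape` (now `BandLandscape`, capped growth `(3/4)·min(‖ΔC‖², 6/1000)`,
  all words), replaced `RegistryLandscape` by `RegistryGap`, `LocalCellStar` by `LocalCellComplex`, and added clause (b) (outer hand-over,
  deficit ≤ ½ word-slack) to `OctahedronCoercivity`; the §7 objects below are the GEN-1 statements (kept: the Lean facts about them stand).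
  Gen-2 numerics so far (disprover's `calc/local2/`, pure python, reproducing the lead's numbers first: γ = 0.2 basal shear deficit
  0.00886, λ_min −2.03, fcc⁺ slack 0.0304, ratio 0.29): an ADVERSARIAL search over the near-conformal band (shear + direction + ⊥ shear
  + in-plane and c stretches; slack minimised over the words hcp / fcc±; deficit maximised over orientation and non-affine field) pushes
  the hand-over ratio deficit/slack to 0.43 (shear 0.188 toward a hole direction, ⊥ shear 0.022, in-plane +1.9 % / −3.2 %, c +2.5 %:
  deficit 0.0091 vs fcc⁻-word slack 0.0210) against the allowed 0.5 — clause 1(b) is NOT broken yet but its margin is 13 %, not 42 %;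
  search continuing (evidence `ratio_rand6.out`; numbers are updated in the disprover's evidence notes).

* §7 TARGETS (gen 3) — the 7 stubs of line `octet-cell-squeeze`: verbatim copies of its objects;
  `CellReading.pinned` / `not_cellReading_of_spread` / `opNorm_sq_le_of_columns` (Statement 4 is an
  inequality on the least-squares fit), `phiOct_even` / `nonaffine_strainedCell_pair_eq` (Statement 1 sees
  even orders only), `squeezeWindow_false_without_groundStates` (**C⁺ is FALSE without exact minimality**:
  fcc-lattice balls, `good_fccBall`, `hcp_reflection_far`); verdicts: Statements 5 and 7 true on paper
  (7 without the `k‖A_k − A_∞‖ → 0` device), 6 an implication whose conclusion needs minimality;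
  **Statement 2 MISSTATED** (metric-growth constant ½ fails at the band edge: true global constant ≈ 0.30,
  `Negative-notes-StrainLandscape.md`), Statement 1 survives with 5.4 % at the adversarial corner, Statement 3
  survives with 1.8× at the c/a corner of the 3 % ball, Statement 4's linearised sup ≈ 1.81·(a/20) < 2·(a/20)
  (margin ≈ 9 %, smoothed-ascent lower bound agreeing with the planner's NLP; exact SOCP = kit j010068–75, queued).

* §0 STRUCTURE — `crux_iff`, `crux_of_isCrystallizing`, `crux_of_crystallization` (the conjunct
  implies the crux: the hypothesis is needed for PROOF, not for TRUTH), `crux_of_not_zeroDefectDensity`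
  (a refutation of 13604 would close 13603 VACUOUSLY — provers beware), `not_crux_iff`
  (`¬crux ↔ ZeroDefectDensity ∧ ¬IsCrystallizing lennardJones 3`), `not_crystallization_of_not_crux`.
* §1 NON-VACUITY — `exists_groundState_sequence` (tree `LennardJonesGroundStatesExist_holds`).
* §2 THE PREDICATE UNBUNDLED (API + tightness) — `nbrs`/`shell`/`Good`/`defects` with
  `zeroDefectDensity_iff`, `crux_iff'` (definitional restatements); `card_nbrs_le`,
  `Good.twelve_le_card_nbrs`, `Good.card_nbrs_eq` (injective ⇒ exactly 12 neighbours within 6/5),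
  `not_good_of_le_twelve` + `defects_eq_of_le_twelve` (**N ≤ 12 ⇒ every site defective**, ratio 1: `H`
  is purely asymptotic), `dist_sub_le_of_shellCloseTo` + `Good.exists_annulus` (**radial pinning**: all
  neighbours within `6/5` of a good site lie in `[19a/20, 21a/20]`, hence in `[0.855, 1.155]`; the
  scale of a good site is determined within the factor `21/19`).
* §3 TRAP — `good_not_closed`: `Good` is NOT closed under limits of configurations (closed cutoff
  `6/5`: a 13th particle converging to distance `6/5` from outside; `trapConfig`). Hull lines
  (all three cards on file re-limit defect-free windows) must carry "limit of good shells" or the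
  open-cutoff variant, not the crux's predicate verbatim.
* §4 TYPE GAP — `not_fccClose_and_hcpClose`, `not_fccGood_and_hcpGood`: **no shell is both
  fcc-good and hcp-good**, even at different admissible scales (centrosymmetry of the cuboctahedron vs
  the point `p⋆` of the anticuboctahedron whose antipode is `1/√3` away from the pattern; integer
  arithmetic by `decide`). So every good site has a well-defined type — the first input of any robust
  layer/template lemma — and the proof shows the margin is huge (it survives any `η < 0.129`).
* §6 STRAIN BLINDNESS, EXACTLY — `norm_uniax_sub_sq` (the `ε/2` identity), `shellCloseTo_uniax`,
  `good_of_uniax_shell`: a uniaxially strained fcc/hcp shell with `−2/21 ≤ ε ≤ 2/19` (any axis) is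
  GOOD; `not_shellCloseTo_of_ratio`: two shell radii with ratio `> 21/19` make a site defective at
  every scale — so the window is sharp. `H` is blind to principal stretches in `[19/21, 21/19]`.
  Helper of independent use: `etaMatched_image_of_dist_le` / `shellCloseTo_image_of_dist_le`
  (a map moving each pattern point by `≤ η`, injective on the pattern, yields an `η`-close shell).
* §5 ICOSAHEDRAL SHELLS ARE CHARGED — `not_etaMatched_of_gap` (the √2-gap lemma: a shell of constant
  radius whose squared chords avoid `(6σ²/5, 13σ²/5)` is not `1/20`-close to any pattern of unit
  vectors with a `√2`-pair), `ico_shell_gap` (the regular icosahedron in the `ℤ[φ]` model `icoInt`,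
  chords `{4, 4+4φ, 8+4φ}` by `decide`), `not_shellCloseTo_ico_fcc/hcp`,
  `not_good_of_icosahedral_shell`: **an icosahedrally coordinated site is defective at EVERY scale and
  orientation** (re-proof of gen-1 §3). `H` therefore charges Mackay cores / Z12 Frank–Kasper order
  with full weight, as every card assumes; conversely (gen-1 §3b numerics) Mackay intra-grain shells
  are good, so `H` does not see multiply-twinned morphology away from the 5-fold axes.

## Numerics (this cycle; scripts in the disprover's folder `calc/`, pure python, reproducible)

* `calc/octa.py` — card octet-cell-squeeze's `OctahedronCoercivity`: reduced Hessian of `PhiOct`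
  on the 6-dim orthogonal complement of affine fields, eigenvalues `{3, 9}` (×3 each) at `a = 1`,
  `{6.695, 23.34}` at `0.95`, `{4.759, 15.73}` at `a* = 0.9712`, PD down to `a = 1.10` (`0.541`),
  indefinite from `a ≈ 1.12` (`−0.133` at `1.13`, `−0.448` at `1.155`); gradient ⟂ non-affine fields
  to `1e-11`. REPRODUCES the card's j005718 numbers exactly; cross terms affine×non-affine vanish at the
  regular octahedron by `O_h`-equivariance (complement = `T1u ⊕ T2u`, translations in `ker H`). The
  typed first lemma is numerically TRUE (not a target). NB the FULL Hessian is indefinite for `a < 1`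
  (`λ_min = −0.35` at `a*`): the cell functional alone is not at equilibrium at `a*`; only the
  transversal statement holds, as typed.
* `SitewiseEarliestReturn` (Ideator3Sketch): TRUE on paper (k-th return time ≥ 2k, ≥ 2k+1 once the
  first return is missed; antitone non-negative weights) — not a target. `PrestressSplit`
  (SketchIdeator1): an exact algebraic identity, TRUE (expand, swap the double sum by symmetry of `ω`,
  insert balance) — not a target.
* `calc/typegap.py typegap` — `min_{R ∈ SO(3), s ∈ [9/11, 11/9]} [d_B(cubo, s·R·anti) − (1+s)/20]
  = 0.274` (two seeds × 300 Nelder–Mead starts; raw bottleneck distance `0.3716` at `s = 0.947`):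
  the two admissible neighbourhoods are far apart (§4 proves disjointness with a cruder constant).
* `calc/typegap.py self*/global*` — FRAME PINNING: `min_axis d_B(P, R_θ·P) = 0.0166·θ/deg`
  (`θ ≤ 30°`, both patterns); over 6000 random rotations `d_B(P, R·P) ≤ 0.10 ⇒ dist(R, Sym P) ≤ 5.7°`
  (cubo, 24 rotations) / `5.3°` (anti, 6 rotations), and `d_B ≥ 0.56·dist(R, O)` (rad) globally for
  cubo. So the frame `A` of a good site is determined modulo `Sym(P)` within `≈ 6°` when read at one
  scale — the quantitative input a robust layer lemma / chaining argument ("rotation drift ≤ r·ε")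
  starts from. Not formalised (an ε-net over `SO(3)` would be needed).

## Record of generation 1 (evidence on the item, 2026-08-15T22:27Z–23:00Z; last sha 041b3cf7c55ac92d;
the file itself is not mounted in later seats' jails and was never crux-written — hence this rebuild)

* geometric bridge REFUTED: `DefectFreeCrystallizesWithoutGroundStates δ` (the crux with
  `IsGroundState` replaced by `injective ∧ δ-separated`) is FALSE for every `δ ≤ 1`, and so is the
  SHARP form with `#defective ≤ 108·N^{2/3}` in place of density `→ 0` — witness: index blocks of the
  2-adic-Hägg (period-doubling) close-packed Barlow stacking (exact fcc/hcp shells, defect ratio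
  `≤ 12/(2n+3) → 0`, no periodic local limit since a lattice period with non-zero stacking component
  would force the Hägg word periodic); it implies the crux for every LJ-valid `δ` (all `≤ 1`, fcc
  tetrahedron). LOAD-BEARING VERDICT (stands): any proof of 13603 must use EXACT MINIMALITY of the
  finite ground states to select the stacking; zero defect density + separation + any layer lemma
  provably cannot suffice. (1918 lines, sorry-free per the evidence note; core lemma
  `Witness.no_periodic_local_limit`; reusable `LocalLimit.*`, `Covering.exists_covering_radius`.)
* icosahedral 12-shell NOT `1/20`-close to fcc/hcp at ANY dilation (√2-gap): icosahedral sites are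
  charged by `H`; Mackay-icosahedron intra-grain shells ARE good at `1/20` (bottleneck `0.0386` at
  dilation `1.039`, margin `0.011`): `H` does not exclude multiply-twinned sequences (their local limits
  deep in a grain are uniformly strained fcc — periodic — so no kill), but a robust layer lemma must
  tolerate ≈ 7 % uniaxial compression and track an AFFINE (not scalar) local scale.
* matching reformulation: for LJ the Blanc–Lewin conclusion ⟺ eventual two-way ε-matching on balls
  of a translated subsequence with a periodic point set (multiplicity WLOG 1 by separation).

## Attempts that did NOT break the crux (why it resists)

* Junk audit of `IsCrystallizing lennardJones 3` as typed: `N = 0, 1` (energy `0 = ⨅ 0`), tsum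
  limit functional (finite on compact supports), `m ≥ 1` on a non-empty relatively dense set (kills
  the escape-to-infinity limit), translations only (rotations of the cluster are absorbed by
  compactness of `O(3)` into the CHOICE of `P`), adversarial choice among non-unique ground states
  (label permutations irrelevant; isometries absorbed; finitely many families handled by the
  subsequence) — no junk truth, no junk falsity found.
* The conclusion is WEAK (∃ subsequence ∃ translations ∃ P): `o(N)`-energy perturbations of a crystal
  (faults at spacing `L_N → ∞`, strain `→ 0`, `o(N)` dislocation length) never destroy ALL windows;
  destroying every window of radius `R` around every particle needs a positive density of "spoilers"
  (aperiodicity at bounded scale everywhere), i.e. an `O(N)` structural statement about exact ground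
  states — the Hägg/stacking-selection content (`J₂(LJ) ≈ −7e-5 < 0`, hcp-type gap) that no cheap
  witness can touch. Conversely a kill needs LJ ground states to be aperiodically stacked in EVERY
  window (kill criterion (d) of the route; then 0627 and the conjunct die too).
* Degenerate regimes: `N ≤ 12` all-defective (§2) — harmless, `H` is asymptotic; surface sites
  (fraction `~N^{-1/3}`) defective — harmless; vacancies make their 12 neighbours defective — `H`
  forces vacancy density `→ 0`, consistent with physics.
* Cards' first lemmas (`OctahedronCoercivity`, `SitewiseEarliestReturn`, `PrestressSplit`): all pass
  cheap checks (above). `DefectFreeLayered`, `WindowPinningUpper` quantify over ground states and are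
  not testable here; `WindowPinningUpper` is sign-consistent (`self(W) = n·e_loc − ½·cross`, cross
  `= −O(R²)`), and is insensitive to `e_∞ < e_per` (it only gets easier) — the e_per-optimality content
  of every line sits in its LOWER (coercivity) bound.

* `calc/strain.py` — STRAIN TOLERANCE of the predicate (best admissible rescale + rotation, in the
  crux's normalisation `d_B(T/a, A·P) ≤ 1/20`): a uniaxial strain `ε` keeps a shell good iff
  `−2/21 ≤ ε ≤ 2/19` (`−0.0952 / +0.1053` to 4 digits along all axes tested, both patterns) — PROVED
  in §6 below (sufficiency for every axis by the `ε/2` identity; necessity along pattern-vertex axes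
  by radial pinning); simple shears up to `γ ≈ 0.100–0.112`. CONSEQUENCE (bent all-good windows): a
  Barlow slab bent to curvature radius `ρ₀` is everywhere good while `|y|/ρ₀ ≤ 0.1` (strain gradient
  per bond `a/ρ₀` negligible), so an all-good ball of radius `R = ρ₀/10` deviates from EVERY affine
  image of a Barlow stacking by the sagitta `R²/(2ρ₀) = R/20` (after the best affine fit still
  `≈ R/40`), i.e. by a full lattice spacing once `R ≳ 40a`: **any robust layer/template lemma with an
  `R`-independent sup-displacement on all-good `B_R` is FALSE**; templates must be patchwise affine
  with frames turning at rate `≤ 1/ρ₀` (both hull cards are phrased that way; `DefectFreeLayered`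
  claims global planes only AFTER energetic exactification — consistent).
* `calc/altspacing.py` — interlayer spacings ALTERNATING `(1 ± δ)` (a gradient jump at EVERY
  layer, periodic, all sites good; crux-normalised tolerance): fcc read as (001) square layers
  `δ = 0.0707` (spacing ratio `1.152`); fcc (111)-ABC `δ = 0.0612` (ratio `1.130`); hcp AB
  `δ = 0.0584` (ratio `1.124`). In these configurations EVERY octahedron is non-affinely
  distorted (apex heights differ by `≈ 0.10a`): per-site scale/shape freedom is real at the 10 %
  level uniformly, not only as slow drift — the regime a cell certificate must cover or price.
* `calc/korn.py` — Bloch Korn-type constant of the fcc nearest-neighbour (octet) truss, the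
  potential-free constant card prestress-split-korn bets on: `sup_k λ_max(L(k))/λ_min(A(k)) = 8.000`
  (`A(k) = Σ_e (1 − cos k·e) ê êᵀ` axial, `L(k) = Σ_e (1 − cos k·e)·I` full relative displacement;
  attained as `k → 0` along `[110]`, the soft `T₂[110]` shear of the central-force fcc crystal,
  `C' = C₄₄/2`), i.e. `1 + K_⊥ ≤ 8` for periodic fields on the Bravais fcc truss; the hcp truss
  (2-atom basis, generalised pencil `sup_u uᴴLu/uᴴAu` by Cholesky, `calc/korn_hcp.py`) gives the
  same `8.000` (`k → 0` basal; `6.000` along the c-axis). Far inside the card's budget (`≈ 15–45`):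
  a SUPPORT for that line's feasibility, not a target (finite balls with boundary and non-ideal
  `c/a` not computed).
* LITERATURE (searchd rc 75 all cycle; arXiv reachable): Pártay–Ortner–Bartók–Csányi 2017,
  *Polytypism in the ground state structure of the Lennard-Jonesium* (arXiv:1705.01751 = PCCP
  doi:10.1039/c7cp02923c), §3, materialised p0005 L13–16: "the hcp structure tends to be the most
  favourable stacking variant at lower pressure values, while for every value of the cutoff there
  is a pressure above which the fcc is the most stable polytype"; other polytypes (⟨hc⟩, ⟨hhc⟩,
  ⟨hhcc⟩, …) are ground states only for TRUNCATED potentials near the fcc/hcp boundary.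
  Loach–Ackland 2017, *Stacking characteristics of close packed materials* (PRL 119, 205701 =
  arXiv:1708.01460), materialised p0004 L91–96: "As r_cut → ∞, H2 converges to a value of around
  −0.0009ε, which accounts for most of the difference in energy between the fcc and hcp phases,
  while H3 converges to a value two orders of magnitude smaller, indicating a stable hcp ground
  state" — in Blanc–Lewin units (`ε = 1/12`… per-atom bookkeeping) this is the cards' `ΔJ₂ =
  −7.25e-5` (`× 12 = −8.7e-4 ε`): the stacking-selection margin every line spends MATCHES PRINT. So
  print offers no support for kill criterion (d) (aperiodically stacked optimal LJ at zero pressure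
  with the full `r⁻⁶` tail): the physical expectation behind `C` stands (hcp, `J₂ < 0`, gap ~|J₂|).

* `calc/spiral.py` — UNBOUNDED ORIENTATION WINDING in an everywhere-good configuration: the image
  of fcc under `x ↦ R_z(ε·log(1 + |x|/r₀))·x` has strain `≤ ε` uniformly (`dist(Df, SO(3)) =
  ε·r/(r+r₀) ≤ ε`; F. John's `ε·log` rotation drift realised) while the local frame turns by
  `ε·log(1 + r/r₀) → ∞`. Check (`ε = 0.06`, `r₀ = 2`, fcc ball of 5089 sites): ALL 2587 interior
  sites are `1/20`-good (worst best-fit `d_B = 0.0255 ≈ ε/2`), frame rotated `5.9°` at `r = 9`,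
  `45°` by `r = 10⁶`, unbounded beyond; at `ε = 0.09` still ALL 2587 good (worst `0.0397`), `8.8°` at
  `r = 9`, `68°` by `10⁶`.

## The three geometric freedoms `H` leaves open (summary of the numerics; all must be closed by
## ENERGY, i.e. by exact minimality — sharpening gen-1's load-bearing verdict beyond stacking)

(i) BENDING: all-good `B_R` deviating from every affine Barlow image by `≈ R/40` (strain budget
10 %); (ii) SPACING JUMPS: periodic all-good configurations with interlayer spacing ratio up to
`1.13–1.15` alternating at every layer (every cell non-affine by `0.10a`); (iii) WINDING: infinite
everywhere-good configurations whose orientation drifts like `ε log r` without bound. None of them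
is a perturbation that the crux's HYPOTHESIS sees; each carries a positive strain-energy DENSITY
(`~ modulus·ε²` per site), so the squeeze `E(N) ≤ N·e_per + C·N^{2/3}` kills them in hull elements
— but only through an energy inequality that is uniform over exactly these configurations (the
own-word / cell / prestress coercivity statements), never through geometry. A template lemma may
therefore only assert: patchwise affine, frames Lipschitz with constant `O(η)/a` per bond and
`o(1)` per bond ONLY after energetic exactification; a global word `s` exists on all-good `B_R` at
best on a concentric `B_{R/2}` (two non-parallel hcp-type sheets through `B_{R/2}` would cross
inside `B_R`, where the crossing line is defective), and globally on hull elements only.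

## Open numerics / next attacks

* card octet-cell-squeeze's own NEXT falsifier (LocalCellStar NLP: worst octahedral non-affinity
  over 13-site all-good clusters; the alternating-spacing family above already gives `0.10a`) — a
  kit job if the lead picks that line.
* literature (searchd rc 75 throughout this cycle): Partay–Ortner–Csányi 2017 polytypism for
  TRUNCATED LJ vs hcp for the full tail; Loach–Ackland 2017 stacking couplings — the only physical
  route to ¬C (kill criterion (d)).
-/

noncomputable section

namespace Summit.AtomisticToContinuum.Crystallization.Cruxes.DefectFreeCrystallizes.Disproof

open Summit.AtomisticToContinuum.Crystallization.Theses.ReggeStarCoercivity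
open Literature.MathematicalPhysics.StatisticalMechanics Literature.Geometry.DiscreteGeometry
open Summit.AtomisticToContinuum.Crystallization.Theorems.DefectFreeCrystallizes.Negative
open scoped InnerProductSpace
open Filter Topology

local notation "E3" => EuclideanSpace ℝ (Fin 3)

/-! ## §0 Structure of the crux -/

/-- The crux is literally `ZeroDefectDensity → IsCrystallizing lennardJones 3`. [folklore] -/
theorem crux_iff :
    DefectFreeCrystallizes ↔ (ZeroDefectDensity → IsCrystallizing lennardJones 3) := Iff.rfl

/-- The positional half of the conjunct implies the crux outright (the hypothesis is not needed
for TRUTH, only for PROOF). [folklore] -/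
theorem crux_of_isCrystallizing (h : IsCrystallizing lennardJones 3) : DefectFreeCrystallizes :=
  fun _ => h

/-- The sub-problem statement implies the crux. [folklore] -/
theorem crux_of_crystallization (h : _root_.Crystallization) : DefectFreeCrystallizes :=
  crux_of_isCrystallizing h.2

/-- A refutation of the sibling item `ZeroDefectDensity` (13604) would close the crux VACUOUSLY.
[folklore] -/
theorem crux_of_not_zeroDefectDensity (h : ¬ ZeroDefectDensity) : DefectFreeCrystallizes :=
  fun hH => absurd hH h

/-- What a kill of the crux is: `ZeroDefectDensity` (open, XL) AND the failure of Blanc–Lewin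
crystallization for Lennard-Jones in `ℝ³` (open). [folklore] -/
theorem not_crux_iff :
    ¬ DefectFreeCrystallizes ↔ (ZeroDefectDensity ∧ ¬ IsCrystallizing lennardJones 3) := by
  rw [crux_iff, Classical.not_imp]

/-- In particular a kill of the crux refutes the sub-problem `Crystallization`. [folklore] -/
theorem not_crystallization_of_not_crux (h : ¬ DefectFreeCrystallizes) : ¬ _root_.Crystallization :=
  fun hC => h (crux_of_crystallization hC)

/-! ## §1 Non-vacuity: the hypothesis quantifies over a non-empty set of sequences -/

/-- Lennard-Jones ground-state sequences exist (tree: `LennardJonesGroundStatesExist_holds`), so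
neither `ZeroDefectDensity` nor `IsCrystallizing lennardJones 3` is vacuously true. [folklore] -/
theorem exists_groundState_sequence :
    ∃ x : (N : ℕ) → (Fin N → E3), ∀ N, IsGroundState lennardJones (x N) :=
  ⟨fun N => (LennardJonesGroundStatesExist_holds N).choose,
    fun N => (LennardJonesGroundStatesExist_holds N).choose_spec⟩


/-! ## §2 The defect predicate, unbundled (API every line needs; verbatim the crux's sub-expression) -/

section Predicate

variable {N : ℕ}

/-- Indices of the other particles within distance `6/5` of particle `i` (the crux's filter). -/
def nbrs (x : Fin N → E3) (i : Fin N) : Finset (Fin N) :=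
  Finset.univ.filter fun j : Fin N => j ≠ i ∧ dist (x i) (x j) ≤ 6 / 5

/-- The recentred first shell of `i`, rescaled by `a⁻¹` (the crux's image). -/
def shell (x : Fin N → E3) (i : Fin N) (a : ℝ) : Finset E3 :=
  (nbrs x i).image fun j => a⁻¹ • (x j - x i)

/-- Site `i` is GOOD (non-defective) in the sense of the crux: some admissible scale `a ∈ [9/10, 11/10]`
makes its rescaled shell `1/20`-close, after a linear isometry, to the fcc or the hcp kissing pattern. -/
def Good (x : Fin N → E3) (i : Fin N) : Prop :=
  ∃ a : ℝ, 9 / 10 ≤ a ∧ a ≤ 11 / 10 ∧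
    (ShellCloseTo (1 / 20) (shell x i a) fccKissingPattern ∨
      ShellCloseTo (1 / 20) (shell x i a) hcpKissingPattern)

/-- Number of defective sites. -/
def defects (x : Fin N → E3) : ℕ := Nat.card {i : Fin N // ¬ Good x i}

/-- `ZeroDefectDensity` restated through `defects` (definitional). [folklore] -/
theorem zeroDefectDensity_iff :
    ZeroDefectDensity ↔ ∀ x : (N : ℕ) → (Fin N → E3), (∀ N, IsGroundState lennardJones (x N)) →
      Tendsto (fun N : ℕ => (defects (x N) : ℝ) / N) atTop (𝓝 0) :=
  Iff.rfl

/-- The crux restated through `defects` (definitional). [folklore] -/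
theorem crux_iff' :
    DefectFreeCrystallizes ↔
      ((∀ x : (N : ℕ) → (Fin N → E3), (∀ N, IsGroundState lennardJones (x N)) →
        Tendsto (fun N : ℕ => (defects (x N) : ℝ) / N) atTop (𝓝 0)) →
      IsCrystallizing lennardJones 3) :=
  Iff.rfl

/-- A site has at most `N - 1` neighbours. [folklore] -/
theorem card_nbrs_le (x : Fin N → E3) (i : Fin N) : (nbrs x i).card ≤ N - 1 := by
  have h : nbrs x i ⊆ Finset.univ.erase i := by
    intro j hj
    simp only [nbrs, Finset.mem_filter, Finset.mem_univ, true_and] at hj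
    exact Finset.mem_erase.2 ⟨hj.1, Finset.mem_univ j⟩
  calc (nbrs x i).card ≤ (Finset.univ.erase i).card := Finset.card_le_card h
    _ = N - 1 := by rw [Finset.card_erase_of_mem (Finset.mem_univ i), Finset.card_univ, Fintype.card_fin]

/-- The rescaled shell has at most as many points as there are neighbours. [folklore] -/
theorem card_shell_le (x : Fin N → E3) (i : Fin N) (a : ℝ) : (shell x i a).card ≤ (nbrs x i).card :=
  Finset.card_image_le

/-- For an injective configuration and `a ≠ 0` the shell has exactly as many points as there are
neighbours. [folklore] -/
theorem card_shell_eq {x : Fin N → E3} (hx : Function.Injective x) (i : Fin N) {a : ℝ} (ha : a ≠ 0) :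
    (shell x i a).card = (nbrs x i).card := by
  apply Finset.card_image_of_injective
  intro j k hjk
  have : x j - x i = x k - x i := smul_right_injective E3 (inv_ne_zero ha) hjk
  exact hx (sub_left_injective this)

/-- A good site has a twelve-point rescaled shell at its admissible scale. [folklore] -/
theorem Good.exists_card_eq {x : Fin N → E3} {i : Fin N} (h : Good x i) :
    ∃ a : ℝ, 9 / 10 ≤ a ∧ a ≤ 11 / 10 ∧ (shell x i a).card = 12 ∧
      (ShellCloseTo (1 / 20) (shell x i a) fccKissingPattern ∨
        ShellCloseTo (1 / 20) (shell x i a) hcpKissingPattern) := by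
  obtain ⟨a, ha₁, ha₂, h⟩ := h
  exact ⟨a, ha₁, ha₂, card_eq_twelve_of_shellCloseTo h, h⟩

/-- A good site has at least twelve neighbours within `6/5`. [folklore] -/
theorem Good.twelve_le_card_nbrs {x : Fin N → E3} {i : Fin N} (h : Good x i) :
    12 ≤ (nbrs x i).card := by
  obtain ⟨a, -, -, hc, -⟩ := h.exists_card_eq
  exact hc ▸ card_shell_le x i a

/-- A good site of an INJECTIVE configuration has exactly twelve neighbours within `6/5`. [folklore] -/
theorem Good.card_nbrs_eq {x : Fin N → E3} (hx : Function.Injective x) {i : Fin N} (h : Good x i) :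
    (nbrs x i).card = 12 := by
  obtain ⟨a, ha₁, -, hc, -⟩ := h.exists_card_eq
  rwa [card_shell_eq hx i (by linarith : a ≠ 0)] at hc

/-- **Small systems are all-defective**: with `N ≤ 12` particles no site is good (a shell has at
most `N - 1 ≤ 11 < 12` points). So the defect RATIO is `1` for `1 ≤ N ≤ 12`: the hypothesis `H` is
purely asymptotic. [folklore] -/
theorem not_good_of_le_twelve (hN : N ≤ 12) (x : Fin N → E3) (i : Fin N) : ¬ Good x i := by
  intro h
  have h12 := h.twelve_le_card_nbrs
  have := card_nbrs_le x i
  omega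

/-- Hence `defects x = N` whenever `N ≤ 12`. [folklore] -/
theorem defects_eq_of_le_twelve (hN : N ≤ 12) (x : Fin N → E3) : defects x = N := by
  unfold defects
  rw [Nat.card_congr (Equiv.subtypeUnivEquiv (not_good_of_le_twelve hN x)), Nat.card_eq_fintype_card,
    Fintype.card_fin]

/-- **Radial pinning of a good shell**: if the rescaled shell is `η`-close to a pattern of UNIT
vectors, every neighbour within `6/5` sits at distance within `a·η` of `a` (for `a > 0`). [folklore] -/
theorem dist_sub_le_of_shellCloseTo {x : Fin N → E3} {i : Fin N} {a η : ℝ} (ha : 0 < a)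
    {P : Finset E3} (hP : ∀ p ∈ P, ‖p‖ = 1) (h : ShellCloseTo η (shell x i a) P)
    {j : Fin N} (hj : j ∈ nbrs x i) : |dist (x j) (x i) - a| ≤ a * η := by
  obtain ⟨A, e, he⟩ := h
  have ht : a⁻¹ • (x j - x i) ∈ shell x i a := Finset.mem_image_of_mem _ hj
  set q : E3 := (e ⟨_, ht⟩ : E3) with hq
  have hqmem : q ∈ P.image A := (e ⟨_, ht⟩).2
  obtain ⟨p, hp, hpq⟩ := Finset.mem_image.1 hqmem
  have hqn : ‖q‖ = 1 := by rw [← hpq, A.norm_map, hP p hp]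
  have h1 : |‖a⁻¹ • (x j - x i)‖ - ‖q‖| ≤ η :=
    (abs_norm_sub_norm_le _ _).trans (by simpa [dist_eq_norm, hq] using he ⟨_, ht⟩)
  rw [hqn, norm_smul, norm_inv, Real.norm_of_nonneg ha.le] at h1
  rw [dist_eq_norm]
  have hmul := mul_le_mul_of_nonneg_left h1 ha.le
  rw [← abs_of_pos ha, ← abs_mul, abs_of_pos ha] at hmul
  have : a * (a⁻¹ * ‖x j - x i‖ - 1) = ‖x j - x i‖ - a := by field_simp
  rwa [this] at hmul

/-- For a good site: all neighbours within `6/5` lie in the annulus `[19a/20, 21a/20]` about it, for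
its admissible scale `a`; in particular in `[0.855, 1.155]`. [folklore] -/
theorem Good.exists_annulus {x : Fin N → E3} {i : Fin N} (h : Good x i) :
    ∃ a : ℝ, 9 / 10 ≤ a ∧ a ≤ 11 / 10 ∧
      ∀ j ∈ nbrs x i, 19 / 20 * a ≤ dist (x j) (x i) ∧ dist (x j) (x i) ≤ 21 / 20 * a := by
  obtain ⟨a, ha₁, ha₂, h⟩ := h
  refine ⟨a, ha₁, ha₂, fun j hj => ?_⟩
  have ha : 0 < a := by linarith
  have key : |dist (x j) (x i) - a| ≤ a * (1 / 20) := by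
    rcases h with h | h
    · exact dist_sub_le_of_shellCloseTo ha (fun p hp => norm_eq_one_of_mem_fccKissingPattern hp) h hj
    · exact dist_sub_le_of_shellCloseTo ha (fun p hp => norm_eq_one_of_mem_hcpKissingPattern hp) h hj
  rw [abs_le] at key
  constructor <;> linarith [key.1, key.2]

/-- What `H` does NOT constrain (recorded for provers): membership in `nbrs` is the CLOSED condition
`dist ≤ 6/5` and matching is the CLOSED condition `≤ 1/20`, but `Good` is NOT closed under limits of
configurations — see `good_not_closed` below: a thirteenth particle approaching distance `6/5` from
outside keeps the site good and makes the limit defective. [folklore] -/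
theorem mem_nbrs_iff {x : Fin N → E3} {i j : Fin N} :
    j ∈ nbrs x i ↔ j ≠ i ∧ dist (x i) (x j) ≤ 6 / 5 := by
  simp [nbrs]

end Predicate


/-! ## §3 `Good` is not closed under limits of configurations (bookkeeping trap for hull lines)

Every line on file (own-word-squeeze, octet-cell-squeeze, prestress-split-korn) passes to LOCAL
LIMITS (hull elements) of defect-free windows. The crux's predicate has a CLOSED outer cutoff
`dist ≤ 6/5`: a thirteenth particle converging to distance exactly `6/5` from outside keeps the site
good at every stage and makes the LIMIT site defective (13 points within `6/5`; radial pinning then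
needs a scale `a ≥ 8/7 > 11/10`). So "everywhere good" is NOT inherited by hull elements verbatim;
what is inherited is goodness with the open cutoff `dist < 6/5` (or: being a limit of good shells).
The witness below is the fcc shell at scale `1` plus one extra particle on a ray. -/

section Trap

/-- The twelve fcc integer vectors, enumerated (same order as `fccInt`). -/
def fccList : Fin 12 → (Fin 3 → ℤ) :=
  ![![1, 1, 0], ![1, -1, 0], ![-1, 1, 0], ![-1, -1, 0], ![1, 0, 1], ![1, 0, -1], ![-1, 0, 1],
    ![-1, 0, -1], ![0, 1, 1], ![0, 1, -1], ![0, -1, 1], ![0, -1, -1]]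

theorem fccInt_eq_image : fccInt = Finset.univ.image fccList := by decide

/-- The twelve fcc kissing points, enumerated. -/
def fccPt (k : Fin 12) : E3 := (Real.sqrt (2 : ℕ))⁻¹ • intVec (fccList k)

theorem fccKissingPattern_eq_image : fccKissingPattern = Finset.univ.image fccPt := by
  rw [fccKissingPattern, scaledPattern, fccInt_eq_image, Finset.image_image]
  rfl

theorem fccPt_mem (k : Fin 12) : fccPt k ∈ fccKissingPattern := by
  rw [fccKissingPattern_eq_image]; exact Finset.mem_image_of_mem _ (Finset.mem_univ k)

theorem norm_fccPt (k : Fin 12) : ‖fccPt k‖ = 1 :=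
  norm_eq_one_of_mem_fccKissingPattern (fccPt_mem k)

/-- The trap family: particle `0` at the origin, particles `1..12` on the unit fcc shell, particle
`13` at distance `6/5 + t` on the ray through `fccPt 0`. -/
def trapConfig (t : ℝ) : Fin 14 → E3 := fun j =>
  if h0 : j.1 = 0 then 0 else if h13 : j.1 = 13 then ((6 : ℝ) / 5 + t) • fccPt 0
    else fccPt ⟨j.1 - 1, by omega⟩

@[simp] theorem trapConfig_zero (t : ℝ) : trapConfig t 0 = 0 := by simp [trapConfig]

theorem trapConfig_thirteen (t : ℝ) : trapConfig t 13 = ((6 : ℝ) / 5 + t) • fccPt 0 := by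
  simp [trapConfig]

theorem trapConfig_of_ne (t : ℝ) {j : Fin 14} (h0 : j.1 ≠ 0) (h13 : j.1 ≠ 13) :
    trapConfig t j = fccPt ⟨j.1 - 1, by omega⟩ := by
  simp [trapConfig, h0, h13]

theorem continuous_trapConfig : Continuous trapConfig := by
  refine continuous_pi fun j => ?_
  by_cases h0 : j.1 = 0
  · simp only [trapConfig, h0]; exact continuous_const
  by_cases h13 : j.1 = 13
  · simp only [trapConfig, h13, dite_true]
    exact (continuous_const.add continuous_id).smul continuous_const
  · simp only [trapConfig, h0, h13, dite_false]; exact continuous_const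

theorem dist_trapConfig_thirteen (t : ℝ) (ht : 0 ≤ t) :
    dist (trapConfig t 0) (trapConfig t 13) = 6 / 5 + t := by
  rw [trapConfig_zero, trapConfig_thirteen, dist_eq_norm, zero_sub, norm_neg, norm_smul, norm_fccPt,
    mul_one, Real.norm_of_nonneg (by positivity)]

theorem dist_trapConfig_of_ne (t : ℝ) {j : Fin 14} (h0 : j.1 ≠ 0) (h13 : j.1 ≠ 13) :
    dist (trapConfig t 0) (trapConfig t j) = 1 := by
  rw [trapConfig_zero, trapConfig_of_ne t h0 h13, dist_eq_norm, zero_sub, norm_neg, norm_fccPt]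

/-- For `t > 0` the `6/5`-neighbourhood of particle `0` is exactly the fcc shell `1..12`. -/
theorem nbrs_trapConfig (t : ℝ) (ht : 0 < t) :
    nbrs (trapConfig t) 0 = Finset.univ.filter fun j : Fin 14 => j.1 ≠ 0 ∧ j.1 ≠ 13 := by
  ext j
  simp only [mem_nbrs_iff, Finset.mem_filter, Finset.mem_univ, true_and]
  by_cases h0 : j.1 = 0
  · have : j = 0 := Fin.ext h0
    simp [this]
  by_cases h13 : j.1 = 13
  · have : j = 13 := Fin.ext h13
    subst this
    rw [dist_trapConfig_thirteen t ht.le]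
    constructor
    · intro h; linarith [h.2]
    · intro h; exact absurd rfl h.2
  · rw [dist_trapConfig_of_ne t h0 h13]
    have hj : j ≠ 0 := fun h => h0 (by rw [h]; rfl)
    simp only [ne_eq, hj, not_false_eq_true, true_and, h0, h13, and_self, iff_true]
    norm_num

/-- For `t > 0` the shell of particle `0` at scale `1` IS the fcc kissing pattern. -/
theorem shell_trapConfig (t : ℝ) (ht : 0 < t) : shell (trapConfig t) 0 1 = fccKissingPattern := by
  rw [shell, nbrs_trapConfig t ht, fccKissingPattern_eq_image]
  ext q
  simp only [Finset.mem_image, Finset.mem_filter, Finset.mem_univ, true_and, inv_one, one_smul,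
    trapConfig_zero, sub_zero]
  constructor
  · rintro ⟨j, ⟨h0, h13⟩, rfl⟩
    exact ⟨⟨j.1 - 1, by omega⟩, (trapConfig_of_ne t h0 h13).symm⟩
  · rintro ⟨k, rfl⟩
    refine ⟨⟨k.1 + 1, by omega⟩, ⟨by simp, by simp; omega⟩, ?_⟩
    rw [trapConfig_of_ne t (by simp) (by simp; omega)]
    congr 1

/-- Along the family, particle `0` is GOOD for every `t > 0` (scale `1`, identity isometry). -/
theorem good_trapConfig (t : ℝ) (ht : 0 < t) : Good (trapConfig t) 0 :=
  ⟨1, by norm_num, by norm_num, Or.inl (by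
    rw [shell_trapConfig t ht]; exact ShellCloseTo.refl (by norm_num) _)⟩

/-- … but in the LIMIT `t = 0` particle `0` is DEFECTIVE: particle `13` is a thirteenth neighbour at
distance exactly `6/5`, which radial pinning would put in `[19a/20, 21a/20]`, forcing `a ≥ 8/7`. -/
theorem not_good_trapConfig_zero : ¬ Good (trapConfig 0) 0 := by
  intro h
  obtain ⟨a, -, ha₂, hann⟩ := h.exists_annulus
  have hmem : (13 : Fin 14) ∈ nbrs (trapConfig 0) 0 := by
    rw [mem_nbrs_iff, dist_trapConfig_thirteen 0 le_rfl]
    exact ⟨by decide, by norm_num⟩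
  have := (hann 13 hmem).2
  rw [dist_comm, dist_trapConfig_thirteen 0 le_rfl] at this
  linarith

/-- **`Good` is not closed.** A continuous one-parameter family of 14-particle configurations whose
particle `0` is good for all `t > 0` and defective at `t = 0`. Consequence for hull lines: local
limits of everywhere-good windows need not be everywhere-good for the crux's predicate verbatim
(closed cutoff `6/5`); carry "limit of good shells" or the open-cutoff variant instead. [folklore] -/
theorem good_not_closed :
    ∃ x : ℝ → (Fin 14 → E3), Continuous x ∧ (∀ t, 0 < t → Good (x t) 0) ∧ ¬ Good (x 0) 0 :=
  ⟨trapConfig, continuous_trapConfig, good_trapConfig, not_good_trapConfig_zero⟩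

end Trap
/-! ## §4–§6 (LANDED, imported): type gap, icosahedral shells are charged, strain blindness

v14: the Lean content of §4 (`Negative/TypeGap.lean`, p71052: `not_fccClose_and_hcpClose`, `not_fccGood_and_hcpGood`), §5
(`Negative/IcosahedralShellsCharged.lean`, p71123: `ico_shell_gap`, `not_good_of_icosahedral_shell`) and §6
(`Negative/StrainBlindness.lean`, p71155: `shellCloseTo_uniax`, `good_of_uniax_shell`, `not_shellCloseTo_of_ratio`) is no longer
copied here — import those modules (this file does).  Summary of the facts: at tolerance `1/20` no shell is both fcc-close and
hcp-close (at any two admissible scales); an icosahedral 12-shell is defective at every scale and orientation (no chord can play the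
`√2` diagonal); a uniaxially strained pattern shell is good for every stretch in `[19/21, 21/19]` and this window is sharp. -/



/-! ## §7 TARGETS — the registered stubs of line `octet-cell-squeeze` (gen 3)

The lead's skeleton `Cruxes/DefectFreeCrystallizes/Lines/octet-cell-squeeze.lean` (7 stubs; the module has no
olean, so its objects are copied VERBATIM below under `Disproof.OctetCellSqueeze`).  Refuter verdicts so far:

* `stub_windowPinning` (Statement 5) — TRUE on paper, no degenerate escape (`N = 0`, `R ≥ 1` force only `C ≥ 0`;
  `e(Q) > 0` trivial; `−cross ≤ C R²` needs only the attractive tail + `1/3`-separation).  Not a target.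
* `stub_transfer` (Statement 7) — TRUE on paper.  NB the skeleton's device "subsequence with `k‖A_k − A_∞‖ → 0`"
  is NOT available in general (`θ_k = 1/log k` has no such subsequence) and is not needed: matching on each FIXED
  ball `B(0, ρ)` costs `ε_j + (6/5)ρ‖A_j − A_∞‖ → 0`.  Not a target.
* `stub_squeeze` (Statement 6) — an implication; its conclusion `SqueezeWindow` (C⁺) is FALSE WITHOUT
  `IsGroundState`: `squeezeWindow_false_without_groundStates` below (fcc-lattice balls; hcp is not closed under
  reflection through an interlayer neighbour).  So C⁺'s hcp-exactness is carried entirely by exact minimality via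
  Statements 3 + 5, and the line bets that `R(ε, r)` exceeds the largest all-good fcc ball of ANY LJ ground state
  (physically `~ Δγ_surface/|J₂| ~ 10²–10³` spacings; fcc / Marks-decahedral morphologies are the expected cluster
  minima up to `N ~ 10⁵–10⁷`) — the size of its own constant `C_Q/γ'`.
* `stub_localCellStar` (Statement 4) — `CellReading.pinned`: a cell reading is PINNED by the six points (the band
  map's columns are the diagonals, the residual at both ends of diagonal `j` is `mids p j − cen p`), so the clause is
  the inequality `2 Σ_j ‖mids_j − cen‖² ≤ (‖G_LS‖/10)²` on the least-squares fit; `not_cellReading_of_spread`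
  (Frobenius test) and `opNorm_sq_le_of_columns` (sharp operator-norm certificate) are the refutation handles.
  Paper analysis: `nonaff² = (4/3)|D|² + 4|Δ|²` with `|Δ| ≤ a/20` from the centre's goodness ALONE, so an
  idealised pure Δ-mode saturates `‖G‖/10` EXACTLY; realisable families reach `0.067–0.09` (planner NLP `0.0907`).
  NUMERICS (`calc/local/cellstar_pure.py`, smoothed p-norm ascent on the linearised problem = a LOWER bound on its sup;
  12–14 starts incl. Δ/D-mode seeds): best ratio `nonaff/(a/20)` = 1.812 (fcc, only the 6 cell vertices constrained), 1.811
  (fcc, all 87 sites within 2.5 constrained), 1.810–1.823 (hcp) versus the stub's 2 — i.e. ≈ 0.0906·‖G‖ vs ‖G‖/10, the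
  planner's nonlinear NLP value (0.098 at ‖G‖ = 1.08 ⇒ 1.815) reproduced by an independent method; the optimal mode is the
  cyclic T1u⊕T2u pattern `m_k ≈ 0.60 e_k ± 0.30 (e_{k+1}, e_{k+2})`; the pure Δ-mode is capped at 4/3 by the equatorial
  vertices' own goodness.  VERDICT: survives, margin ≈ 9 % (exact SOCP = kit jobs j010068/70/74/75, queued).  Uniqueness
  clause: the nearest spurious cell in fcc (centre = midpoint of a `√3a` pair: diagonals `{0.866, 0.866, 0.5}·a`)
  is excluded by the band's LOWER edge with 4 % margin (`0.707·a_loc ≤ 0.817 < 17/20`), not by a "ratio √3" argument.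
* `stub_octahedronCoercivity` (Statement 1) — `phiOct_even` + `nonaffine_strainedCell_pair_eq`: along every
  admissible `v` the functional is EVEN (`PhiOct(q − v) = PhiOct(q + v)`), so the certificate has no odd orders and is
  decided by `½λ_min` of the reduced Hessian plus quartic terms on the tube.  NUMERICS (`calc/local/octa_pure.py`,
  `octa_adv.py`): spectra `{6.695, 23.34}` (a = 0.95), `{4.759, 15.73}` (a*), `{3, 9}` (a = 1), `{2.178, 5.96}` (1.02),
  indefinite from a ≈ 1.12 — the card's digits; adversarial symmetric `E` (27 sign patterns × 66 orientations + refinement):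
  WORST `½λ_min = 1.0536` at a = 1, eig(E) = (+0.02, +0.02, −0.02) oblique (dilation +0.02: 1.089; xy-shear: 1.081); the
  quartic is POSITIVE along the soft modes (g rises 1.0565 → 1.129 across the tube), so `min g = 1.054 ≥ 1`: SURVIVES with
  5.4 % margin (not 15 %); a ≤ 0.99 gives ≥ 1.23; beyond the band dilation 0.03: 0.93 (hand-over must stay at 2 %).
* `stub_strainLandscape` (Statement 2) — **MISSTATED (numerically false as pinned)**: `W(G) − W(G₀) ≥ ½‖GᵀG − G₀ᵀG₀‖_op²`
  FAILS at the band edge for basal / oblique UNIAXIAL stretches (LJ softens under stretch; the operator norm only sees the most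
  strained axis).  hcp frame (x = u, z = c): C₀ = diag(0.94337, 0.94337, 0.94311), W₀ = −0.717590; G₁ = diag(1.2, 0.9, 0.95):
  W − W₀ = 0.0807 < 0.1233 (ratio 0.327); worst found: stretches (1.2 at 33° off c, 0.960, 0.877): W − W₀ = 0.0740 vs 0.1234
  (F = −0.0494, ratio 0.300); onset at basal s ≈ 1.12; c-axis stretch stays feasible (0.55 at 1.2); cutoffs 11/13/15 agree to
  1e-6 (`calc/local/landscape_pure.py`, `uniax_scan.py`, `witness2.py`; evidence `Negative-notes-StrainLandscape.md`).  True
  global constant ≈ 0.30 (repair `c = 1/4`, or band ≤ 1.08, or two-regime: local ratios at C₀ are dilation 6.96, basal-dev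
  2.00, xy-shear 2.04, basal shear 1.51 (= the plan's 1.52), axial 1.62 → 1.28 at 10 %).  KERNEL-CHECKED MODULO NUMERICS:
  `strainLandscape_false_of_energyBounds : EnergyBounds → ¬ StrainLandscape` (three certified lattice-sum bounds; the clause
  at the isotropic point confines the minimiser's metric, the clause at the basal stretch then needs 0.1003 > 0.0845).  No
  structural kill otherwise (hcp-preserving non-isometric linear maps have distortion ≥ 3 > 1.412).  NB as pinned,
  `stub_squeeze` becomes provable from `¬ stub_strainLandscape` by absurdity — re-pin Statement 2 before Statement 6.
* `stub_registryLandscape` (Statement 3) — SURVIVES on the 3 % ball: D₂(G₀) = −7.27e-5, D₃ = −8.6e-8, D₄ = −1.1e-9 (the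
  plan's J's); worst corner c +3 % & a −3 %: D₂ = −3.55e-5 ⇒ one-sided gap 1.77e-5 ≥ 1e-5 (1.8×, not ≥ 2×); basal shears
  change D₂ by < 12 % and the B/C asymmetry is 3e-10 (third order, as the 3-fold symmetry predicts); |D₂| ≫ |D₃| ≫ |D₄| at
  every sample (majorisation hypothesis intact).  A 4 % ball would fail (c/a +8 %: gap 1.3e-5; +10 %: 0.95e-5).  Full 3-D
  sitewise sums over 11 Hägg words = kit j010160 (queued).
-/

section Targets

namespace OctetCellSqueeze


/-! ### Verbatim copies of the line's objects (`Lines/octet-cell-squeeze.lean` has no olean) -/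

/-- [verbatim copy of the line's `octVertex`] -/
def octVertex (a : ℝ) : Fin 6 → E3 :=
  ![ (a / Real.sqrt 2) • EuclideanSpace.single (0 : Fin 3) (1 : ℝ),
    -((a / Real.sqrt 2) • EuclideanSpace.single (0 : Fin 3) (1 : ℝ)),
     (a / Real.sqrt 2) • EuclideanSpace.single (1 : Fin 3) (1 : ℝ),
    -((a / Real.sqrt 2) • EuclideanSpace.single (1 : Fin 3) (1 : ℝ)),
     (a / Real.sqrt 2) • EuclideanSpace.single (2 : Fin 3) (1 : ℝ),
    -((a / Real.sqrt 2) • EuclideanSpace.single (2 : Fin 3) (1 : ℝ)) ]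

/-- [verbatim copy of the line's `PhiOct`] -/
def PhiOct (p : Fin 6 → E3) : ℝ :=
  (1 / 2) * (∑ i : Fin 6, ∑ j ∈ Finset.Ioi i, lennardJones (dist (p i) (p j))) +
  (1 / 2) * (lennardJones (dist (p 0) (p 1)) + lennardJones (dist (p 2) (p 3)) +
    lennardJones (dist (p 4) (p 5)))

/-- [verbatim copy of the line's `IsNonAffine`] -/
def IsNonAffine (q v : Fin 6 → E3) : Prop :=
  ∀ (A : E3 →ₗ[ℝ] E3) (b : E3), ∑ i : Fin 6, ⟪v i, A (q i) + b⟫_ℝ = 0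

/-- [verbatim copy of the line's `strainedCell`] -/
def strainedCell (a : ℝ) (E : E3 →L[ℝ] E3) : Fin 6 → E3 :=
  fun i => a • (octVertex 1 i + E (octVertex 1 i))

/-- [verbatim copy of the line's `InBand`] -/
def InBand (G : E3 →L[ℝ] E3) : Prop :=
  ∀ u : E3, (17 / 20) * ‖u‖ ≤ ‖G u‖ ∧ ‖G u‖ ≤ (6 / 5) * ‖u‖

/-- [verbatim copy of the line's `CellReading`] -/
def CellReading (p : Fin 6 → E3) : Prop :=
  ∃ (G : E3 →L[ℝ] E3) (z : E3) (v : Fin 6 → E3), InBand G ∧ IsNonAffine (fun k => z + G (octVertex 1 k)) v ∧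
    ∑ k : Fin 6, ‖v k‖ ^ 2 ≤ (‖G‖ / 10) ^ 2 ∧ ∀ k, p k = z + G (octVertex 1 k) + v k

/-- [verbatim copy of the line's Statement 1 `OctahedronCoercivity`] -/
def OctahedronCoercivity : Prop :=
  ∀ a : ℝ, 19 / 20 ≤ a → a ≤ 1 → ∀ E : E3 →L[ℝ] E3, ‖E‖ ≤ 1 / 50 →
    ∀ v : Fin 6 → E3, IsNonAffine (strainedCell a E) v → ∑ i : Fin 6, ‖v i‖ ^ 2 ≤ (a / 9) ^ 2 →
      PhiOct (strainedCell a E) + ∑ i : Fin 6, ‖v i‖ ^ 2 ≤ PhiOct (fun i => strainedCell a E i + v i)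

/-! ### The affine part of a cell reading is pinned; exact non-affinity identity -/

/-- The unit coordinate vectors. -/
def e3 (j : Fin 3) : E3 := EuclideanSpace.single j (1 : ℝ)

@[simp] theorem octVertex_one_0 : octVertex 1 0 = (Real.sqrt 2)⁻¹ • e3 0 := by simp [octVertex, e3]
@[simp] theorem octVertex_one_1 : octVertex 1 1 = -((Real.sqrt 2)⁻¹ • e3 0) := by simp [octVertex, e3]
@[simp] theorem octVertex_one_2 : octVertex 1 2 = (Real.sqrt 2)⁻¹ • e3 1 := by simp [octVertex, e3]
@[simp] theorem octVertex_one_3 : octVertex 1 3 = -((Real.sqrt 2)⁻¹ • e3 1) := by simp [octVertex, e3]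
@[simp] theorem octVertex_one_4 : octVertex 1 4 = (Real.sqrt 2)⁻¹ • e3 2 := by simp [octVertex, e3]
@[simp] theorem octVertex_one_5 : octVertex 1 5 = -((Real.sqrt 2)⁻¹ • e3 2) := by simp [octVertex, e3]

theorem inner_e3_e3 (i j : Fin 3) : ⟪e3 i, e3 j⟫_ℝ = if i = j then 1 else 0 := by
  simp [e3, EuclideanSpace.inner_single_left]

@[simp] theorem inner_e3_same (i : Fin 3) : ⟪e3 i, e3 i⟫_ℝ = 1 := by rw [inner_e3_e3, if_pos rfl]
theorem inner_e3_ne {i j : Fin 3} (h : i ≠ j) : ⟪e3 i, e3 j⟫_ℝ = 0 := by simp [inner_e3_e3, h]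
@[simp] theorem norm_e3 (i : Fin 3) : ‖e3 i‖ = 1 := by simp [e3]

/-- A non-affine field has zero sum. -/
theorem IsNonAffine.sum_eq_zero {q v : Fin 6 → E3} (h : IsNonAffine q v) : ∑ i, v i = 0 := by
  have key : ∀ b : E3, ⟪∑ i, v i, b⟫_ℝ = 0 := by
    intro b
    have := h 0 b
    simpa [sum_inner] using this
  exact inner_self_eq_zero.1 (key _)

/-- The rank-one linear map `x ↦ ⟪e_j, x⟫ w`. -/
def rankOne (j : Fin 3) (w : E3) : E3 →ₗ[ℝ] E3 :=
  (LinearMap.toSpanSingleton ℝ E3 w).comp (innerₗ E3 (e3 j))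

@[simp] theorem rankOne_apply (j : Fin 3) (w x : E3) : rankOne j w x = ⟪e3 j, x⟫_ℝ • w := by
  simp [rankOne]

/-- A band map is injective. -/
theorem InBand.injective {G : E3 →L[ℝ] E3} (hG : InBand G) : Function.Injective G := by
  intro x y hxy
  have h := (hG (x - y)).1
  rw [map_sub, hxy, sub_self, norm_zero] at h
  have : ‖x - y‖ ≤ 0 := by nlinarith [norm_nonneg (x - y)]
  exact sub_eq_zero.1 (norm_le_zero_iff.1 this)

/-- For an injective `G`, every linear `A'` factors as `A ∘ G`. -/
theorem exists_comp_eq_of_injective {G : E3 →L[ℝ] E3} (hG : Function.Injective G) (A' : E3 →ₗ[ℝ] E3) :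
    ∃ A : E3 →ₗ[ℝ] E3, ∀ x, A (G x) = A' x := by
  have hbij : Function.Bijective (G : E3 →ₗ[ℝ] E3) :=
    ⟨hG, LinearMap.surjective_of_injective hG⟩
  let e : E3 ≃ₗ[ℝ] E3 := LinearEquiv.ofBijective (G : E3 →ₗ[ℝ] E3) hbij
  refine ⟨A'.comp e.symm.toLinearMap, fun x => ?_⟩
  simp only [LinearMap.coe_comp, Function.comp_apply]
  congr 1
  exact e.symm_apply_apply x

/-- **The affine part is pinned.** A field that is non-affine along an affine image `z + G·oct` of the
octahedron (with `G` injective) is PAIR-SYMMETRIC: equal on the two ends of each diagonal. -/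
theorem IsNonAffine.pair_eq {G : E3 →L[ℝ] E3} (hG : Function.Injective G) {z : E3} {v : Fin 6 → E3}
    (h : IsNonAffine (fun k => z + G (octVertex 1 k)) v) : v 0 = v 1 ∧ v 2 = v 3 ∧ v 4 = v 5 := by
  have key : ∀ (j : Fin 3) (w : E3), ∑ i : Fin 6, ⟪v i, rankOne j w (octVertex 1 i)⟫_ℝ = 0 := by
    intro j w
    obtain ⟨A, hA⟩ := exists_comp_eq_of_injective hG (rankOne j w)
    have := h A (-(A z))
    simpa [map_add, hA] using this
  have hs : (Real.sqrt 2)⁻¹ ≠ 0 := by positivity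
  have e01 : ⟪e3 0, e3 1⟫_ℝ = 0 := inner_e3_ne (by decide)
  have e02 : ⟪e3 0, e3 2⟫_ℝ = 0 := inner_e3_ne (by decide)
  have e10 : ⟪e3 1, e3 0⟫_ℝ = 0 := inner_e3_ne (by decide)
  have e12 : ⟪e3 1, e3 2⟫_ℝ = 0 := inner_e3_ne (by decide)
  have e20 : ⟪e3 2, e3 0⟫_ℝ = 0 := inner_e3_ne (by decide)
  have e21 : ⟪e3 2, e3 1⟫_ℝ = 0 := inner_e3_ne (by decide)
  have expand : ∀ (j : Fin 3) (w : E3), ∑ i : Fin 6, ⟪v i, rankOne j w (octVertex 1 i)⟫_ℝ =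
      (Real.sqrt 2)⁻¹ * (⟪e3 j, e3 0⟫_ℝ * (⟪v 0, w⟫_ℝ - ⟪v 1, w⟫_ℝ) + ⟪e3 j, e3 1⟫_ℝ * (⟪v 2, w⟫_ℝ - ⟪v 3, w⟫_ℝ)
        + ⟪e3 j, e3 2⟫_ℝ * (⟪v 4, w⟫_ℝ - ⟪v 5, w⟫_ℝ)) := by
    intro j w
    simp only [Fin.sum_univ_six, rankOne_apply, octVertex_one_0, octVertex_one_1, octVertex_one_2,
      octVertex_one_3, octVertex_one_4, octVertex_one_5, inner_smul_right, inner_neg_right]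
    ring
  refine ⟨?_, ?_, ?_⟩
  · have h0 : ∀ w : E3, ⟪v 0 - v 1, w⟫_ℝ = 0 := by
      intro w
      have h1 := key 0 w
      rw [expand, inner_e3_same, e01, e02] at h1
      rw [inner_sub_left]
      have h2 : (Real.sqrt 2)⁻¹ * (⟪v 0, w⟫_ℝ - ⟪v 1, w⟫_ℝ) = 0 := by linear_combination h1
      exact (mul_eq_zero.1 h2).resolve_left hs
    exact sub_eq_zero.1 (inner_self_eq_zero.1 (h0 _))
  · have h0 : ∀ w : E3, ⟪v 2 - v 3, w⟫_ℝ = 0 := by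
      intro w
      have h1 := key 1 w
      rw [expand, inner_e3_same, e10, e12] at h1
      rw [inner_sub_left]
      have h2 : (Real.sqrt 2)⁻¹ * (⟪v 2, w⟫_ℝ - ⟪v 3, w⟫_ℝ) = 0 := by linear_combination h1
      exact (mul_eq_zero.1 h2).resolve_left hs
    exact sub_eq_zero.1 (inner_self_eq_zero.1 (h0 _))
  · have h0 : ∀ w : E3, ⟪v 4 - v 5, w⟫_ℝ = 0 := by
      intro w
      have h1 := key 2 w
      rw [expand, inner_e3_same, e20, e21] at h1
      rw [inner_sub_left]
      have h2 : (Real.sqrt 2)⁻¹ * (⟪v 4, w⟫_ℝ - ⟪v 5, w⟫_ℝ) = 0 := by linear_combination h1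
      exact (mul_eq_zero.1 h2).resolve_left hs
    exact sub_eq_zero.1 (inner_self_eq_zero.1 (h0 _))

/-- Sum of the octahedron's vertices under any additive map vanishes. -/
theorem sum_map_octVertex_one (G : E3 →L[ℝ] E3) : ∑ k : Fin 6, G (octVertex 1 k) = 0 := by
  simp [Fin.sum_univ_six, map_neg]

/-- The three diagonal midpoints of a 6-tuple labelled like `octVertex` (pairs `(0,1), (2,3), (4,5)`). -/
def mids (p : Fin 6 → E3) : Fin 3 → E3 :=
  ![(1 / 2 : ℝ) • (p 0 + p 1), (1 / 2 : ℝ) • (p 2 + p 3), (1 / 2 : ℝ) • (p 4 + p 5)]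

/-- The centroid of a 6-tuple. -/
def cen (p : Fin 6 → E3) : E3 := (1 / 6 : ℝ) • ∑ k : Fin 6, p k

@[simp] theorem mids_0 (p : Fin 6 → E3) : mids p 0 = (1 / 2 : ℝ) • (p 0 + p 1) := rfl
@[simp] theorem mids_1 (p : Fin 6 → E3) : mids p 1 = (1 / 2 : ℝ) • (p 2 + p 3) := rfl
@[simp] theorem mids_2 (p : Fin 6 → E3) : mids p 2 = (1 / 2 : ℝ) • (p 4 + p 5) := rfl

/-- **Cell readings are pinned (exact non-affinity identity).** If `p` reads as a cell then the band map
`G` is determined by the three diagonals (`G e_j = (√2/2)(p_{2j} − p_{2j+1})`), the non-affine residual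
at the two ends of diagonal `j` equals `mids p j − cen p`, and therefore the MIDPOINT SPREAD obeys
`2 Σ_j ‖mids p j − cen p‖² ≤ (‖G‖/10)²`.  (So `CellReading p` is decided by `p` alone: it holds iff the
least-squares affine fit is in the band and the spread inequality holds.) -/
theorem CellReading.pinned {p : Fin 6 → E3} (h : CellReading p) :
    ∃ G : E3 →L[ℝ] E3, InBand G ∧
      G (e3 0) = (Real.sqrt 2 / 2) • (p 0 - p 1) ∧ G (e3 1) = (Real.sqrt 2 / 2) • (p 2 - p 3) ∧
      G (e3 2) = (Real.sqrt 2 / 2) • (p 4 - p 5) ∧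
      2 * ∑ j : Fin 3, ‖mids p j - cen p‖ ^ 2 ≤ (‖G‖ / 10) ^ 2 := by
  obtain ⟨G, z, v, hB, hNA, hv, hp⟩ := h
  obtain ⟨h01, h23, h45⟩ := hNA.pair_eq hB.injective
  have hsum := hNA.sum_eq_zero
  have hs2 : Real.sqrt 2 ≠ 0 := by positivity
  have hc : Real.sqrt 2 / 2 * (2 * (Real.sqrt 2)⁻¹) = 1 := by field_simp
  refine ⟨G, hB, ?_, ?_, ?_, ?_⟩
  · rw [hp 0, hp 1, octVertex_one_0, octVertex_one_1, h01, map_neg, map_smul]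
    have : (Real.sqrt 2 / 2) • ((z + (Real.sqrt 2)⁻¹ • G (e3 0) + v 1) - (z + -((Real.sqrt 2)⁻¹ • G (e3 0)) + v 1))
        = (Real.sqrt 2 / 2 * (2 * (Real.sqrt 2)⁻¹)) • G (e3 0) := by
      rw [← smul_smul]; congr 1; module
    rw [this, hc, one_smul]
  · rw [hp 2, hp 3, octVertex_one_2, octVertex_one_3, h23, map_neg, map_smul]
    have : (Real.sqrt 2 / 2) • ((z + (Real.sqrt 2)⁻¹ • G (e3 1) + v 3) - (z + -((Real.sqrt 2)⁻¹ • G (e3 1)) + v 3))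
        = (Real.sqrt 2 / 2 * (2 * (Real.sqrt 2)⁻¹)) • G (e3 1) := by
      rw [← smul_smul]; congr 1; module
    rw [this, hc, one_smul]
  · rw [hp 4, hp 5, octVertex_one_4, octVertex_one_5, h45, map_neg, map_smul]
    have : (Real.sqrt 2 / 2) • ((z + (Real.sqrt 2)⁻¹ • G (e3 2) + v 5) - (z + -((Real.sqrt 2)⁻¹ • G (e3 2)) + v 5))
        = (Real.sqrt 2 / 2 * (2 * (Real.sqrt 2)⁻¹)) • G (e3 2) := by
      rw [← smul_smul]; congr 1; module
    rw [this, hc, one_smul]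
  · -- the residuals at the diagonal ends are the midpoint deviations
    have hcen : cen p = z := by
      unfold cen
      have : ∑ k : Fin 6, p k = ∑ k : Fin 6, (z + G (octVertex 1 k) + v k) := Finset.sum_congr rfl fun k _ => hp k
      rw [this, Finset.sum_add_distrib, Finset.sum_add_distrib, sum_map_octVertex_one, hsum]
      simp [Finset.sum_const, Finset.card_univ, Fintype.card_fin]
      module
    have m0 : mids p 0 - cen p = v 0 := by
      rw [mids_0, hcen, hp 0, hp 1, octVertex_one_1, octVertex_one_0, h01, map_neg]; module
    have m1 : mids p 1 - cen p = v 2 := by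
      rw [mids_1, hcen, hp 2, hp 3, octVertex_one_3, octVertex_one_2, h23, map_neg]; module
    have m2 : mids p 2 - cen p = v 4 := by
      rw [mids_2, hcen, hp 4, hp 5, octVertex_one_5, octVertex_one_4, h45, map_neg]; module
    have : 2 * ∑ j : Fin 3, ‖mids p j - cen p‖ ^ 2 = ∑ k : Fin 6, ‖v k‖ ^ 2 := by
      rw [Fin.sum_univ_three, Fin.sum_univ_six, m0, m1, m2, h01, h23, h45]; ring
    rw [this]; exact hv

/-- **Refuting a cell reading from the six points alone (Frobenius form).** Since
`‖G‖² ≤ Σ_j ‖G e_j‖² = ½ Σ_j ‖p_{2j} − p_{2j+1}‖²`, a 6-tuple whose midpoint spread satisfies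
`400 · Σ_j ‖mids p j − cen p‖² > Σ_j ‖p_{2j} − p_{2j+1}‖²` does NOT read as a cell — in particular
every wrongly PAIRED labelling of an octahedron (adjacent vertices on a 'diagonal') fails grossly.
(The sharp test uses the operator norm: `200 · spread² > λ_max(Gram)`; this Frobenius form loses √3.) -/
theorem not_cellReading_of_spread {p : Fin 6 → E3}
    (h : ‖p 0 - p 1‖ ^ 2 + ‖p 2 - p 3‖ ^ 2 + ‖p 4 - p 5‖ ^ 2 < 400 * ∑ j : Fin 3, ‖mids p j - cen p‖ ^ 2) :
    ¬ CellReading p := by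
  intro hc
  obtain ⟨G, -, h0, h1, h2, hsp⟩ := hc.pinned
  -- Frobenius bound on the operator norm
  have hF : ‖G‖ ^ 2 ≤ ‖G (e3 0)‖ ^ 2 + ‖G (e3 1)‖ ^ 2 + ‖G (e3 2)‖ ^ 2 := by
    have hb : ∀ u : E3, ‖G u‖ ≤ Real.sqrt (‖G (e3 0)‖ ^ 2 + ‖G (e3 1)‖ ^ 2 + ‖G (e3 2)‖ ^ 2) * ‖u‖ := by
      intro u
      have hu : u = (u 0) • e3 0 + (u 1) • e3 1 + (u 2) • e3 2 := by
        ext i; fin_cases i <;> simp [e3]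
      have hnorm : ‖u‖ ^ 2 = u 0 ^ 2 + u 1 ^ 2 + u 2 ^ 2 := by
        rw [EuclideanSpace.norm_eq, Real.sq_sqrt (by positivity), Fin.sum_univ_three]
        simp [sq_abs]
      have h1' : ‖G u‖ ≤ |u 0| * ‖G (e3 0)‖ + |u 1| * ‖G (e3 1)‖ + |u 2| * ‖G (e3 2)‖ := by
        conv_lhs => rw [hu]
        rw [map_add, map_add, map_smul, map_smul, map_smul]
        calc ‖u 0 • G (e3 0) + u 1 • G (e3 1) + u 2 • G (e3 2)‖
            ≤ ‖u 0 • G (e3 0) + u 1 • G (e3 1)‖ + ‖u 2 • G (e3 2)‖ := norm_add_le _ _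
          _ ≤ ‖u 0 • G (e3 0)‖ + ‖u 1 • G (e3 1)‖ + ‖u 2 • G (e3 2)‖ := by gcongr; exact norm_add_le _ _
          _ = |u 0| * ‖G (e3 0)‖ + |u 1| * ‖G (e3 1)‖ + |u 2| * ‖G (e3 2)‖ := by
            simp [norm_smul]
      -- Cauchy–Schwarz in ℝ³
      have hCS : (|u 0| * ‖G (e3 0)‖ + |u 1| * ‖G (e3 1)‖ + |u 2| * ‖G (e3 2)‖) ^ 2 ≤
          (u 0 ^ 2 + u 1 ^ 2 + u 2 ^ 2) * (‖G (e3 0)‖ ^ 2 + ‖G (e3 1)‖ ^ 2 + ‖G (e3 2)‖ ^ 2) := by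
        rw [← sq_abs (u 0), ← sq_abs (u 1), ← sq_abs (u 2)]
        nlinarith [sq_nonneg (|u 0| * ‖G (e3 1)‖ - |u 1| * ‖G (e3 0)‖),
          sq_nonneg (|u 0| * ‖G (e3 2)‖ - |u 2| * ‖G (e3 0)‖),
          sq_nonneg (|u 1| * ‖G (e3 2)‖ - |u 2| * ‖G (e3 1)‖)]
      have hA : 0 ≤ |u 0| * ‖G (e3 0)‖ + |u 1| * ‖G (e3 1)‖ + |u 2| * ‖G (e3 2)‖ := by positivity
      have hS : 0 ≤ ‖G (e3 0)‖ ^ 2 + ‖G (e3 1)‖ ^ 2 + ‖G (e3 2)‖ ^ 2 := by positivity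
      calc ‖G u‖ ≤ |u 0| * ‖G (e3 0)‖ + |u 1| * ‖G (e3 1)‖ + |u 2| * ‖G (e3 2)‖ := h1'
        _ ≤ Real.sqrt (‖G (e3 0)‖ ^ 2 + ‖G (e3 1)‖ ^ 2 + ‖G (e3 2)‖ ^ 2) * ‖u‖ := by
          rw [← Real.sqrt_sq hA, ← Real.sqrt_sq (norm_nonneg u), ← Real.sqrt_mul hS]
          exact Real.sqrt_le_sqrt (by rw [hnorm]; linarith)
    have hop : ‖G‖ ≤ Real.sqrt (‖G (e3 0)‖ ^ 2 + ‖G (e3 1)‖ ^ 2 + ‖G (e3 2)‖ ^ 2) :=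
      ContinuousLinearMap.opNorm_le_bound _ (Real.sqrt_nonneg _) hb
    have := pow_le_pow_left₀ (norm_nonneg _) hop 2
    rwa [Real.sq_sqrt (by positivity)] at this
  have hcol : ‖G (e3 0)‖ ^ 2 + ‖G (e3 1)‖ ^ 2 + ‖G (e3 2)‖ ^ 2 =
      (1 / 2) * (‖p 0 - p 1‖ ^ 2 + ‖p 2 - p 3‖ ^ 2 + ‖p 4 - p 5‖ ^ 2) := by
    rw [h0, h1, h2, norm_smul, norm_smul, norm_smul, Real.norm_of_nonneg (by positivity)]
    have : (Real.sqrt 2 / 2) ^ 2 = 1 / 2 := by rw [div_pow, Real.sq_sqrt (by norm_num)]; norm_num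
    rw [mul_pow, mul_pow, mul_pow, this]; ring
  have hpos : 0 ≤ ∑ j : Fin 3, ‖mids p j - cen p‖ ^ 2 := by positivity
  nlinarith

/-- **Operator-norm certificate from the columns.** If the quadratic form of the three columns
`G e_j` is bounded by `μ`, then `‖G‖² ≤ μ` — the sharp way to bound `‖G‖` for an explicit cell reading
(columns pinned by `CellReading.pinned`). -/
theorem opNorm_sq_le_of_columns {G : E3 →L[ℝ] E3} {μ : ℝ} (hμ : 0 ≤ μ)
    (h : ∀ a b c : ℝ, ‖a • G (e3 0) + b • G (e3 1) + c • G (e3 2)‖ ^ 2 ≤ μ * (a ^ 2 + b ^ 2 + c ^ 2)) :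
    ‖G‖ ^ 2 ≤ μ := by
  have hb : ∀ u : E3, ‖G u‖ ≤ Real.sqrt μ * ‖u‖ := by
    intro u
    have hu : u = (u 0) • e3 0 + (u 1) • e3 1 + (u 2) • e3 2 := by
      ext i; fin_cases i <;> simp [e3]
    have hnorm : ‖u‖ ^ 2 = u 0 ^ 2 + u 1 ^ 2 + u 2 ^ 2 := by
      rw [EuclideanSpace.norm_eq, Real.sq_sqrt (by positivity), Fin.sum_univ_three]
      simp [sq_abs]
    have hGu : G u = u 0 • G (e3 0) + u 1 • G (e3 1) + u 2 • G (e3 2) := by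
      conv_lhs => rw [hu]
      simp only [map_add, map_smul]
    have h2 : ‖G u‖ ^ 2 ≤ (Real.sqrt μ * ‖u‖) ^ 2 := by
      rw [hGu, mul_pow, Real.sq_sqrt hμ, hnorm]; exact h _ _ _
    exact (pow_le_pow_iff_left₀ (norm_nonneg _) (by positivity) two_ne_zero).1 h2
  have hop : ‖G‖ ≤ Real.sqrt μ := ContinuousLinearMap.opNorm_le_bound _ (Real.sqrt_nonneg _) hb
  have := pow_le_pow_left₀ (norm_nonneg _) hop 2
  rwa [Real.sq_sqrt hμ] at this

/-! ### Statement 1 sees EVEN orders only -/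

/-- The 15-term expansion of the line's pair sum. -/
theorem sum_Ioi_fin6 (f : Fin 6 → Fin 6 → ℝ) : ∑ i : Fin 6, ∑ j ∈ Finset.Ioi i, f i j =
    f 0 1 + f 0 2 + f 0 3 + f 0 4 + f 0 5 + f 1 2 + f 1 3 + f 1 4 + f 1 5 + f 2 3 + f 2 4 + f 2 5 +
      f 3 4 + f 3 5 + f 4 5 := by
  have h0 : Finset.Ioi (0 : Fin 6) = {1, 2, 3, 4, 5} := by decide
  have h1 : Finset.Ioi (1 : Fin 6) = {2, 3, 4, 5} := by decide
  have h2 : Finset.Ioi (2 : Fin 6) = {3, 4, 5} := by decide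
  have h3 : Finset.Ioi (3 : Fin 6) = {4, 5} := by decide
  have h4 : Finset.Ioi (4 : Fin 6) = {5} := by decide
  have h5 : Finset.Ioi (5 : Fin 6) = ∅ := by decide
  rw [Fin.sum_univ_six, h0, h1, h2, h3, h4, h5]
  simp [Finset.sum_insert]
  ring

/-- Swap the two ends of each diagonal. -/
def swapPairs : Fin 6 → Fin 6 := ![1, 0, 3, 2, 5, 4]

@[simp] theorem swapPairs_0 : swapPairs 0 = 1 := rfl
@[simp] theorem swapPairs_1 : swapPairs 1 = 0 := rfl
@[simp] theorem swapPairs_2 : swapPairs 2 = 3 := rfl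
@[simp] theorem swapPairs_3 : swapPairs 3 = 2 := rfl
@[simp] theorem swapPairs_4 : swapPairs 4 = 5 := rfl
@[simp] theorem swapPairs_5 : swapPairs 5 = 4 := rfl

/-- `PhiOct` is invariant under "swap the diagonal ends and negate" (the weights give edges ½ and
diagonals 1, a pattern preserved by the swap). [folklore] -/
theorem phiOct_neg_swap (p : Fin 6 → E3) : PhiOct (fun i => -p (swapPairs i)) = PhiOct p := by
  simp only [PhiOct, sum_Ioi_fin6, swapPairs_0, swapPairs_1, swapPairs_2, swapPairs_3, swapPairs_4,
    swapPairs_5, dist_neg_neg]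
  rw [dist_comm (p 1) (p 0), dist_comm (p 3) (p 2), dist_comm (p 5) (p 4)]
  ring

/-- **Even orders only.** At a CENTROSYMMETRIC cell `q` (diagonal ends opposite) and along a
PAIR-SYMMETRIC field `v` (equal at the two ends of each diagonal), `t ↦ PhiOct (q + t v)` is even:
`PhiOct (q − v) = PhiOct (q + v)`.  By `IsNonAffine.pair_eq` every non-affine field along an affine cell
is pair-symmetric, and `strainedCell a E` is centrosymmetric; so the cell certificate of Statement 1 has
no odd-order terms: it is decided by `½·(reduced Hessian) +` quartic and higher even orders on the tube
`Σ‖vᵢ‖² ≤ (a/9)²`. [folklore] -/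
theorem phiOct_even {q v : Fin 6 → E3} (hq : q 1 = -q 0 ∧ q 3 = -q 2 ∧ q 5 = -q 4)
    (hv : v 1 = v 0 ∧ v 3 = v 2 ∧ v 5 = v 4) :
    PhiOct (fun i => q i - v i) = PhiOct (fun i => q i + v i) := by
  rw [← phiOct_neg_swap (fun i => q i + v i)]
  congr 1
  funext i
  fin_cases i <;> simp [hq.1, hq.2.1, hq.2.2, hv.1, hv.2.1, hv.2.2] <;> abel

/-- The strained cell of Statement 1 is centrosymmetric. -/
theorem strainedCell_centro (a : ℝ) (E : E3 →L[ℝ] E3) :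
    strainedCell a E 1 = -strainedCell a E 0 ∧ strainedCell a E 3 = -strainedCell a E 2 ∧
      strainedCell a E 5 = -strainedCell a E 4 := by
  refine ⟨?_, ?_, ?_⟩ <;> simp [strainedCell, smul_add] <;> abel

/-- The strained cell is the affine image `0 + G·oct` with `G = a(1 + E)`. -/
theorem strainedCell_eq (a : ℝ) (E : E3 →L[ℝ] E3) (k : Fin 6) :
    strainedCell a E k = 0 + (a • (1 + E)) (octVertex 1 k) := by
  simp [strainedCell]

/-- For `a ≠ 0` and `‖E‖ < 1` the map `a(1 + E)` is injective. -/
theorem injective_smul_one_add {a : ℝ} (ha : a ≠ 0) {E : E3 →L[ℝ] E3} (hE : ‖E‖ < 1) :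
    Function.Injective (a • (1 + E) : E3 →L[ℝ] E3) := by
  intro x y hxy
  have h1 : (1 + E) x = (1 + E) y := by
    have := congrArg (fun w => a⁻¹ • w) hxy
    simpa [smul_smul, inv_mul_cancel₀ ha] using this
  have h2 : (x - y) + E (x - y) = 0 := by
    rw [map_sub]
    have : x + E x = y + E y := by simpa using h1
    rw [sub_add_sub_comm, sub_eq_zero.2 this]
  by_contra hne
  have hpos : 0 < ‖x - y‖ := norm_pos_iff.2 (sub_ne_zero.2 hne)
  have h3 : ‖E (x - y)‖ = ‖x - y‖ := by
    have : E (x - y) = -(x - y) := eq_neg_of_add_eq_zero_right h2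
    rw [this, norm_neg]
  have h4 : ‖E (x - y)‖ ≤ ‖E‖ * ‖x - y‖ := E.le_opNorm _
  nlinarith

/-- **In Statement 1 every admissible `v` is pair-symmetric with zero sum** (so `PhiOct(q ± v)`
coincide by `phiOct_even`). -/
theorem nonaffine_strainedCell_pair_eq {a : ℝ} (ha : a ≠ 0) {E : E3 →L[ℝ] E3} (hE : ‖E‖ < 1)
    {v : Fin 6 → E3} (h : IsNonAffine (strainedCell a E) v) :
    (v 0 = v 1 ∧ v 2 = v 3 ∧ v 4 = v 5) ∧ ∑ i, v i = 0 := by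
  have h' : IsNonAffine (fun k => (0 : E3) + (a • (1 + E)) (octVertex 1 k)) v := by
    have hfun : strainedCell a E = fun k => (0 : E3) + (a • (1 + E)) (octVertex 1 k) :=
      funext (strainedCell_eq a E)
    rw [← hfun]; exact h
  exact ⟨h'.pair_eq (injective_smul_one_add ha hE), h.sum_eq_zero⟩

/-- Statement 1 restated with the symmetric difference: under its hypotheses
`PhiOct (q + v) − PhiOct q = ½ (PhiOct (q + v) + PhiOct (q − v)) − PhiOct q`, an even functional of `v`. -/
theorem octahedronCoercivity_even_form {a : ℝ} (ha : a ≠ 0) {E : E3 →L[ℝ] E3} (hE : ‖E‖ < 1)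
    {v : Fin 6 → E3} (h : IsNonAffine (strainedCell a E) v) :
    PhiOct (fun i => strainedCell a E i + v i) =
      (1 / 2) * (PhiOct (fun i => strainedCell a E i + v i) + PhiOct (fun i => strainedCell a E i - v i)) := by
  obtain ⟨⟨h01, h23, h45⟩, -⟩ := nonaffine_strainedCell_pair_eq ha hE h
  rw [phiOct_even (strainedCell_centro a E) ⟨h01.symm, h23.symm, h45.symm⟩]
  ring

/-! ### `SqueezeWindow` is FALSE without exact minimality (LANDED, imported)

v14: the development (fcc-lattice balls `Negative/FccBall.lean`, p75966; `hcp_reflection_far`, `lateral_form_ge`,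
`squeezeWindow_false_without_groundStates` in `Negative/SqueezeWindowNeedsMinimality.lean`, p78202 — both ACCEPTED) is no longer
copied here.  Statement: the line's transfer target `SqueezeWindow` with `IsGroundState lennardJones x` replaced by
`Function.Injective x` is FALSE (all-good fcc balls admit no `1/7`-matching with any rigid image of a strained hcp, because hcp is
not closed under reflection through an interlayer neighbour while fcc is centrosymmetric). -/

/-- [verbatim copy of the line's `hIdeal`] -/
def hIdeal : ℝ := Real.sqrt (2 / 3)

/-! ### Statement 2 (`StrainLandscape`) is FALSE modulo certified energy bounds -/

/-- [verbatim copy of the line's `siteE`] -/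
def siteE (G : E3 →L[ℝ] E3) (s : ℤ → ℤ) (m : ℤ) : ℝ :=
  (1 / 2) * ∑' p : {p : E3 // p ∈ barlowStacking 1 hIdeal s ∧ p ≠ barlowPos 1 hIdeal s m 0 0},
    lennardJones ‖G (p.1 - barlowPos 1 hIdeal s m 0 0)‖

/-- [verbatim copy of the line's `W`] -/
def W (G : E3 →L[ℝ] E3) : ℝ := siteE G alternatingHagg 0

/-- [verbatim copy of the line's Statement 2 `StrainLandscape`] -/
def StrainLandscape : Prop :=
  ∃ G₀ : E3 →L[ℝ] E3, InBand G₀ ∧ IsMinOn W {G | InBand G} G₀ ∧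
    (∀ G : E3 →L[ℝ] E3, InBand G →
      W G₀ + (1 / 2) * ‖(ContinuousLinearMap.adjoint G).comp G - (ContinuousLinearMap.adjoint G₀).comp G₀‖ ^ 2
        ≤ W G) ∧
    ∃ Q : PeriodicConfiguration 3, Q.points = (fun p => G₀ p) '' hcpStacking 1 hIdeal ∧
      Q.energyPerParticle lennardJones = W G₀

/-! ### Two test strains -/

/-- The diagonal linear map `diag(a, b, c)` in the frame of `barlowPos` (x = u, z = layer normal). -/
def diagLin (a b c : ℝ) : E3 →ₗ[ℝ] E3 where
  toFun u := !₂[a * u 0, b * u 1, c * u 2]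
  map_add' u v := by ext i; fin_cases i <;> simp <;> ring
  map_smul' r u := by ext i; fin_cases i <;> simp <;> ring

/-- `diag(a, b, c)` as a continuous linear map. -/
def diagCLM (a b c : ℝ) : E3 →L[ℝ] E3 := LinearMap.toContinuousLinearMap (diagLin a b c)

theorem diagCLM_apply (a b c : ℝ) (u : E3) : diagCLM a b c u = !₂[a * u 0, b * u 1, c * u 2] := rfl

theorem norm_sq_E3 (u : E3) : ‖u‖ ^ 2 = u 0 ^ 2 + u 1 ^ 2 + u 2 ^ 2 := by
  rw [EuclideanSpace.norm_eq, Real.sq_sqrt (by positivity), Fin.sum_univ_three]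
  simp [sq_abs]

theorem norm_diagCLM_sq (a b c : ℝ) (u : E3) :
    ‖diagCLM a b c u‖ ^ 2 = a ^ 2 * u 0 ^ 2 + b ^ 2 * u 1 ^ 2 + c ^ 2 * u 2 ^ 2 := by
  rw [norm_sq_E3, diagCLM_apply]
  simp; ring

/-- The basal uniaxial stretch `G₁ = diag(6/5, 9/10, 19/20)` (singular values `1.2, 0.9, 0.95`). -/
def G₁ : E3 →L[ℝ] E3 := diagCLM (6 / 5) (9 / 10) (19 / 20)

/-- The near-optimal isotropic scale `G_iso = 0.9711 · id`. -/
def Giso : E3 →L[ℝ] E3 := (9711 / 10000 : ℝ) • ContinuousLinearMap.id ℝ E3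

theorem inBand_G₁ : InBand G₁ := by
  intro u
  have h := norm_diagCLM_sq (6 / 5) (9 / 10) (19 / 20) u
  have hn := norm_sq_E3 u
  have h0 : 0 ≤ ‖u‖ := norm_nonneg u
  rw [show G₁ = diagCLM (6 / 5) (9 / 10) (19 / 20) from rfl]
  have h1 : 0 ≤ ‖diagCLM (6 / 5) (9 / 10) (19 / 20) u‖ := norm_nonneg _
  have hlow : (9 / 10 * ‖u‖) ^ 2 ≤ ‖diagCLM (6 / 5) (9 / 10) (19 / 20) u‖ ^ 2 := by
    rw [h, mul_pow, hn]; nlinarith [sq_nonneg (u 0), sq_nonneg (u 1), sq_nonneg (u 2)]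
  have hup : ‖diagCLM (6 / 5) (9 / 10) (19 / 20) u‖ ^ 2 ≤ (6 / 5 * ‖u‖) ^ 2 := by
    rw [h, mul_pow, hn]; nlinarith [sq_nonneg (u 0), sq_nonneg (u 1), sq_nonneg (u 2)]
  have hlow' := (pow_le_pow_iff_left₀ (by positivity) h1 two_ne_zero).1 hlow
  have hup' := (pow_le_pow_iff_left₀ h1 (by positivity) two_ne_zero).1 hup
  constructor <;> linarith

theorem inBand_Giso : InBand Giso := by
  intro u
  have : ‖Giso u‖ = 9711 / 10000 * ‖u‖ := by
    simp [Giso, norm_smul]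
  rw [this]
  constructor <;> nlinarith [norm_nonneg u]

/-- The unit vector `e_x = (1, 0, 0)` (the in-plane nearest-neighbour direction `u`). -/
def ex : E3 := EuclideanSpace.single 0 1

theorem norm_ex : ‖ex‖ = 1 := by simp [ex]

theorem norm_G₁_ex_sq : ‖G₁ ex‖ ^ 2 = 36 / 25 := by
  rw [show G₁ = diagCLM (6 / 5) (9 / 10) (19 / 20) from rfl, norm_diagCLM_sq]
  simp [ex]; norm_num

theorem norm_Giso_ex_sq : ‖Giso ex‖ ^ 2 = (9711 / 10000) ^ 2 := by
  simp [Giso, norm_smul, norm_ex]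

/-! ### The certified-numerics hypothesis and the conditional refutation -/

/-- **H (certified numerics, not constructed here)**: three bounds on the strained-hcp Lennard-Jones energy per
particle `W` (Blanc–Lewin units; reference `a = 1`, `h = √(2/3)`, alternating Hägg word): the near-optimal isotropic
value `W(0.9711·id) ≤ −0.7173` (numerics: −0.717589), the stretched value `W(diag(1.2, 0.9, 0.95)) ≤ −0.634`
(numerics: −0.636858), and the UNIFORM lower bound `−0.7185 ≤ W(G)` over the whole band (numerics: min = −0.717590 at
`C₀ = diag(0.94337, 0.94337, 0.94311)`).  Each is an interval-arithmetic statement about explicit `r⁻⁶`-summable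
lattice sums (upper bounds: finite partial sums, every dropped term negative; lower bound: branch and bound over the
6-dimensional band with an Epstein-type tail estimate) — a `kit` certificate, not a session proof.
[topic MathematicalPhysics/StatisticalMechanics] -/
def EnergyBounds : Prop :=
  W Giso ≤ -7173 / 10000 ∧ W G₁ ≤ -634 / 1000 ∧ ∀ G : E3 →L[ℝ] E3, InBand G → -7185 / 10000 ≤ W G

/-- The quadratic form of `T = A†A − B†B` on a vector: `⟪u, T u⟫ = ‖A u‖² − ‖B u‖²`. -/
theorem inner_adjointComp_sub (A B : E3 →L[ℝ] E3) (u : E3) :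
    ⟪u, ((ContinuousLinearMap.adjoint A).comp A - (ContinuousLinearMap.adjoint B).comp B) u⟫_ℝ =
      ‖A u‖ ^ 2 - ‖B u‖ ^ 2 := by
  rw [sub_apply, inner_sub_right]
  have hA := ContinuousLinearMap.apply_norm_sq_eq_inner_adjoint_right A u
  have hB := ContinuousLinearMap.apply_norm_sq_eq_inner_adjoint_right B u
  simp only [RCLike.re_to_real] at hA hB
  rw [hA, hB]

/-- `|⟪e, T e⟫| ≤ ‖T‖` for a unit vector `e`. -/
theorem abs_inner_le_opNorm (T : E3 →L[ℝ] E3) {e : E3} (he : ‖e‖ = 1) : |⟪e, T e⟫_ℝ| ≤ ‖T‖ := by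
  calc |⟪e, T e⟫_ℝ| ≤ ‖e‖ * ‖T e‖ := abs_real_inner_le_norm _ _
    _ ≤ ‖e‖ * (‖T‖ * ‖e‖) := by gcongr; exact T.le_opNorm e
    _ = ‖T‖ := by rw [he]; ring

/-- **Statement 2 is FALSE modulo the certified energy bounds.**  Given a minimiser `G₀` with the pinned
growth clause: at `G_iso` the clause and the bounds confine the metric, `‖G_isoᵀG_iso − G₀ᵀG₀‖ ≤ 0.049`, so
`‖G₀ e_x‖² ≤ 0.9711² + 0.049`; at the basal stretch `G₁` the clause then demands
`W(G₁) − W(G₀) ≥ ½ (1.44 − 0.9430 − 0.049)² = 0.1003`, but the bounds give `≤ −0.634 + 0.7185 = 0.0845`. -/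
theorem strainLandscape_false_of_energyBounds (hE : EnergyBounds) : ¬ StrainLandscape := by
  rintro ⟨G₀, hB₀, hmin, hgrow, -⟩
  obtain ⟨hUiso, hU1, hL⟩ := hE
  have hL0 : -7185 / 10000 ≤ W G₀ := hL G₀ hB₀
  -- confinement at G_iso
  set Tiso := (ContinuousLinearMap.adjoint Giso).comp Giso - (ContinuousLinearMap.adjoint G₀).comp G₀ with hTiso
  have hciso := hgrow Giso inBand_Giso
  have hTiso_sq : ‖Tiso‖ ^ 2 ≤ 24 / 10000 := by rw [← hTiso] at hciso; linarith
  have hTiso_le : ‖Tiso‖ ≤ 49 / 1000 := by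
    nlinarith [norm_nonneg Tiso]
  have hG0ex : ‖G₀ ex‖ ^ 2 ≤ (9711 / 10000) ^ 2 + 49 / 1000 := by
    have h1 := abs_inner_le_opNorm Tiso norm_ex
    rw [hTiso, inner_adjointComp_sub, norm_Giso_ex_sq] at h1
    have h2 := neg_abs_le (((9711 : ℝ) / 10000) ^ 2 - ‖G₀ ex‖ ^ 2)
    linarith
  -- violation at G₁
  set T1 := (ContinuousLinearMap.adjoint G₁).comp G₁ - (ContinuousLinearMap.adjoint G₀).comp G₀ with hT1
  have hc1 := hgrow G₁ inBand_G₁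
  have hT1_ge : 36 / 25 - ((9711 / 10000) ^ 2 + 49 / 1000) ≤ ‖T1‖ := by
    have h1 := abs_inner_le_opNorm T1 norm_ex
    rw [hT1, inner_adjointComp_sub, norm_G₁_ex_sq] at h1
    have h2 := le_abs_self ((36 : ℝ) / 25 - ‖G₀ ex‖ ^ 2)
    linarith
  have hT1_sq : (36 / 25 - ((9711 / 10000) ^ 2 + 49 / 1000)) ^ 2 ≤ ‖T1‖ ^ 2 :=
    pow_le_pow_left₀ (by norm_num) hT1_ge 2
  rw [← hT1] at hc1
  nlinarith


end OctetCellSqueeze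

end Targets

end Summit.AtomisticToContinuum.Crystallization.Cruxes.DefectFreeCrystallizes.Disproof

end

/-! # §8 — THE GEOMETRIC BRIDGE IS FALSE WITHOUT EXACT MINIMALITY (v14; inline copy of the pending `Negative/` chain)

Namespaces `Summit.AtomisticToContinuum.Crystallization.Cruxes.DefectFreeCrystallizes.Disproof.{VagueToMatching, RulerHagg,
StackingShift, StackingBlocks, WithoutGroundStates}`. -/

/-! ## §8.1 Vague convergence to a periodic point measure forces two-way matching on balls (`eventually_ballMatch`) -/

noncomputable section

namespace Summit.AtomisticToContinuum.Crystallization.Cruxes.DefectFreeCrystallizes.Disproof.VagueToMatching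

open Literature.MathematicalPhysics.StatisticalMechanics
open scoped BigOperators Topology
open Filter Set Metric

variable {d : ℕ}

local notation "E" => EuclideanSpace ℝ (Fin d)

/-- The tent bump of radius `r` at `p`: `max 0 (1 − dist z p / r)`. -/
def bump (p : EuclideanSpace ℝ (Fin d)) (r : ℝ) (z : EuclideanSpace ℝ (Fin d)) : ℝ := max 0 (1 - dist z p / r)

theorem bump_nonneg (p : E) (r : ℝ) (z : E) : 0 ≤ bump p r z := le_max_left _ _

theorem bump_self (p : E) (r : ℝ) : bump p r p = 1 := by simp [bump]

theorem bump_eq_zero {p : E} {r : ℝ} (hr : 0 < r) {z : E} (hz : r ≤ dist z p) : bump p r z = 0 := by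
  unfold bump
  rw [max_eq_left]
  rw [sub_nonpos, le_div_iff₀ hr]; linarith

theorem bump_pos_iff {p : E} {r : ℝ} (hr : 0 < r) {z : E} : 0 < bump p r z ↔ dist z p < r := by
  unfold bump
  rw [lt_max_iff, lt_self_iff_false, false_or, sub_pos, div_lt_one hr]

theorem bump_le_one (p : E) {r : ℝ} (hr : 0 < r) (z : E) : bump p r z ≤ 1 := by
  unfold bump
  refine max_le zero_le_one ?_
  have : 0 ≤ dist z p / r := by positivity
  linarith

theorem continuous_bump (p : E) (r : ℝ) : Continuous (bump p r) := by
  unfold bump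
  fun_prop

theorem hasCompactSupport_bump (p : E) {r : ℝ} (hr : 0 < r) : HasCompactSupport (bump p r) := by
  refine HasCompactSupport.intro (isCompact_closedBall p r) fun z hz => ?_
  rw [mem_closedBall, not_le] at hz
  exact bump_eq_zero hr hz.le

/-- The plateau `min 1 (max 0 (R + 1 − ‖z‖))`: `1` on `B̄(0, R)`, `0` outside `B(0, R + 1)`. -/
def plateau (R : ℝ) (z : EuclideanSpace ℝ (Fin d)) : ℝ := min 1 (max 0 (R + 1 - ‖z‖))

theorem plateau_eq_one {R : ℝ} {z : E} (hz : ‖z‖ ≤ R) : plateau R z = 1 := by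
  unfold plateau; rw [min_eq_left]; rw [le_max_iff]; right; linarith

theorem plateau_eq_zero {R : ℝ} {z : E} (hz : R + 1 ≤ ‖z‖) : plateau R z = 0 := by
  unfold plateau; rw [max_eq_left (by linarith), min_eq_right zero_le_one]

theorem plateau_nonneg (R : ℝ) (z : E) : 0 ≤ plateau R z := le_min zero_le_one (le_max_left _ _)

theorem plateau_le_one (R : ℝ) (z : E) : plateau R z ≤ 1 := min_le_left _ _

theorem continuous_plateau (R : ℝ) : Continuous (plateau (d := d) R) := by
  unfold plateau; fun_prop

/-- The ramp `min 1 (max 0 (2 t / ε − 1))`: `0` for `t ≤ ε/2`, `1` for `t ≥ ε`. -/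
def ramp (ε t : ℝ) : ℝ := min 1 (max 0 (2 * t / ε - 1))

theorem ramp_zero_of_le {ε t : ℝ} (hε : 0 < ε) (ht : t ≤ ε / 2) : ramp ε t = 0 := by
  unfold ramp
  have : 2 * t / ε - 1 ≤ 0 := by rw [sub_nonpos, div_le_one hε]; linarith
  rw [max_eq_left this, min_eq_right zero_le_one]

theorem ramp_one_of_le {ε t : ℝ} (hε : 0 < ε) (ht : ε ≤ t) : ramp ε t = 1 := by
  unfold ramp
  have : 1 ≤ 2 * t / ε - 1 := by rw [le_sub_iff_add_le, le_div_iff₀ hε]; linarith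
  rw [min_eq_left (le_max_iff.2 (Or.inr this))]

theorem ramp_nonneg (ε t : ℝ) : 0 ≤ ramp ε t := le_min zero_le_one (le_max_left _ _)

theorem continuous_ramp (ε : ℝ) : Continuous (ramp ε) := by unfold ramp; fun_prop

/-- The "vacuum detector": `plateau R z · ramp ε (infDist z X)` — continuous, compactly supported,
vanishing on `X`, equal to `1` at every `z` with `‖z‖ ≤ R` and `infDist z X ≥ ε`. -/
def vacuumTest (X : Set (EuclideanSpace ℝ (Fin d))) (R ε : ℝ) (z : EuclideanSpace ℝ (Fin d)) : ℝ :=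
  plateau R z * ramp ε (infDist z X)

theorem continuous_vacuumTest (X : Set E) (R ε : ℝ) : Continuous (vacuumTest X R ε) :=
  (continuous_plateau R).mul ((continuous_ramp ε).comp (continuous_infDist_pt (s := X)))

theorem hasCompactSupport_vacuumTest (X : Set E) (R ε : ℝ) : HasCompactSupport (vacuumTest X R ε) := by
  refine HasCompactSupport.intro (isCompact_closedBall (0 : E) (R + 1)) fun z hz => ?_
  rw [mem_closedBall, dist_zero_right, not_le] at hz
  simp [vacuumTest, plateau_eq_zero hz.le]

theorem vacuumTest_nonneg (X : Set E) (R ε : ℝ) (z : E) : 0 ≤ vacuumTest X R ε z :=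
  mul_nonneg (plateau_nonneg R z) (ramp_nonneg _ _)

theorem vacuumTest_eq_zero_of_mem {X : Set E} {R ε : ℝ} (hε : 0 < ε) {z : E} (hz : z ∈ X) :
    vacuumTest X R ε z = 0 := by
  simp [vacuumTest, infDist_zero_of_mem hz, ramp_zero_of_le hε (by linarith : (0 : ℝ) ≤ ε / 2)]

theorem vacuumTest_eq_one {X : Set E} {R ε : ℝ} (hε : 0 < ε) {z : E} (hz : ‖z‖ ≤ R) (hfar : ε ≤ infDist z X) :
    vacuumTest X R ε z = 1 := by
  simp [vacuumTest, plateau_eq_one hz, ramp_one_of_le hε hfar]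

/-- **Local convergence to a periodic point measure forces eventual two-way matching.** If
`∑ᵢ f(yᵢʲ) → ∑' s : F+G, m(s) f(s)` for every continuous compactly supported `f`, with integer
multiplicities `m ≥ 1` on the periodic configuration `P`, then for every radius `R` and every `ε > 0`,
eventually in `j`, every point of `P` in `B̄(0, R)` has a particle within `ε` and every particle in
`B̄(0, R)` has a point of `P` within `ε` (bump functions at the finitely many sites of the ball detect
occupation; a "vacuum detector" vanishing on `F + G` detects stray particles). [folklore] -/
theorem eventually_ballMatch (P : PeriodicConfiguration d) (m : E → ℕ) (hm : ∀ s ∈ P.points, 1 ≤ m s)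
    {n : ℕ → ℕ} (y : (j : ℕ) → Fin (n j) → E)
    (h : ∀ f : E → ℝ, Continuous f → HasCompactSupport f →
      Tendsto (fun j => ∑ i, f (y j i)) atTop (𝓝 (∑' s : P.points, (m s : ℝ) * f s)))
    (R ε : ℝ) (hε : 0 < ε) :
    ∀ᶠ j in atTop, BallMatch ε R 0 (Set.range (y j)) P.points := by
  classical
  obtain ⟨ρ, hρ, hsep⟩ := P.exists_pos_le_dist
  set r : ℝ := min ε (ρ / 2) with hr
  have hr0 : 0 < r := lt_min hε (half_pos hρ)
  have hrε : r ≤ ε := min_le_left _ _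
  have hrρ : r ≤ ρ / 2 := min_le_right _ _
  -- (1) sites of the ball are occupied
  have hfin : (closedBall (0 : E) R ∩ P.points).Finite := P.finite_inter_points isBounded_closedBall
  have h1 : ∀ p ∈ hfin.toFinset, ∀ᶠ j in atTop, ∃ i, dist (y j i) p ≤ ε := by
    intro p hp
    rw [Set.Finite.mem_toFinset] at hp
    obtain ⟨-, hpP⟩ := hp
    -- the limit of the bump sums is m p ≥ 1
    have hlim : (∑' s : P.points, (m s : ℝ) * bump p r s) = m p := by
      rw [tsum_eq_single ⟨p, hpP⟩]
      · simp [bump_self p r]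
      · rintro ⟨s, hs⟩ hne
        have hsp : s ≠ p := fun h' => hne (Subtype.ext h')
        have hd : r ≤ dist s p := by linarith [hsep s hs p hpP hsp]
        simp [bump_eq_zero hr0 hd]
    have ht := h (bump p r) (continuous_bump p r) (hasCompactSupport_bump p hr0)
    rw [hlim] at ht
    have hmp : (1 : ℝ) ≤ m p := by exact_mod_cast hm p hpP
    have hev : ∀ᶠ j in atTop, (1 : ℝ) / 2 < ∑ i, bump p r (y j i) :=
      ht.eventually (lt_mem_nhds (by linarith))
    refine hev.mono fun j hj => ?_
    by_contra hno
    push Not at hno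
    have : ∑ i, bump p r (y j i) = 0 := by
      refine Finset.sum_eq_zero fun i _ => ?_
      have hnot : ¬ 0 < bump p r (y j i) := by
        rw [bump_pos_iff hr0]
        intro hlt
        exact absurd (hlt.le.trans hrε) (not_le.2 (hno i))
      exact le_antisymm (not_lt.1 hnot) (bump_nonneg _ _ _)
    rw [this] at hj; linarith
  have h1' : ∀ᶠ j in atTop, ∀ p ∈ hfin.toFinset, ∃ i, dist (y j i) p ≤ ε :=
    (hfin.toFinset.eventually_all).2 h1
  -- (2) no stray particles
  have hP0 : P.points.Nonempty := P.points_nonempty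
  have hlim2 : (∑' s : P.points, (m s : ℝ) * vacuumTest P.points R ε s) = 0 := by
    have : ∀ s : P.points, (m s : ℝ) * vacuumTest P.points R ε s = 0 := fun s => by
      rw [vacuumTest_eq_zero_of_mem hε s.2, mul_zero]
    simp [this]
  have ht2 := h (vacuumTest P.points R ε) (continuous_vacuumTest _ _ _) (hasCompactSupport_vacuumTest _ _ _)
  rw [hlim2] at ht2
  have h2 : ∀ᶠ j in atTop, ∑ i, vacuumTest P.points R ε (y j i) < 1 := ht2.eventually (gt_mem_nhds one_pos)
  filter_upwards [h1', h2] with j hj1 hj2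
  constructor
  · -- every site in the ball is occupied
    intro s hs hsR
    have hs' : s ∈ hfin.toFinset := by
      rw [Set.Finite.mem_toFinset]; exact ⟨by rwa [mem_closedBall], hs⟩
    obtain ⟨i, hi⟩ := hj1 s hs'
    exact ⟨y j i, ⟨i, rfl⟩, hi⟩
  · -- every particle in the ball is near a site
    rintro a ⟨i, rfl⟩ haR
    rw [dist_zero_right] at haR
    by_contra hno
    push Not at hno
    have hfar : ε ≤ infDist (y j i) P.points := by
      by_contra hlt
      rw [not_le, infDist_lt_iff hP0] at hlt
      obtain ⟨s, hs, hds⟩ := hlt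
      exact absurd hds.le (not_le.2 (hno s hs))
    have hone : vacuumTest P.points R ε (y j i) = 1 := vacuumTest_eq_one hε haR hfar
    have : (1 : ℝ) ≤ ∑ i, vacuumTest P.points R ε (y j i) := by
      rw [← hone]
      exact Finset.single_le_sum (fun k _ => vacuumTest_nonneg _ _ _ _) (Finset.mem_univ i)
    linarith

end Summit.AtomisticToContinuum.Crystallization.Cruxes.DefectFreeCrystallizes.Disproof.VagueToMatching

end


/-! ## §8.2 The ruler (2-adic) Hägg word has no periodic stretch of `4p` layers (`rulerHagg_periodic_stretch_lt`) -/

noncomputable section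

namespace Summit.AtomisticToContinuum.Crystallization.Cruxes.DefectFreeCrystallizes.Disproof.RulerHagg

open Literature.MathematicalPhysics.StatisticalMechanics

/-- The 2-adic valuation of `k + 1` (`0` at `k = -1` by the junk value `v₂(0) = 0`). -/
def rulerVal (k : ℤ) : ℕ := padicValInt 2 (k + 1)

/-- **The ruler (period-doubling) Hägg sequence**: `+1` where `v₂(k+1)` is even, `−1` where it is odd.
Its stacking `…` is the 2-adic Barlow stacking of the gen-1 witness. [folklore] -/
def rulerHagg (k : ℤ) : ℤ := if Even (rulerVal k) then 1 else -1

/-- It is a genuine `±1` sequence. [folklore] -/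
theorem isHaggSeq_rulerHagg : IsHaggSeq rulerHagg := by
  intro k; unfold rulerHagg; split_ifs <;> simp


/-- `v₂(2^(a+1)·m) = a + 1` for odd `m`. [folklore] -/
theorem padicValInt_two_pow_mul_odd (a : ℕ) {m : ℤ} (hm : Odd m) :
    padicValInt 2 (2 ^ (a + 1) * m) = a + 1 := by
  have hm0 : m ≠ 0 := by rintro rfl; exact (Int.not_even_iff_odd.2 hm) ⟨0, by simp⟩
  have h2 : (2 : ℤ) ^ (a + 1) ≠ 0 := pow_ne_zero _ two_ne_zero
  rw [padicValInt.mul h2 hm0]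
  have hv : padicValInt 2 m = 0 := by
    apply padicValInt.eq_zero_of_not_dvd
    intro hd
    exact (Int.not_even_iff_odd.2 hm) (even_iff_two_dvd.2 (by exact_mod_cast hd))
  have hp : padicValInt 2 ((2 : ℤ) ^ (a + 1)) = a + 1 := by
    have : ((2 : ℤ) ^ (a + 1)) = ((2 ^ (a + 1) : ℕ) : ℤ) := by push_cast; rfl
    rw [this, padicValInt.of_nat, padicValNat.prime_pow]
  rw [hp, hv, add_zero]

/-- `v₂(2^a·m) = a` for odd `m`. [folklore] -/
theorem padicValInt_two_pow_mul_odd' (a : ℕ) {m : ℤ} (hm : Odd m) :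
    padicValInt 2 (2 ^ a * m) = a := by
  cases a with
  | zero =>
    rw [pow_zero, one_mul]
    apply padicValInt.eq_zero_of_not_dvd
    intro hd
    exact (Int.not_even_iff_odd.2 hm) (even_iff_two_dvd.2 (by exact_mod_cast hd))
  | succ a => exact padicValInt_two_pow_mul_odd a hm

/-- **No long periodic stretches.** For every shift `p ≥ 1` and every start `k₀`, within `4p`
consecutive layers the ruler sequence disagrees with its `p`-shift somewhere: writing `p = 2^a q` with
`q` odd, the layer `k` with `k + 1 = 2^(a+1)·(odd)` has `v₂(k+1) = a+1` but `v₂(k+1+p) = a`. [folklore] -/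
theorem rulerHagg_ne_shift (p : ℕ) (hp : 0 < p) (k₀ : ℤ) :
    ∃ k : ℤ, k₀ ≤ k ∧ k < k₀ + 4 * p ∧ rulerHagg (k + p) ≠ rulerHagg k := by
  obtain ⟨a, q, hq, hpq⟩ := Nat.exists_eq_two_pow_mul_odd hp.ne'
  set M : ℤ := 2 ^ (a + 2) with hM
  have hM0 : 0 < M := by positivity
  set t : ℤ := k₀ + 1 with ht
  set e : ℤ := (2 ^ (a + 1) - t) % M with he
  have he0 : 0 ≤ e := Int.emod_nonneg _ hM0.ne'
  have heM : e < M := Int.emod_lt_of_pos _ hM0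
  -- (2^(a+1) - t) - e = M * n
  set n : ℤ := (2 ^ (a + 1) - t) / M with hn
  have hdiv : (2 : ℤ) ^ (a + 1) - t = M * n + e := by
    have := Int.emod_add_ediv_mul ((2 : ℤ) ^ (a + 1) - t) M
    rw [← hn, ← he] at this; linarith
  refine ⟨k₀ + e, by linarith, ?_, ?_⟩
  · -- M = 2^(a+2) ≤ 4 p
    have hMp : M ≤ 4 * (p : ℤ) := by
      rw [hM, hpq]; push_cast
      have : (1 : ℤ) ≤ q := by exact_mod_cast hq.pos
      calc (2 : ℤ) ^ (a + 2) = 4 * (2 ^ a * 1) := by ring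
        _ ≤ 4 * (2 ^ a * (q : ℤ)) := by gcongr
    linarith
  · -- valuations
    have hk1 : k₀ + e + 1 = 2 ^ (a + 1) * (1 - 2 * n) := by
      have : e = 2 ^ (a + 1) - t - M * n := by linarith
      rw [this, ht, hM]; ring
    have hk2 : k₀ + e + p + 1 = 2 ^ a * (2 * (1 - 2 * n) + q) := by
      have : (p : ℤ) = 2 ^ a * q := by rw [hpq]; push_cast; ring
      rw [add_assoc, add_comm (p : ℤ) 1, ← add_assoc, hk1, this]; ring
    have hodd1 : Odd (1 - 2 * n) := by
      refine ⟨-n, by ring⟩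
    have hodd2 : Odd (2 * (1 - 2 * n) + (q : ℤ)) := by
      obtain ⟨r, hr⟩ := hq
      refine ⟨1 - 2 * n + r, ?_⟩
      rw [hr]; push_cast; ring
    have hv1 : rulerVal (k₀ + e) = a + 1 := by
      rw [rulerVal, hk1]; exact padicValInt_two_pow_mul_odd a hodd1
    have hv2 : rulerVal (k₀ + e + p) = a := by
      rw [rulerVal, hk2]; exact padicValInt_two_pow_mul_odd' a hodd2
    unfold rulerHagg
    rw [hv1, hv2]
    rcases Nat.even_or_odd a with ha | ha
    · have : ¬ Even (a + 1) := Nat.not_even_iff_odd.2 ha.add_one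
      simp [ha, this]
    · have : Even (a + 1) := ha.add_one
      have hna : ¬ Even a := Nat.not_even_iff_odd.2 ha
      simp [hna, this]

/-- Equivalently: a stretch on which the ruler sequence is `p`-periodic has fewer than `4p` layers. -/
theorem rulerHagg_periodic_stretch_lt {p : ℕ} (hp : 0 < p) {k₀ : ℤ} {L : ℕ}
    (h : ∀ k : ℤ, k₀ ≤ k → k < k₀ + L → rulerHagg (k + p) = rulerHagg k) : L < 4 * p := by
  by_contra hL
  push Not at hL
  obtain ⟨k, hk1, hk2, hne⟩ := rulerHagg_ne_shift p hp k₀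
  have hL' : (4 * p : ℤ) ≤ L := by exact_mod_cast hL
  exact hne (h k hk1 (by linarith))

end Summit.AtomisticToContinuum.Crystallization.Cruxes.DefectFreeCrystallizes.Disproof.RulerHagg

end


/-! ## §8.3 Self-matched stacking windows have periodic Hägg words (`shift_of_match`, `periodic_of_selfmatch`) -/

noncomputable section

namespace Summit.AtomisticToContinuum.Crystallization.Cruxes.DefectFreeCrystallizes.Disproof.StackingShift

open Literature.MathematicalPhysics.StatisticalMechanics Literature.Geometry.DiscreteGeometry
open Filter Set Metric

local notation "E3" => EuclideanSpace ℝ (Fin 3)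

/-- Ideal layer spacing `√(2/3)` (the line's `hIdeal`). -/
def hI : ℝ := Real.sqrt (2 / 3)

/-- `hI² = 2/3`. [folklore] -/
theorem hI_sq : hI ^ 2 = 2 / 3 := Real.sq_sqrt (by norm_num)

/-- `hI > 4/5` (indeed `≈ 0.8165`). [folklore] -/
theorem hI_gt : 4 / 5 < hI := by
  rw [hI, show (4 : ℝ) / 5 = Real.sqrt ((4 / 5) ^ 2) by rw [Real.sqrt_sq (by norm_num)]]
  exact Real.sqrt_lt_sqrt (by norm_num) (by norm_num)

/-- `hI < 1`. [folklore] -/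
theorem hI_lt_one : hI < 1 := by
  rw [hI, show (1 : ℝ) = Real.sqrt 1 by simp]
  exact Real.sqrt_lt_sqrt (by norm_num) (by norm_num)

/-- `hI > 0`. [folklore] -/
theorem hI_pos : 0 < hI := by linarith [hI_gt]

variable {s : ℤ → ℤ}

/-- Shorthand for the points of the unit-spacing ideal Barlow stacking of `s`. -/
abbrev bp (s : ℤ → ℤ) (k i j : ℤ) : E3 := barlowPos 1 hI s k i j

/-- An integer of absolute value `< 1` (after scaling by `hI`) vanishes. -/
theorem int_eq_zero_of_abs_mul_hI_lt {m : ℤ} (h : |(m : ℝ) * hI| < hI) : m = 0 := by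
  by_contra hm
  have h1 : (1 : ℝ) ≤ |(m : ℝ)| := by
    rw [← Int.cast_abs]; exact_mod_cast Int.one_le_abs hm
  rw [abs_mul, abs_of_pos hI_pos] at h
  nlinarith [hI_pos]

/-- The integer quadratic forms behind the lateral offsets `∓2w` (from `Negative.SqueezeWindowNeedsMinimality`'s
sibling computation): `(m + n/2 − 1)² + ¾(n − ⅔)² ≥ ⅓`. [folklore] -/
theorem lateral_form_ge (m n : ℤ) : (1 : ℝ) / 3 ≤ ((m : ℝ) + n / 2 - 1) ^ 2 + 3 / 4 * ((n : ℝ) - 2 / 3) ^ 2 := by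
  rcases eq_or_ne n 1 with rfl | hn
  · have h1 : (1 : ℤ) ≤ (2 * m - 1) ^ 2 := by
      rcases le_or_gt 1 m with h | h <;> nlinarith
    have h1' : (1 : ℝ) ≤ (2 * (m : ℝ) - 1) ^ 2 := by exact_mod_cast h1
    push_cast
    nlinarith
  · have h1 : (4 : ℤ) ≤ (3 * n - 2) ^ 2 := by
      rcases le_or_gt 2 n with h | h
      · nlinarith
      · have : n ≤ 0 := by omega
        nlinarith
    have h1' : (4 : ℝ) ≤ (3 * (n : ℝ) - 2) ^ 2 := by exact_mod_cast h1
    nlinarith [sq_nonneg ((m : ℝ) + n / 2 - 1)]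

/-- The mirrored form `(m + n/2 + 1)² + ¾(n + ⅔)² ≥ ⅓`. [folklore] -/
theorem lateral_form_ge' (m n : ℤ) : (1 : ℝ) / 3 ≤ ((m : ℝ) + n / 2 + 1) ^ 2 + 3 / 4 * ((n : ℝ) + 2 / 3) ^ 2 := by
  have := lateral_form_ge (-m) (-n)
  push_cast at this
  nlinarith [this]

/-- Coordinates of a difference of stacking points. [folklore] -/
theorem bp_sub_apply (k i j k' i' j' : ℤ) :
    (bp s k' i' j' - bp s k i j) 0 = ((i' : ℝ) - i) + ((j' : ℝ) - j) / 2 + ((haggLabel s k' : ℝ) - haggLabel s k) / 2 ∧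
    (bp s k' i' j' - bp s k i j) 1 = Real.sqrt 3 / 2 * (((j' : ℝ) - j) + ((haggLabel s k' : ℝ) - haggLabel s k) / 3) ∧
    (bp s k' i' j' - bp s k i j) 2 = ((k' : ℝ) - k) * hI := by
  refine ⟨?_, ?_, ?_⟩ <;> simp [bp] <;> ring

/-- **The shift lemma.** If the stacking point `p' = bp k' i' j'` is within `η` of `p + g` (`p = bp k i j`) and
`q' = bp k'' i'' j''` is within `η` of `q + g`, where `q = bp (k+1) i j` is the point of the next layer above the
same `(i, j)`, and `|g₂ − Δk·hI| ≤ η` with `η ≤ 1/20`, then `p'` lies in layer `k + Δk` and the Hägg letters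
agree: `s (k + Δk) = s k` (the lateral offset `±2w` that a disagreement would require is `≥ 1/√3` from the layer
lattice). [folklore] -/
theorem shift_of_match (hs : IsHaggSeq s) {k i j k' i' j' k'' i'' j'' Δk : ℤ} {g : E3} {η : ℝ} (hη : η ≤ 1 / 20)
    (h1 : dist (bp s k' i' j') (bp s k i j + g) ≤ η)
    (h2 : dist (bp s k'' i'' j'') (bp s (k + 1) i j + g) ≤ η)
    (hg : |g 2 - Δk * hI| ≤ η) :
    k' = k + Δk ∧ s k' = s k := by
  have hη0 : 0 ≤ η := dist_nonneg.trans h1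
  -- coordinate bounds
  have c1 : ∀ l : Fin 3, |(bp s k' i' j') l - ((bp s k i j) l + g l)| ≤ η := fun l => by
    have := (PiLp.dist_apply_le (bp s k' i' j') (bp s k i j + g) l).trans h1
    rwa [Real.dist_eq, PiLp.add_apply] at this
  have c2 : ∀ l : Fin 3, |(bp s k'' i'' j'') l - ((bp s (k + 1) i j) l + g l)| ≤ η := fun l => by
    have := (PiLp.dist_apply_le (bp s k'' i'' j'') (bp s (k + 1) i j + g) l).trans h2
    rwa [Real.dist_eq, PiLp.add_apply] at this
  -- layers
  have hz1 := c1 2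
  have hz2 := c2 2
  simp only [bp, barlowPos_apply_two] at hz1 hz2
  have hk' : k' = k + Δk := by
    have : |((k' - (k + Δk) : ℤ) : ℝ) * hI| < hI := by
      push_cast
      have e : ((k' : ℝ) - (k + Δk)) * hI = ((k' : ℝ) * hI - ((k : ℝ) * hI + g 2)) + (g 2 - Δk * hI) := by ring
      rw [e]
      calc |((k' : ℝ) * hI - ((k : ℝ) * hI + g 2)) + (g 2 - Δk * hI)| ≤ |(k' : ℝ) * hI - ((k : ℝ) * hI + g 2)| + |g 2 - Δk * hI| :=
            abs_add_le _ _
        _ ≤ η + η := add_le_add hz1 hg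
        _ < hI := by linarith [hI_gt]
    have := int_eq_zero_of_abs_mul_hI_lt this
    omega
  have hk'' : k'' = k' + 1 := by
    have : |((k'' - (k' + 1) : ℤ) : ℝ) * hI| < hI := by
      push_cast
      rw [hk']; push_cast
      have e : ((k'' : ℝ) - (k + Δk + 1)) * hI = ((k'' : ℝ) * hI - (((k + 1 : ℤ) : ℝ) * hI + g 2)) + (g 2 - Δk * hI) := by
        push_cast; ring
      rw [e]
      calc _ ≤ |(k'' : ℝ) * hI - (((k + 1 : ℤ) : ℝ) * hI + g 2)| + |g 2 - Δk * hI| := abs_add_le _ _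
        _ ≤ η + η := add_le_add hz2 hg
        _ < hI := by linarith [hI_gt]
    have := int_eq_zero_of_abs_mul_hI_lt this
    omega
  refine ⟨hk', ?_⟩
  -- lateral analysis
  have hx1 := c1 0
  have hx2 := c2 0
  have hy1 := c1 1
  have hy2 := c2 1
  simp only [bp, barlowPos_apply_zero, barlowPos_apply_one, one_mul] at hx1 hx2 hy1 hy2
  rw [hk''] at hx2 hy2
  rw [haggLabel_succ, haggLabel_succ] at hx2 hy2
  set A : ℝ := ((i'' : ℝ) - i') + ((j'' : ℝ) - j') / 2 + ((s k' : ℝ) - s k) / 2 with hA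
  set B : ℝ := ((j'' : ℝ) - j') + ((s k' : ℝ) - s k) / 3 with hB
  have dx : |A| ≤ 2 * η := by
    have e : A =
        (((i'' : ℝ) + (j'' : ℝ) / 2 + ((haggLabel s k' + s k' : ℤ) : ℝ) / 2) - (((i : ℝ) + (j : ℝ) / 2 + ((haggLabel s k + s k : ℤ) : ℝ) / 2) + g 0))
        - (((i' : ℝ) + (j' : ℝ) / 2 + (haggLabel s k' : ℝ) / 2) - (((i : ℝ) + (j : ℝ) / 2 + (haggLabel s k : ℝ) / 2) + g 0)) := by
      rw [hA]; push_cast; ring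
    rw [e]
    calc _ ≤ _ := abs_sub _ _
      _ ≤ η + η := add_le_add hx2 hx1
      _ = 2 * η := by ring
  have dy : Real.sqrt 3 / 2 * |B| ≤ 2 * η := by
    have h3 : (0 : ℝ) ≤ Real.sqrt 3 / 2 := by positivity
    have e : Real.sqrt 3 / 2 * B =
        (Real.sqrt 3 / 2 * ((j'' : ℝ) + ((haggLabel s k' + s k' : ℤ) : ℝ) / 3) - (Real.sqrt 3 / 2 * ((j : ℝ) + ((haggLabel s k + s k : ℤ) : ℝ) / 3) + g 1))
        - (Real.sqrt 3 / 2 * ((j' : ℝ) + (haggLabel s k' : ℝ) / 3) - (Real.sqrt 3 / 2 * ((j : ℝ) + (haggLabel s k : ℝ) / 3) + g 1)) := by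
      rw [hB]; push_cast; ring
    rw [← abs_of_nonneg h3, ← abs_mul, e]
    calc _ ≤ _ := abs_sub _ _
      _ ≤ η + η := add_le_add hy2 hy1
      _ = 2 * η := by ring
  -- squares
  have h3sq : Real.sqrt 3 ^ 2 = 3 := Real.sq_sqrt (by norm_num)
  have dx2 : A ^ 2 ≤ 4 * η ^ 2 := by
    have := pow_le_pow_left₀ (abs_nonneg _) dx 2
    rw [sq_abs] at this; linarith [this]
  have dy2 : 3 / 4 * B ^ 2 ≤ 4 * η ^ 2 := by
    have := pow_le_pow_left₀ (by positivity) dy 2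
    rw [mul_pow, sq_abs, div_pow, h3sq] at this; linarith [this]
  have hη2 : η ^ 2 ≤ 1 / 400 := by nlinarith
  -- case analysis on the letters
  rcases hs k with hsk | hsk <;> rcases hs k' with hsk' | hsk'
  · rw [hsk, hsk']
  · exfalso
    have key := lateral_form_ge (i'' - i') (j'' - j')
    have hA' : A = ((i'' - i' : ℤ) : ℝ) + ((j'' - j' : ℤ) : ℝ) / 2 - 1 := by rw [hA, hsk, hsk']; push_cast; ring
    have hB' : B = ((j'' - j' : ℤ) : ℝ) - 2 / 3 := by rw [hB, hsk, hsk']; push_cast; ring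
    rw [hA'] at dx2; rw [hB'] at dy2
    linarith
  · exfalso
    have key := lateral_form_ge' (i'' - i') (j'' - j')
    have hA' : A = ((i'' - i' : ℤ) : ℝ) + ((j'' - j' : ℤ) : ℝ) / 2 + 1 := by rw [hA, hsk, hsk']; push_cast; ring
    have hB' : B = ((j'' - j' : ℤ) : ℝ) + 2 / 3 := by rw [hB, hsk, hsk']; push_cast; ring
    rw [hA'] at dx2; rw [hB'] at dy2
    linarith
  · rw [hsk, hsk']

/-- `dist ≤ |Δx| + |Δy| + |Δz|` on `ℝ³`. [folklore] -/
theorem dist_le_sum_abs (p q : E3) : dist p q ≤ |p 0 - q 0| + |p 1 - q 1| + |p 2 - q 2| := by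
  rw [EuclideanSpace.dist_eq, Fin.sum_univ_three]
  simp only [Real.dist_eq]
  have h0 := abs_nonneg (p 0 - q 0); have h1 := abs_nonneg (p 1 - q 1); have h2 := abs_nonneg (p 2 - q 2)
  rw [Real.sqrt_le_left (by positivity)]
  nlinarith [sq_abs (p 0 - q 0), sq_abs (p 1 - q 1), sq_abs (p 2 - q 2)]

/-- **Every layer has a point laterally within `1/2 + 1/2` of any target** (rounding in the `(u, v)` frame). -/
theorem exists_layer_point_near (s : ℤ → ℤ) (k : ℤ) (x y : ℝ) :
    ∃ i j : ℤ, |bp s k i j 0 - x| ≤ 1 / 2 ∧ |bp s k i j 1 - y| ≤ 1 / 2 := by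
  have hsq3 : (0 : ℝ) < Real.sqrt 3 := by positivity
  have h3 : Real.sqrt 3 ^ 2 = 3 := Real.sq_sqrt (by norm_num)
  set L : ℝ := (haggLabel s k : ℝ) with hL
  set j : ℤ := round (2 * y / Real.sqrt 3 - L / 3) with hj
  set i : ℤ := round (x - (j : ℝ) / 2 - L / 2) with hi
  refine ⟨i, j, ?_, ?_⟩
  · simp only [bp, barlowPos_apply_zero, one_mul]
    have := abs_sub_round (x - (j : ℝ) / 2 - L / 2)
    rw [← hi] at this
    rw [abs_sub_comm] at this
    have e : (i : ℝ) + (j : ℝ) / 2 + L / 2 - x = (i : ℝ) - (x - (j : ℝ) / 2 - L / 2) := by ring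
    rw [e]; rw [hL] at this; exact this
  · simp only [bp, barlowPos_apply_one, one_mul]
    have hr := abs_sub_round (2 * y / Real.sqrt 3 - L / 3)
    rw [← hj] at hr
    have e : Real.sqrt 3 / 2 * ((j : ℝ) + L / 3) - y = -(Real.sqrt 3 / 2) * ((2 * y / Real.sqrt 3 - L / 3) - j) := by
      field_simp; ring
    rw [hL] at hr; rw [e, abs_mul, abs_neg, abs_of_pos (by positivity : (0 : ℝ) < Real.sqrt 3 / 2)]
    have hs2 : Real.sqrt 3 / 2 ≤ 1 := by
      rw [div_le_one (by norm_num : (0:ℝ) < 2)]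
      have : Real.sqrt 3 ≤ Real.sqrt 4 := Real.sqrt_le_sqrt (by norm_num)
      have h4 : Real.sqrt 4 = 2 := by rw [show (4:ℝ) = 2 ^ 2 by norm_num, Real.sqrt_sq (by norm_num)]
      linarith
    calc Real.sqrt 3 / 2 * |2 * y / Real.sqrt 3 - ↑(haggLabel s k) / 3 - ↑j| ≤ 1 * (1 / 2) := by
          gcongr
      _ = 1 / 2 := by ring

/-- Coordinates of the interlayer step `bp (k+1) i j − bp k i j = s k • w + h e₃`. [folklore] -/
theorem bp_succ_apply (k i j : ℤ) :
    bp s (k + 1) i j 0 = bp s k i j 0 + (s k : ℝ) / 2 ∧ bp s (k + 1) i j 1 = bp s k i j 1 + Real.sqrt 3 / 6 * (s k : ℝ) ∧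
      bp s (k + 1) i j 2 = bp s k i j 2 + hI := by
  simp only [bp, barlowPos_apply_zero, barlowPos_apply_one, barlowPos_apply_two, haggLabel_succ, one_mul]
  push_cast
  exact ⟨by ring, by ring, by ring⟩

/-- **The window lemma.** Let `X ⊆ S` contain every stacking point of the window `B̄(c, R₂)` ("bulk"), and let
every point of `X` in the window have a STACKING point within `η ≤ 1/20` of its translate by `g`
("forward self-matching"), where `g₂` is within `η` of `Δk · hI`.  Then the Hägg word is `Δk`-periodic across
the window: `s (k + Δk) = s k` for every layer `k` with `|k·hI − c₂| ≤ R₂ − 3`. [folklore] -/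
theorem periodic_of_selfmatch (hs : IsHaggSeq s) {X : Set E3} {c g : E3} {R₂ η : ℝ} {Δk : ℤ} (hη : η ≤ 1 / 20)
    (hbulk : ∀ k i j : ℤ, dist (bp s k i j) c ≤ R₂ → bp s k i j ∈ X)
    (hmatch : ∀ p ∈ X, dist p c ≤ R₂ → ∃ k' i' j' : ℤ, dist (bp s k' i' j') (p + g) ≤ η)
    (hg : |g 2 - Δk * hI| ≤ η) :
    ∀ k : ℤ, |k * hI - c 2| ≤ R₂ - 3 → s (k + Δk) = s k := by
  intro k hk
  obtain ⟨i, j, hx, hy⟩ := exists_layer_point_near s k (c 0) (c 1)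
  obtain ⟨ex, ey, ez⟩ := bp_succ_apply (s := s) k i j
  have hz : bp s k i j 2 = k * hI := by simp [bp]
  -- both p and its upper neighbour q lie in the window
  have hp : dist (bp s k i j) c ≤ R₂ := by
    have := dist_le_sum_abs (bp s k i j) c
    rw [hz] at this
    linarith
  have hq : dist (bp s (k + 1) i j) c ≤ R₂ := by
    have := dist_le_sum_abs (bp s (k + 1) i j) c
    rw [ex, ey, ez, hz] at this
    have h1 : |bp s k i j 0 + (s k : ℝ) / 2 - c 0| ≤ 1 := by
      rcases hs k with h | h <;> rw [h] <;> push_cast <;>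
        [exact (abs_sub_le_iff.2 ⟨by linarith [(abs_le.1 hx).1, (abs_le.1 hx).2], by linarith [(abs_le.1 hx).1, (abs_le.1 hx).2]⟩);
         exact (abs_sub_le_iff.2 ⟨by linarith [(abs_le.1 hx).1, (abs_le.1 hx).2], by linarith [(abs_le.1 hx).1, (abs_le.1 hx).2]⟩)]
    have hs6 : |Real.sqrt 3 / 6 * (s k : ℝ)| ≤ 1 / 2 := by
      have hsq : Real.sqrt 3 ≤ 2 := by
        have : Real.sqrt 3 ≤ Real.sqrt 4 := Real.sqrt_le_sqrt (by norm_num)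
        have h4 : Real.sqrt 4 = 2 := by rw [show (4:ℝ) = 2 ^ 2 by norm_num, Real.sqrt_sq (by norm_num)]
        linarith
      have hs1 : |(s k : ℝ)| = 1 := by rcases hs k with h | h <;> rw [h] <;> simp
      rw [abs_mul, hs1, mul_one, abs_of_nonneg (by positivity)]
      linarith
    have h2 : |bp s k i j 1 + Real.sqrt 3 / 6 * (s k : ℝ) - c 1| ≤ 1 := by
      have := abs_add_le (bp s k i j 1 - c 1) (Real.sqrt 3 / 6 * (s k : ℝ))
      have e : bp s k i j 1 - c 1 + Real.sqrt 3 / 6 * (s k : ℝ) = bp s k i j 1 + Real.sqrt 3 / 6 * (s k : ℝ) - c 1 := by ring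
      rw [e] at this; linarith
    have h3 : |k * hI + hI - c 2| ≤ R₂ - 3 + hI := by
      have := abs_add_le (k * hI - c 2) hI
      have e : k * hI - c 2 + hI = k * hI + hI - c 2 := by ring
      rw [e, abs_of_pos hI_pos] at this; linarith
    linarith [hI_lt_one]
  -- matches
  obtain ⟨k', i', j', h1⟩ := hmatch _ (hbulk k i j hp) hp
  obtain ⟨k'', i'', j'', h2⟩ := hmatch _ (hbulk (k + 1) i j hq) hq
  obtain ⟨hk', hsk⟩ := shift_of_match hs hη h1 h2 hg
  rw [← hk']; exact hsk


end Summit.AtomisticToContinuum.Crystallization.Cruxes.DefectFreeCrystallizes.Disproof.StackingShift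

end


/-! ## §8.4 The witness blocks: distance gap, lex-filled boxes, interior sites are good, defect density → 0 (`tendsto_defects_block`) -/

noncomputable section

namespace Summit.AtomisticToContinuum.Crystallization.Cruxes.DefectFreeCrystallizes.Disproof.StackingBlocks

open Literature.MathematicalPhysics.StatisticalMechanics Literature.Geometry.DiscreteGeometry
open Filter Set Metric

local notation "E3" => EuclideanSpace ℝ (Fin 3)

open StackingShift (hI hI_sq hI_pos hI_lt_one bp)

/-- `hI² = 2/3 · 1²` (the shape `le_dist_of_mem_barlowStacking_ideal` wants). [folklore] -/
theorem hI_sq' : hI ^ 2 = 2 / 3 * (1 : ℝ) ^ 2 := by rw [hI_sq]; ring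

variable {s : ℤ → ℤ}

/-! ### The distance gap -/

/-- `m² + mn + n² = 1` forces `|m|, |n| ≤ 1`. [folklore] -/
theorem abs_le_one_of_form_eq_one {m n : ℤ} (h : m ^ 2 + m * n + n ^ 2 = 1) : |m| ≤ 1 ∧ |n| ≤ 1 := by
  constructor
  · have : 3 * m ^ 2 ≤ 4 := by nlinarith [sq_nonneg (2 * n + m)]
    rw [abs_le]; constructor <;> nlinarith
  · have : 3 * n ^ 2 ≤ 4 := by nlinarith [sq_nonneg (2 * m + n)]
    rw [abs_le]; constructor <;> nlinarith

/-- Squared distance of two stacking points, split by layer difference: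
`d² = (Δi + Δj/2 + ΔL/2)² + ¾(Δj + ΔL/3)² + ⅔ Δk²`. [folklore] -/
theorem dist_bp_sq (k i j k' i' j' : ℤ) :
    dist (bp s k i j) (bp s k' i' j') ^ 2 =
      (((i : ℝ) - i') + ((j : ℝ) - j') / 2 + ((haggLabel s k : ℝ) - haggLabel s k') / 2) ^ 2 +
      3 / 4 * (((j : ℝ) - j') + ((haggLabel s k : ℝ) - haggLabel s k') / 3) ^ 2 +
      2 / 3 * ((k : ℝ) - k') ^ 2 := by
  rw [bp, bp, dist_barlowPos_sq]
  have h3 : Real.sqrt 3 ^ 2 = 3 := Real.sq_sqrt (by norm_num)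
  have hh := hI_sq
  simp only [one_mul, mul_pow, div_pow]
  nlinarith [h3, hh]

/-- `d ≥ 0`, `d² = 1` ⇒ `d = 1`. [folklore] -/
theorem eq_one_of_sq_eq_one {d : ℝ} (h0 : 0 ≤ d) (h : d ^ 2 = 1) : d = 1 := by
  have h1 : (d - 1) * (d + 1) = 0 := by nlinarith [h]
  rcases mul_eq_zero.1 h1 with h2 | h2 <;> linarith

/-- Same-layer integer form: `1 ≤ m² + mn + n² < 2` forces the value `1` and `|m|, |n| ≤ 1`. [folklore] -/
theorem same_layer_form {m n : ℤ} (hne : (m, n) ≠ (0, 0)) (hlt : m ^ 2 + m * n + n ^ 2 < 2) :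
    m ^ 2 + m * n + n ^ 2 = 1 ∧ |m| ≤ 1 ∧ |n| ≤ 1 := by
  have hge1 : (1 : ℤ) ≤ m ^ 2 + m * n + n ^ 2 := one_le_sq_add_mul_add_sq hne
  have heq : m ^ 2 + m * n + n ^ 2 = 1 := by omega
  exact ⟨heq, abs_le_one_of_form_eq_one heq⟩

/-- Adjacent-layer integer form: `f = m² + n² + mn + σ(m + n)` (`σ = ±1`) is `≥ 0`, and `f < 1` forces `f = 0`
with `|m|, |n| ≤ 1` (`12 f = 3(2m + n + σ)² + (3n + σ)² − 4`). [folklore] -/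
theorem adj_layer_form {σ m n : ℤ} (hσ : σ = 1 ∨ σ = -1) (hlt : m ^ 2 + n ^ 2 + m * n + σ * m + σ * n < 1) :
    m ^ 2 + n ^ 2 + m * n + σ * m + σ * n = 0 ∧ |m| ≤ 1 ∧ |n| ≤ 1 := by
  have hσ2 : σ ^ 2 = 1 := by rcases hσ with h | h <;> rw [h] <;> norm_num
  have e : 12 * (m ^ 2 + n ^ 2 + m * n + σ * m + σ * n) = 3 * (2 * m + n + σ) ^ 2 + (3 * n + σ) ^ 2 - 4 := by
    nlinarith [hσ2]
  have e' : 12 * (m ^ 2 + n ^ 2 + m * n + σ * m + σ * n) = 3 * (2 * n + m + σ) ^ 2 + (3 * m + σ) ^ 2 - 4 := by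
    nlinarith [hσ2]
  have hge : 0 ≤ m ^ 2 + n ^ 2 + m * n + σ * m + σ * n := by
    nlinarith [sq_nonneg (2 * m + n + σ), sq_nonneg (3 * n + σ)]
  have heq : m ^ 2 + n ^ 2 + m * n + σ * m + σ * n = 0 := by omega
  refine ⟨heq, ?_, ?_⟩
  · have h1 : (3 * m + σ) ^ 2 ≤ 4 := by nlinarith [sq_nonneg (2 * n + m + σ)]
    have h2 : -2 ≤ 3 * m + σ ∧ 3 * m + σ ≤ 2 := by
      constructor <;> nlinarith [sq_nonneg (3 * m + σ + 2), sq_nonneg (3 * m + σ - 2)]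
    rw [abs_le]; rcases hσ with h | h <;> rw [h] at h2 <;> omega
  · have h1 : (3 * n + σ) ^ 2 ≤ 4 := by nlinarith [sq_nonneg (2 * m + n + σ)]
    have h2 : -2 ≤ 3 * n + σ ∧ 3 * n + σ ≤ 2 := by
      constructor <;> nlinarith [sq_nonneg (3 * n + σ + 2), sq_nonneg (3 * n + σ - 2)]
    rw [abs_le]; rcases hσ with h | h <;> rw [h] at h2 <;> omega

/-- **The gap.** Two DISTINCT points of the unit ideal stacking at distance `≤ 6/5` are at distance exactly `1`,
and their indices differ by at most `1` in each of `k, i, j`. [folklore] -/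
theorem gap (hs : IsHaggSeq s) {k i j k' i' j' : ℤ} (hne : (k, i, j) ≠ (k', i', j'))
    (hd : dist (bp s k i j) (bp s k' i' j') ≤ 6 / 5) :
    dist (bp s k i j) (bp s k' i' j') = 1 ∧ |k - k'| ≤ 1 ∧ |i - i'| ≤ 1 ∧ |j - j'| ≤ 1 := by
  have hsq := dist_bp_sq (s := s) k i j k' i' j'
  have hd0 : 0 ≤ dist (bp s k i j) (bp s k' i' j') := dist_nonneg
  have hd2 : dist (bp s k i j) (bp s k' i' j') ^ 2 ≤ 36 / 25 := by nlinarith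
  -- Step 1: adjacent or equal layers
  have hk : -1 ≤ k - k' ∧ k - k' ≤ 1 := by
    by_contra hcon
    have h4 : (4 : ℤ) ≤ (k - k') ^ 2 := by
      rcases not_and_or.1 hcon with h | h
      · push Not at h; nlinarith
      · push Not at h; nlinarith
    have h4' : (4 : ℝ) ≤ ((k : ℝ) - k') ^ 2 := by exact_mod_cast h4
    nlinarith [sq_nonneg (((i : ℝ) - i') + ((j : ℝ) - j') / 2 + ((haggLabel s k : ℝ) - haggLabel s k') / 2),
      sq_nonneg (((j : ℝ) - j') + ((haggLabel s k : ℝ) - haggLabel s k') / 3)]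
  have hkabs : |k - k'| ≤ 1 := abs_le.2 hk
  rcases (show k' = k ∨ k' = k + 1 ∨ k = k' + 1 by omega) with h0 | h0 | h0
  · -- same layer
    subst h0
    have hmn : (i - i', j - j') ≠ (0, 0) := by
      intro h; apply hne
      simp only [Prod.mk.injEq, true_and] at h ⊢
      exact ⟨by omega, by omega⟩
    have hform : dist (bp s k' i j) (bp s k' i' j') ^ 2 = (((i - i') ^ 2 + (i - i') * (j - j') + (j - j') ^ 2 : ℤ) : ℝ) := by
      rw [hsq]; push_cast; ring
    have hlt : (i - i') ^ 2 + (i - i') * (j - j') + (j - j') ^ 2 < 2 := by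
      have : (((i - i') ^ 2 + (i - i') * (j - j') + (j - j') ^ 2 : ℤ) : ℝ) < 2 := by rw [← hform]; linarith
      exact_mod_cast this
    obtain ⟨h1, hi, hj⟩ := same_layer_form hmn hlt
    refine ⟨eq_one_of_sq_eq_one hd0 ?_, hkabs, hi, hj⟩
    rw [hform, h1]; simp
  · -- k' = k + 1 : ΔL = -s k
    subst h0
    rw [haggLabel_succ] at hsq
    rcases hs k with hσ | hσ
    · have hform : dist (bp s k i j) (bp s (k + 1) i' j') ^ 2 =
          (((i - i') ^ 2 + (j - j') ^ 2 + (i - i') * (j - j') + (-1) * (i - i') + (-1) * (j - j') : ℤ) : ℝ) + 1 := by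
        rw [hsq, hσ]; push_cast; ring
      have hlt : (i - i') ^ 2 + (j - j') ^ 2 + (i - i') * (j - j') + (-1) * (i - i') + (-1) * (j - j') < 1 := by
        have : (((i - i') ^ 2 + (j - j') ^ 2 + (i - i') * (j - j') + (-1) * (i - i') + (-1) * (j - j') : ℤ) : ℝ) < 1 := by
          linarith [hform.symm.le.trans hd2]
        exact_mod_cast this
      obtain ⟨h1, hi, hj⟩ := adj_layer_form (Or.inr rfl) hlt
      refine ⟨eq_one_of_sq_eq_one hd0 ?_, hkabs, hi, hj⟩
      rw [hform, h1]; simp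
    · have hform : dist (bp s k i j) (bp s (k + 1) i' j') ^ 2 =
          (((i - i') ^ 2 + (j - j') ^ 2 + (i - i') * (j - j') + 1 * (i - i') + 1 * (j - j') : ℤ) : ℝ) + 1 := by
        rw [hsq, hσ]; push_cast; ring
      have hlt : (i - i') ^ 2 + (j - j') ^ 2 + (i - i') * (j - j') + 1 * (i - i') + 1 * (j - j') < 1 := by
        have : (((i - i') ^ 2 + (j - j') ^ 2 + (i - i') * (j - j') + 1 * (i - i') + 1 * (j - j') : ℤ) : ℝ) < 1 := by
          linarith [hform.symm.le.trans hd2]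
        exact_mod_cast this
      obtain ⟨h1, hi, hj⟩ := adj_layer_form (Or.inl rfl) hlt
      refine ⟨eq_one_of_sq_eq_one hd0 ?_, hkabs, hi, hj⟩
      rw [hform, h1]; simp
  · -- k = k' + 1 : ΔL = s k'
    subst h0
    rw [haggLabel_succ] at hsq
    rcases hs k' with hσ | hσ
    · have hform : dist (bp s (k' + 1) i j) (bp s k' i' j') ^ 2 =
          (((i - i') ^ 2 + (j - j') ^ 2 + (i - i') * (j - j') + 1 * (i - i') + 1 * (j - j') : ℤ) : ℝ) + 1 := by
        rw [hsq, hσ]; push_cast; ring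
      have hlt : (i - i') ^ 2 + (j - j') ^ 2 + (i - i') * (j - j') + 1 * (i - i') + 1 * (j - j') < 1 := by
        have : (((i - i') ^ 2 + (j - j') ^ 2 + (i - i') * (j - j') + 1 * (i - i') + 1 * (j - j') : ℤ) : ℝ) < 1 := by
          linarith [hform.symm.le.trans hd2]
        exact_mod_cast this
      obtain ⟨h1, hi, hj⟩ := adj_layer_form (Or.inl rfl) hlt
      refine ⟨eq_one_of_sq_eq_one hd0 ?_, hkabs, hi, hj⟩
      rw [hform, h1]; simp
    · have hform : dist (bp s (k' + 1) i j) (bp s k' i' j') ^ 2 =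
          (((i - i') ^ 2 + (j - j') ^ 2 + (i - i') * (j - j') + (-1) * (i - i') + (-1) * (j - j') : ℤ) : ℝ) + 1 := by
        rw [hsq, hσ]; push_cast; ring
      have hlt : (i - i') ^ 2 + (j - j') ^ 2 + (i - i') * (j - j') + (-1) * (i - i') + (-1) * (j - j') < 1 := by
        have : (((i - i') ^ 2 + (j - j') ^ 2 + (i - i') * (j - j') + (-1) * (i - i') + (-1) * (j - j') : ℤ) : ℝ) < 1 := by
          linarith [hform.symm.le.trans hd2]
        exact_mod_cast this
      obtain ⟨h1, hi, hj⟩ := adj_layer_form (Or.inr rfl) hlt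
      refine ⟨eq_one_of_sq_eq_one hd0 ?_, hkabs, hi, hj⟩
      rw [hform, h1]; simp

/-! ### Separation and injectivity of the stacking -/

/-- Distinct index triples give points at distance `≥ 1`. [folklore] -/
theorem one_le_dist_bp (hs : IsHaggSeq s) {k i j k' i' j' : ℤ} (hne : (k, i, j) ≠ (k', i', j')) :
    1 ≤ dist (bp s k i j) (bp s k' i' j') :=
  le_dist_barlowPos_of_ideal hs one_pos hI_sq' hne

/-- `bp` is injective on index triples. [folklore] -/
theorem bp_injective (hs : IsHaggSeq s) {k i j k' i' j' : ℤ} (h : bp s k i j = bp s k' i' j') :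
    (k, i, j) = (k', i', j') := by
  by_contra hne
  have := one_le_dist_bp hs hne
  rw [h, dist_self] at this
  linarith

/-! ### The lex-filled box -/

/-- Some box holds `N` points (`n = N` does). [folklore] -/
theorem exists_side (N : ℕ) : ∃ n : ℕ, N ≤ (2 * n + 1) ^ 3 :=
  ⟨N, (show N ≤ 2 * N + 1 by omega).trans (Nat.le_self_pow (by norm_num) _)⟩

/-- The box side parameter: the least `n` with `N ≤ (2n+1)³`. -/
def side (N : ℕ) : ℕ := Nat.find (exists_side N)

/-- The box holds `N` points. [folklore] -/
theorem le_cube_side (N : ℕ) : N ≤ (2 * side N + 1) ^ 3 :=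
  Nat.find_spec (exists_side N)

/-- Minimality of the side: smaller boxes are too small. [folklore] -/
theorem cube_lt_of_lt_side {N m : ℕ} (h : m < side N) : (2 * m + 1) ^ 3 < N := by
  have := Nat.find_min (exists_side N) h
  omega

/-- The side tends to infinity: `M < side N` once `(2M+1)³ < N`. [folklore] -/
theorem lt_side_of_cube_lt {N M : ℕ} (h : (2 * M + 1) ^ 3 < N) : M < side N := by
  by_contra hle
  push Not at hle
  have h1 := le_cube_side N
  have h2 : (2 * side N + 1) ^ 3 ≤ (2 * M + 1) ^ 3 := by
    apply Nat.pow_le_pow_left; omega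
  omega

/-- Lexicographic decoding `t ↦ (k, i, j)` of the box `[-n, n]³`, `k` most significant. -/
def dec (n t : ℕ) : ℤ × ℤ × ℤ :=
  (((t / (2 * n + 1) ^ 2 : ℕ) : ℤ) - n, (((t / (2 * n + 1)) % (2 * n + 1) : ℕ) : ℤ) - n, ((t % (2 * n + 1) : ℕ) : ℤ) - n)

/-- Lexicographic encoding of a box triple. -/
def enc (n : ℕ) (k i j : ℤ) : ℕ := ((k + n) * (2 * n + 1) ^ 2 + (i + n) * (2 * n + 1) + (j + n)).toNat

/-- `dec ∘ enc = id` on the box. [folklore] -/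
theorem dec_enc {n : ℕ} {k i j : ℤ} (hk : -(n : ℤ) ≤ k) (hk' : k ≤ n) (hi : -(n : ℤ) ≤ i) (hi' : i ≤ n)
    (hj : -(n : ℤ) ≤ j) (hj' : j ≤ n) : dec n (enc n k i j) = (k, i, j) := by
  obtain ⟨a, rfl⟩ : ∃ a : ℕ, k = (a : ℤ) - n := ⟨(k + n).toNat, by omega⟩
  obtain ⟨b, rfl⟩ : ∃ b : ℕ, i = (b : ℤ) - n := ⟨(i + n).toNat, by omega⟩
  obtain ⟨c, rfl⟩ : ∃ c : ℕ, j = (c : ℤ) - n := ⟨(j + n).toNat, by omega⟩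
  have haM : a < 2 * n + 1 := by omega
  have hbM : b < 2 * n + 1 := by omega
  have hcM : c < 2 * n + 1 := by omega
  unfold dec enc
  have ht : (((a : ℤ) - n + n) * (2 * (n : ℤ) + 1) ^ 2 + ((b : ℤ) - n + n) * (2 * (n : ℤ) + 1) + ((c : ℤ) - n + n)).toNat =
      a * (2 * n + 1) ^ 2 + b * (2 * n + 1) + c := by
    have : (((a : ℤ) - n + n) * (2 * (n : ℤ) + 1) ^ 2 + ((b : ℤ) - n + n) * (2 * (n : ℤ) + 1) + ((c : ℤ) - n + n)) =
        ((a * (2 * n + 1) ^ 2 + b * (2 * n + 1) + c : ℕ) : ℤ) := by push_cast; ring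
    rw [this, Int.toNat_natCast]
  rw [ht]
  have hM0 : 0 < 2 * n + 1 := by omega
  have h1 : (a * (2 * n + 1) ^ 2 + b * (2 * n + 1) + c) / (2 * n + 1) ^ 2 = a := by
    rw [show a * (2 * n + 1) ^ 2 + b * (2 * n + 1) + c = (b * (2 * n + 1) + c) + a * (2 * n + 1) ^ 2 by ring,
      Nat.add_mul_div_right _ _ (by positivity)]
    have : (b * (2 * n + 1) + c) / (2 * n + 1) ^ 2 = 0 := Nat.div_eq_of_lt (by nlinarith)
    omega
  have h2 : (a * (2 * n + 1) ^ 2 + b * (2 * n + 1) + c) / (2 * n + 1) = a * (2 * n + 1) + b := by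
    rw [show a * (2 * n + 1) ^ 2 + b * (2 * n + 1) + c = c + (a * (2 * n + 1) + b) * (2 * n + 1) by ring,
      Nat.add_mul_div_right _ _ hM0, Nat.div_eq_of_lt hcM, zero_add]
  have h3 : (a * (2 * n + 1) + b) % (2 * n + 1) = b := by
    rw [Nat.add_comm, Nat.add_mul_mod_self_right]; exact Nat.mod_eq_of_lt hbM
  have h4 : (a * (2 * n + 1) ^ 2 + b * (2 * n + 1) + c) % (2 * n + 1) = c := by
    rw [show a * (2 * n + 1) ^ 2 + b * (2 * n + 1) + c = c + (a * (2 * n + 1) + b) * (2 * n + 1) by ring,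
      Nat.add_mul_mod_self_right]
    exact Nat.mod_eq_of_lt hcM
  rw [h1, h2, h3, h4]

/-- `enc` of a box triple is below `(k + n + 1)(2n+1)²`. [folklore] -/
theorem enc_lt {n : ℕ} {k i j : ℤ} (hk : -(n : ℤ) ≤ k) (hi : -(n : ℤ) ≤ i) (hi' : i ≤ n) (hj : -(n : ℤ) ≤ j) (hj' : j ≤ n) :
    (enc n k i j : ℤ) < (k + n + 1) * (2 * n + 1) ^ 2 := by
  unfold enc
  have hkn : (0 : ℤ) ≤ k + n := by omega
  have hin : (0 : ℤ) ≤ i + n := by omega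
  have h0 : (0 : ℤ) ≤ (k + n) * (2 * n + 1) ^ 2 + (i + n) * (2 * n + 1) + (j + n) := by
    have h1 := mul_nonneg hkn (show (0 : ℤ) ≤ (2 * n + 1) ^ 2 by positivity)
    have h2 := mul_nonneg hin (show (0 : ℤ) ≤ 2 * n + 1 by positivity)
    omega
  rw [Int.toNat_of_nonneg h0]
  have hin' : i + n ≤ 2 * n := by omega
  have hjn' : j + n ≤ 2 * n := by omega
  have h3 : (i + n) * (2 * (n : ℤ) + 1) ≤ 2 * n * (2 * n + 1) := mul_le_mul_of_nonneg_right hin' (by positivity)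
  nlinarith

/-- `dec` is injective below `(2n+1)³`. [folklore] -/
theorem dec_injective {n t t' : ℕ} (h : dec n t = dec n t') : t = t' := by
  unfold dec at h
  simp only [Prod.mk.injEq] at h
  obtain ⟨h1, h2, h3⟩ := h
  set M : ℕ := 2 * n + 1
  have e1 : t / M ^ 2 = t' / M ^ 2 := by omega
  have e2 : (t / M) % M = (t' / M) % M := by omega
  have e3 : t % M = t' % M := by omega
  have e4 : t / M = t' / M := by
    have ht := Nat.div_add_mod (t / M) M
    have ht' := Nat.div_add_mod (t' / M) M
    rw [Nat.div_div_eq_div_mul, ← pow_two] at ht ht'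
    rw [← ht, ← ht', e1, e2]
  have := Nat.div_add_mod t M
  have this' := Nat.div_add_mod t' M
  rw [← this, ← this', e4, e3]

/-- Decoded triples lie in the box (first coordinate needs `t < (2n+1)³`). [folklore] -/
theorem dec_mem_box {n t : ℕ} (ht : t < (2 * n + 1) ^ 3) :
    -(n : ℤ) ≤ (dec n t).1 ∧ (dec n t).1 ≤ n ∧ -(n : ℤ) ≤ (dec n t).2.1 ∧ (dec n t).2.1 ≤ n ∧
      -(n : ℤ) ≤ (dec n t).2.2 ∧ (dec n t).2.2 ≤ n := by
  unfold dec
  have hM0 : 0 < 2 * n + 1 := by omega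
  have h1 : t / (2 * n + 1) ^ 2 < 2 * n + 1 := by
    rw [Nat.div_lt_iff_lt_mul (by positivity)]
    calc t < (2 * n + 1) ^ 3 := ht
      _ = (2 * n + 1) * (2 * n + 1) ^ 2 := by ring
  have h2 : (t / (2 * n + 1)) % (2 * n + 1) < 2 * n + 1 := Nat.mod_lt _ hM0
  have h3 : t % (2 * n + 1) < 2 * n + 1 := Nat.mod_lt _ hM0
  generalize t / (2 * n + 1) ^ 2 = q1 at *
  generalize (t / (2 * n + 1)) % (2 * n + 1) = q2 at *
  generalize t % (2 * n + 1) = q3 at *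
  simp only
  omega

/-! ### Reduced-label points (no lateral drift of the box) -/

/-- The layer-`k` point with lateral indices `(i, j)` measured from the REDUCED letter `L(k) mod 3`:
`bq k i j = bp k (i − ⌊L/3⌋) (j − ⌊L/3⌋)`, physically `i u + j v + (L mod 3) w + k hI e₃`. -/
def bq (s : ℤ → ℤ) (k i j : ℤ) : E3 := bp s k (i - haggLabel s k / 3) (j - haggLabel s k / 3)

/-- `bq` points are stacking points. [folklore] -/
theorem bq_mem (s : ℤ → ℤ) (k i j : ℤ) : bq s k i j ∈ barlowStacking 1 hI s := barlowPos_mem _ _ _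

/-- Every stacking point is a `bq` point of its layer. [folklore] -/
theorem bp_eq_bq (s : ℤ → ℤ) (k i j : ℤ) : bp s k i j = bq s k (i + haggLabel s k / 3) (j + haggLabel s k / 3) := by
  simp [bq]

/-- `bq` is injective on index triples. [folklore] -/
theorem bq_injective (hs : IsHaggSeq s) {k i j k' i' j' : ℤ} (h : bq s k i j = bq s k' i' j') :
    (k, i, j) = (k', i', j') := by
  have h1 := bp_injective hs h
  simp only [Prod.mk.injEq] at h1 ⊢
  obtain ⟨rfl, h2, h3⟩ := h1
  exact ⟨rfl, by omega, by omega⟩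

/-- Labels of adjacent layers differ by at most one, hence so do their thirds. [folklore] -/
theorem abs_label_div_sub_le (hs : IsHaggSeq s) {k k' : ℤ} (hk : |k - k'| ≤ 1) :
    |haggLabel s k / 3 - haggLabel s k' / 3| ≤ 1 := by
  rcases (show k' = k ∨ k' = k + 1 ∨ k = k' + 1 by rcases abs_le.1 hk with ⟨h1, h2⟩; omega) with h | h | h
  · subst h; simp
  · subst h
    rw [haggLabel_succ]
    rcases hs k with h1 | h1 <;> rw [h1, abs_le] <;> constructor <;> omega
  · subst h
    rw [haggLabel_succ]
    rcases hs k' with h1 | h1 <;> rw [h1, abs_le] <;> constructor <;> omega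

/-- **The witness configuration**: the first `N` points, in lexicographic order (layer index most significant), of
the index box `[-n, n]³` of reduced-label points of the unit ideal stacking of `s`, `n = side N`. -/
def block (s : ℤ → ℤ) (N : ℕ) (t : Fin N) : E3 :=
  bq s (dec (side N) t).1 (dec (side N) t).2.1 (dec (side N) t).2.2

/-- The block configuration is injective. [folklore] -/
theorem block_injective (hs : IsHaggSeq s) (N : ℕ) : Function.Injective (block s N) := by
  intro t t' h
  have h1 := bq_injective hs h
  have : (dec (side N) t) = (dec (side N) t') := by
    ext <;> simp only [Prod.mk.injEq] at h1 <;> [exact h1.1; exact h1.2.1; exact h1.2.2]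
  exact Fin.ext (dec_injective this)

/-- Distinct particles have distinct `bp`-index triples. [folklore] -/
theorem block_ne_index {N : ℕ} {t t' : Fin N} (hne : t ≠ t') :
    ((dec (side N) t).1, (dec (side N) t).2.1 - haggLabel s (dec (side N) t).1 / 3,
        (dec (side N) t).2.2 - haggLabel s (dec (side N) t).1 / 3) ≠
      ((dec (side N) t').1, (dec (side N) t').2.1 - haggLabel s (dec (side N) t').1 / 3,
        (dec (side N) t').2.2 - haggLabel s (dec (side N) t').1 / 3) := by
  intro h
  apply hne
  simp only [Prod.mk.injEq] at h
  obtain ⟨h1, h2, h3⟩ := h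
  have : (dec (side N) t) = (dec (side N) t') := by
    ext
    · exact h1
    · rw [h1] at h2; omega
    · rw [h1] at h3; omega
  exact Fin.ext (dec_injective this)

/-- The block configuration is `1`-separated. [folklore] -/
theorem one_le_dist_block (hs : IsHaggSeq s) (N : ℕ) {t t' : Fin N} (hne : t ≠ t') :
    1 ≤ dist (block s N t) (block s N t') :=
  one_le_dist_bp hs (block_ne_index hne)

/-- Every particle is a stacking point. [folklore] -/
theorem block_mem (s : ℤ → ℤ) (N : ℕ) (t : Fin N) : block s N t ∈ barlowStacking 1 hI s := bq_mem _ _ _ _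

/-! ### Interior sites -/

/-- Interior index triples: two layers / two lateral steps away from every face of the filled region
(`N / (2n+1)²` complete layers from the bottom). -/
def Interior (N : ℕ) (k i j : ℤ) : Prop :=
  2 - (side N : ℤ) ≤ k ∧ k + side N + 2 ≤ ((N / (2 * side N + 1) ^ 2 : ℕ) : ℤ) ∧ |i| + 2 ≤ side N ∧ |j| + 2 ≤ side N

/-- **Index triples near an interior triple are present in the block.** [folklore] -/
theorem exists_block_eq_of_near_interior {N : ℕ} {k i j : ℤ} (hint : Interior N k i j) {k' i' j' : ℤ}
    (hk : |k' - k| ≤ 1) (hi : |i' - i| ≤ 2) (hj : |j' - j| ≤ 2) :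
    ∃ t : Fin N, block s N t = bq s k' i' j' := by
  obtain ⟨h1, h2, h3, h4⟩ := hint
  set n := side N with hn
  have hk1 : -(n : ℤ) ≤ k' := by rcases abs_le.1 hk with ⟨a, b⟩; omega
  have hk2 : k' ≤ n := by
    rcases abs_le.1 hk with ⟨a, b⟩
    have : ((N / (2 * n + 1) ^ 2 : ℕ) : ℤ) ≤ 2 * n + 1 := by
      have := Nat.div_le_of_le_mul (show N ≤ (2 * n + 1) ^ 2 * (2 * n + 1) by
        calc N ≤ (2 * n + 1) ^ 3 := le_cube_side N
          _ = (2 * n + 1) ^ 2 * (2 * n + 1) := by ring)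
      exact_mod_cast this
    omega
  have hii := abs_le.1 hi
  have hjj := abs_le.1 hj
  have hi0 := abs_le.1 (show |i| ≤ (n : ℤ) - 2 by linarith)
  have hj0 := abs_le.1 (show |j| ≤ (n : ℤ) - 2 by linarith)
  have hi1 : -(n : ℤ) ≤ i' := by linarith [hii.1, hi0.1]
  have hi2 : i' ≤ n := by linarith [hii.2, hi0.2]
  have hj1 : -(n : ℤ) ≤ j' := by linarith [hjj.1, hj0.1]
  have hj2 : j' ≤ n := by linarith [hjj.2, hj0.2]
  have henc : enc n k' i' j' < N := by
    have e1 := enc_lt (n := n) hk1 hi1 hi2 hj1 hj2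
    have e2 : (k' + n + 1) * (2 * (n : ℤ) + 1) ^ 2 ≤ ((N / (2 * n + 1) ^ 2 : ℕ) : ℤ) * (2 * n + 1) ^ 2 := by
      apply mul_le_mul_of_nonneg_right _ (by positivity)
      rcases abs_le.1 hk with ⟨a, b⟩; omega
    have e3 : ((N / (2 * n + 1) ^ 2 : ℕ) : ℤ) * (2 * n + 1) ^ 2 ≤ N := by
      have := Nat.div_mul_le_self N ((2 * n + 1) ^ 2)
      exact_mod_cast this
    have : (enc n k' i' j' : ℤ) < N := by linarith
    exact_mod_cast this
  refine ⟨⟨enc n k' i' j', henc⟩, ?_⟩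
  unfold block
  rw [← hn]
  simp only []
  rw [dec_enc hk1 hk2 hi1 hi2 hj1 hj2]

/-- **The `6/5`-shell of an interior particle is its kissing shell in the infinite stacking.** [folklore] -/
theorem shell_block_eq (hs : IsHaggSeq s) {N : ℕ} (t : Fin N)
    (hint : Interior N (dec (side N) t).1 (dec (side N) t).2.1 (dec (side N) t).2.2) :
    (↑(Summit.AtomisticToContinuum.Crystallization.Theorems.DefectFreeCrystallizes.Negative.PredicateAPI.shell (block s N) t 1) : Set E3) = {y | block s N t + y ∈ barlowStacking 1 hI s ∧ ‖y‖ = 1} := by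
  set n := side N with hn
  set k := (dec n t).1 with hk
  set i := (dec n t).2.1 with hi
  set j := (dec n t).2.2 with hj
  set q := haggLabel s k / 3 with hq
  have hp : block s N t = bp s k (i - q) (j - q) := rfl
  ext y
  simp only [Summit.AtomisticToContinuum.Crystallization.Theorems.DefectFreeCrystallizes.Negative.PredicateAPI.shell, Summit.AtomisticToContinuum.Crystallization.Theorems.DefectFreeCrystallizes.Negative.PredicateAPI.nbrs, Finset.coe_image, Finset.coe_filter, Finset.mem_univ, true_and,
    Set.mem_image, Set.mem_setOf_eq, inv_one, one_smul]
  constructor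
  · rintro ⟨t', ⟨hne, hdist⟩, rfl⟩
    refine ⟨by rw [add_sub_cancel]; exact block_mem s N t', ?_⟩
    have hdist' : dist (block s N t) (block s N t') ≤ 6 / 5 := hdist
    unfold block bq at hdist' ⊢
    have := (gap hs (block_ne_index (s := s) (Ne.symm hne)) hdist').1
    rw [← dist_eq_norm, dist_comm]
    exact this
  · rintro ⟨hmem, hnorm⟩
    obtain ⟨k₁, a, b, hab⟩ := hmem
    change block s N t + y = bp s k₁ a b at hab
    have hy0 : y ≠ 0 := by intro h; rw [h, norm_zero] at hnorm; norm_num at hnorm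
    have hne : (k, i - q, j - q) ≠ (k₁, a, b) := by
      intro h
      apply hy0
      have : block s N t = bp s k₁ a b := by
        rw [hp]; simp only [Prod.mk.injEq] at h; rw [h.1, h.2.1, h.2.2]
      have h2 : block s N t + y = block s N t := by rw [hab, this]
      simpa using h2
    have hdist : dist (bp s k (i - q) (j - q)) (bp s k₁ a b) ≤ 6 / 5 := by
      rw [← hp, ← hab, dist_eq_norm, sub_add_cancel_left, norm_neg, hnorm]; norm_num
    obtain ⟨-, hk₁, ha, hb⟩ := gap hs hne hdist
    -- convert to bq indices
    set q₁ := haggLabel s k₁ / 3 with hq₁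
    have hqq : |q - q₁| ≤ 1 := abs_label_div_sub_le hs hk₁
    have hk₁' : |k₁ - k| ≤ 1 := by rw [abs_sub_comm]; exact hk₁
    have hi' : |(a + q₁) - i| ≤ 2 := by
      rw [abs_le] at ha hqq ⊢; constructor <;> linarith [ha.1, ha.2, hqq.1, hqq.2]
    have hj' : |(b + q₁) - j| ≤ 2 := by
      rw [abs_le] at hb hqq ⊢; constructor <;> linarith [hb.1, hb.2, hqq.1, hqq.2]
    obtain ⟨t', ht'⟩ := exists_block_eq_of_near_interior (s := s) hint hk₁' hi' hj'
    have hbq : bq s k₁ (a + q₁) (b + q₁) = bp s k₁ a b := by simp [bq, hq₁]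
    refine ⟨t', ⟨?_, ?_⟩, ?_⟩
    · intro h; rw [h] at ht'
      apply hy0
      have h2 : block s N t + y = block s N t := by rw [hab, ← hbq, ← ht']
      simpa using h2
    · show dist (block s N t) (block s N t') ≤ 6 / 5
      rw [ht', hbq, ← hab, dist_eq_norm, sub_add_cancel_left, norm_neg, hnorm]; norm_num
    · rw [ht', hbq, ← hab, add_sub_cancel_left]

/-! ### Interior particles are GOOD (bridge to `LayerShellPatterns`, Hales's scale `2`) -/

/-- Hales's stacking is twice ours: `barlowPos 2 (2√(2/3)) = 2 • barlowPos 1 hI`. [folklore] -/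
theorem barlowPos_two (s : ℤ → ℤ) (k i j : ℤ) :
    barlowPos 2 (2 * Real.sqrt (2 / 3)) s k i j = (2 : ℝ) • bp s k i j := by
  ext l
  fin_cases l <;> simp [bp, hI] <;> ring

/-- Hence `V₂ = 2 • S`: membership transfers. [folklore] -/
theorem mem_two_iff (s : ℤ → ℤ) (z : E3) :
    (2 : ℝ) • z ∈ barlowStacking 2 (2 * Real.sqrt (2 / 3)) s ↔ z ∈ barlowStacking 1 hI s := by
  constructor
  · rintro ⟨k, i, j, h⟩
    refine ⟨k, i, j, ?_⟩
    rw [barlowPos_two] at h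
    exact smul_right_injective E3 (two_ne_zero) h
  · rintro ⟨k, i, j, rfl⟩
    exact ⟨k, i, j, (barlowPos_two s k i j).symm⟩

/-- **The unit kissing shell of a stacking point is an isometric image of the fcc or the hcp pattern.**
(`hasFccOrHcpShells_barlowStacking'` at Hales's scale, halved.) [cite: HalesDSP2012, §1.3 (pp. 12–13)] -/
theorem shell_set_eq_image (hs : IsHaggSeq s) {p : E3} (hp : p ∈ barlowStacking 1 hI s) :
    ∃ A : E3 →ₗᵢ[ℝ] E3, ({y | p + y ∈ barlowStacking 1 hI s ∧ ‖y‖ = 1} = A '' (fccKissingPattern : Set E3)) ∨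
      ({y | p + y ∈ barlowStacking 1 hI s ∧ ‖y‖ = 1} = A '' (hcpKissingPattern : Set E3)) := by
  have hp2 : (2 : ℝ) • p ∈ barlowStacking 2 (2 * Real.sqrt (2 / 3)) s := (mem_two_iff s p).2 hp
  have key : ∀ (P : Finset E3) (A : E3 →ₗᵢ[ℝ] E3),
      kissingShell (barlowStacking 2 (2 * Real.sqrt (2 / 3)) s) ((2 : ℝ) • p) = (fun x => (2 : ℝ) • A x) '' (P : Set E3) →
      {y | p + y ∈ barlowStacking 1 hI s ∧ ‖y‖ = 1} = A '' (P : Set E3) := by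
    intro P A hK
    ext y
    simp only [Set.mem_setOf_eq, Set.mem_image, Finset.mem_coe]
    have hy : y ∈ (fun x => (2 : ℝ)⁻¹ • x) '' kissingShell (barlowStacking 2 (2 * Real.sqrt (2 / 3)) s) ((2 : ℝ) • p) ↔
        p + y ∈ barlowStacking 1 hI s ∧ ‖y‖ = 1 := by
      constructor
      · rintro ⟨x, ⟨hx1, hx2⟩, rfl⟩
        constructor
        · rw [← mem_two_iff, smul_add, smul_inv_smul₀ two_ne_zero]; exact hx1
        · rw [norm_smul, norm_inv, Real.norm_two, hx2]; norm_num
      · rintro ⟨h1, h2⟩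
        refine ⟨(2 : ℝ) • y, ⟨?_, ?_⟩, by show (2 : ℝ)⁻¹ • ((2 : ℝ) • y) = y; rw [inv_smul_smul₀ two_ne_zero]⟩
        · rw [← smul_add, mem_two_iff]; exact h1
        · rw [norm_smul, Real.norm_two, h2]; norm_num
    rw [← hy, hK, Set.image_image]
    simp only [inv_smul_smul₀ (two_ne_zero (α := ℝ)), Set.mem_image, Finset.mem_coe]
  rcases hasFccOrHcpShells_barlowStacking' hs _ hp2 with ⟨A, hA⟩ | ⟨A, hA⟩
  · exact ⟨A, Or.inl (key _ A hA)⟩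
  · exact ⟨A, Or.inr (key _ A hA)⟩

/-- **Interior particles are good** for the crux's predicate, at scale `1`. [folklore] -/
theorem good_block (hs : IsHaggSeq s) {N : ℕ} (t : Fin N)
    (hint : Interior N (dec (side N) t).1 (dec (side N) t).2.1 (dec (side N) t).2.2) :
    Summit.AtomisticToContinuum.Crystallization.Theorems.DefectFreeCrystallizes.Negative.PredicateAPI.Good (block s N) t := by
  obtain ⟨A, hA⟩ := shell_set_eq_image hs (block_mem s N t)
  have hshell := shell_block_eq hs t hint
  refine ⟨1, by norm_num, by norm_num, ?_⟩
  rcases hA with hA | hA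
  · left
    refine ⟨A, ?_⟩
    have : Summit.AtomisticToContinuum.Crystallization.Theorems.DefectFreeCrystallizes.Negative.PredicateAPI.shell (block s N) t 1 = fccKissingPattern.image A := by
      apply Finset.coe_injective
      rw [hshell, hA, Finset.coe_image]
    rw [this]
    exact EtaMatched.refl (by norm_num) _
  · right
    refine ⟨A, ?_⟩
    have : Summit.AtomisticToContinuum.Crystallization.Theorems.DefectFreeCrystallizes.Negative.PredicateAPI.shell (block s N) t 1 = hcpKissingPattern.image A := by
      apply Finset.coe_injective
      rw [hshell, hA, Finset.coe_image]
    rw [this]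
    exact EtaMatched.refl (by norm_num) _

/-! ### Counting the non-interior particles -/

instance (N : ℕ) (k i j : ℤ) : Decidable (Interior N k i j) := by unfold Interior; infer_instance

/-- The interior index box. -/
def interiorBox (N : ℕ) : Finset (ℤ × ℤ × ℤ) :=
  (Finset.Icc (2 - (side N : ℤ)) (((N / (2 * side N + 1) ^ 2 : ℕ) : ℤ) - side N - 2)) ×ˢ
    ((Finset.Icc (2 - (side N : ℤ)) (side N - 2)) ×ˢ (Finset.Icc (2 - (side N : ℤ)) (side N - 2)))

/-- Membership in the interior box. [folklore] -/
theorem mem_interiorBox_iff {N : ℕ} {x : ℤ × ℤ × ℤ} : x ∈ interiorBox N ↔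
    (2 - (side N : ℤ) ≤ x.1 ∧ x.1 ≤ ((N / (2 * side N + 1) ^ 2 : ℕ) : ℤ) - side N - 2) ∧
      (2 - (side N : ℤ) ≤ x.2.1 ∧ x.2.1 ≤ side N - 2) ∧ (2 - (side N : ℤ) ≤ x.2.2 ∧ x.2.2 ≤ side N - 2) := by
  rw [interiorBox, Finset.mem_product, Finset.mem_product, Finset.mem_Icc, Finset.mem_Icc, Finset.mem_Icc]

/-- Members of the interior box are interior triples. [folklore] -/
theorem interior_of_mem_interiorBox {N : ℕ} {x : ℤ × ℤ × ℤ} (hx : x ∈ interiorBox N) : Interior N x.1 x.2.1 x.2.2 := by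
  rw [mem_interiorBox_iff] at hx
  obtain ⟨⟨h1, h2⟩, ⟨h3, h4⟩, ⟨h5, h6⟩⟩ := hx
  refine ⟨h1, by omega, ?_, ?_⟩
  · have : |x.2.1| ≤ (side N : ℤ) - 2 := abs_le.2 ⟨by omega, by omega⟩
    omega
  · have : |x.2.2| ≤ (side N : ℤ) - 2 := abs_le.2 ⟨by omega, by omega⟩
    omega

/-- The number of complete layers is at most the box height. [folklore] -/
theorem layers_le (N : ℕ) : ((N / (2 * side N + 1) ^ 2 : ℕ) : ℤ) ≤ 2 * side N + 1 := by
  have := Nat.div_le_of_le_mul (show N ≤ (2 * side N + 1) ^ 2 * (2 * side N + 1) by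
    calc N ≤ (2 * side N + 1) ^ 3 := le_cube_side N
      _ = (2 * side N + 1) ^ 2 * (2 * side N + 1) := by ring)
  exact_mod_cast this

/-- Codes of box triples below the complete layers are `< N`. [folklore] -/
theorem enc_lt_N {N : ℕ} {k i j : ℤ} (hk : -(side N : ℤ) ≤ k) (hk2 : k + side N + 1 ≤ ((N / (2 * side N + 1) ^ 2 : ℕ) : ℤ))
    (hi : -(side N : ℤ) ≤ i) (hi' : i ≤ side N) (hj : -(side N : ℤ) ≤ j) (hj' : j ≤ side N) :
    enc (side N) k i j < N := by
  have e1 := enc_lt (n := side N) hk hi hi' hj hj'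
  have e2 : (k + side N + 1) * (2 * (side N : ℤ) + 1) ^ 2 ≤ ((N / (2 * side N + 1) ^ 2 : ℕ) : ℤ) * (2 * side N + 1) ^ 2 :=
    mul_le_mul_of_nonneg_right hk2 (by positivity)
  have e3 : ((N / (2 * side N + 1) ^ 2 : ℕ) : ℤ) * (2 * side N + 1) ^ 2 ≤ N := by
    have := Nat.div_mul_le_self N ((2 * side N + 1) ^ 2); exact_mod_cast this
  have : (enc (side N) k i j : ℤ) < N := by linarith
  exact_mod_cast this

/-- The number of non-interior particles plus the size of the interior box is at most `N`. [folklore] -/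
theorem card_not_interior_add_le (N : ℕ) :
    (Finset.univ.filter fun t : Fin N =>
        ¬ Interior N (dec (side N) t).1 (dec (side N) t).2.1 (dec (side N) t).2.2).card + (interiorBox N).card ≤ N := by
  classical
  -- the box injects into the interior particles (through ℕ-valued codes)
  have hinj : (interiorBox N).card ≤ (Finset.univ.filter fun t : Fin N =>
      Interior N (dec (side N) t).1 (dec (side N) t).2.1 (dec (side N) t).2.2).card := by
    have hcard : ((Finset.univ.filter fun t : Fin N =>
        Interior N (dec (side N) t).1 (dec (side N) t).2.1 (dec (side N) t).2.2).image fun t : Fin N => (t : ℕ)).card =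
        (Finset.univ.filter fun t : Fin N =>
          Interior N (dec (side N) t).1 (dec (side N) t).2.1 (dec (side N) t).2.2).card :=
      Finset.card_image_of_injective _ Fin.val_injective
    rw [← hcard]
    refine Finset.card_le_card_of_injOn (fun x => enc (side N) x.1 x.2.1 x.2.2) ?_ ?_
    · intro x hx
      rw [Finset.mem_coe] at hx
      have hint := interior_of_mem_interiorBox hx
      rw [mem_interiorBox_iff] at hx
      obtain ⟨⟨h1, h2⟩, ⟨h3, h4⟩, ⟨h5, h6⟩⟩ := hx
      have hlt : enc (side N) x.1 x.2.1 x.2.2 < N :=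
        enc_lt_N (by omega) (by omega) (by omega) (by omega) (by omega) (by omega)
      rw [Finset.mem_coe, Finset.mem_image]
      refine ⟨⟨enc (side N) x.1 x.2.1 x.2.2, hlt⟩, ?_, rfl⟩
      rw [Finset.mem_filter]
      refine ⟨Finset.mem_univ _, ?_⟩
      have hde := dec_enc (n := side N) (k := x.1) (i := x.2.1) (j := x.2.2)
        (by omega) (by have := layers_le N; omega) (by omega) (by omega) (by omega) (by omega)
      simp only [hde]
      exact hint
    · intro x hx x' hx' heq
      rw [Finset.mem_coe, mem_interiorBox_iff] at hx hx'
      have hL := layers_le N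
      have h1 := dec_enc (n := side N) (k := x.1) (i := x.2.1) (j := x.2.2)
        (by omega) (by omega) (by omega) (by omega) (by omega) (by omega)
      have h2 := dec_enc (n := side N) (k := x'.1) (i := x'.2.1) (j := x'.2.2)
        (by omega) (by omega) (by omega) (by omega) (by omega) (by omega)
      have heq' : enc (side N) x.1 x.2.1 x.2.2 = enc (side N) x'.1 x'.2.1 x'.2.2 := heq
      rw [heq'] at h1
      rw [h1] at h2
      ext <;> simp only [Prod.mk.injEq] at h2 <;> [exact h2.1; exact h2.2.1; exact h2.2.2]
  have hsum := Finset.card_filter_add_card_filter_not (s := (Finset.univ : Finset (Fin N)))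
    (fun t : Fin N => Interior N (dec (side N) t).1 (dec (side N) t).2.1 (dec (side N) t).2.2)
  rw [Finset.card_univ, Fintype.card_fin] at hsum
  omega

/-- **Few non-interior particles**: at most `100 (n + 1)²`, `n = side N`. [folklore] -/
theorem card_not_interior_le (N : ℕ) :
    ((Finset.univ.filter fun t : Fin N =>
        ¬ Interior N (dec (side N) t).1 (dec (side N) t).2.1 (dec (side N) t).2.2).card : ℤ) ≤
      100 * ((side N : ℤ) + 1) ^ 2 := by
  have h1 : ((Finset.univ.filter fun t : Fin N =>
      ¬ Interior N (dec (side N) t).1 (dec (side N) t).2.1 (dec (side N) t).2.2).card : ℤ) + (interiorBox N).card ≤ N := by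
    exact_mod_cast card_not_interior_add_le N
  have hcardN : ((Finset.univ.filter fun t : Fin N =>
      ¬ Interior N (dec (side N) t).1 (dec (side N) t).2.1 (dec (side N) t).2.2).card : ℤ) ≤ N := by
    have := Finset.card_filter_le (Finset.univ : Finset (Fin N))
      (fun t : Fin N => ¬ Interior N (dec (side N) t).1 (dec (side N) t).2.1 (dec (side N) t).2.2)
    rw [Finset.card_univ, Fintype.card_fin] at this; exact_mod_cast this
  have hKf := layers_le N
  have hNc : (N : ℤ) ≤ (2 * side N + 1) ^ 3 := by exact_mod_cast le_cube_side N
  set Kf : ℕ := N / (2 * side N + 1) ^ 2 with hKfdef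
  have hN : (N : ℤ) < ((Kf : ℤ) + 1) * (2 * (side N : ℤ) + 1) ^ 2 := by
    have h0 := Nat.lt_div_mul_add (a := N) (show 0 < (2 * side N + 1) ^ 2 by positivity)
    rw [← hKfdef] at h0
    have h2 : N < (Kf + 1) * (2 * side N + 1) ^ 2 := by rw [add_mul, one_mul]; exact h0
    exact_mod_cast h2
  by_cases hK : 3 ≤ (Kf : ℤ)
  · by_cases hn2 : 2 ≤ (side N : ℤ)
    · have hbox : ((interiorBox N).card : ℤ) = ((Kf : ℤ) - 3) * (2 * (side N : ℤ) - 3) ^ 2 := by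
        rw [interiorBox, Finset.card_product, Finset.card_product, Int.card_Icc, Int.card_Icc, ← hKfdef]
        push_cast
        rw [Int.toNat_of_nonneg (by omega), Int.toNat_of_nonneg (by omega)]; ring
      nlinarith
    · push Not at hn2
      nlinarith
  · push Not at hK
    nlinarith

/-! ### The defect density of the blocks tends to zero -/

/-- Defective particles are non-interior. [folklore] -/
theorem defects_block_le (hs : IsHaggSeq s) (N : ℕ) :
    (Summit.AtomisticToContinuum.Crystallization.Theorems.DefectFreeCrystallizes.Negative.PredicateAPI.defects (block s N) : ℤ) ≤ 100 * ((side N : ℤ) + 1) ^ 2 := by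
  classical
  refine le_trans ?_ (card_not_interior_le N)
  unfold Summit.AtomisticToContinuum.Crystallization.Theorems.DefectFreeCrystallizes.Negative.PredicateAPI.defects
  rw [Nat.card_eq_fintype_card, Fintype.card_subtype]
  have hsub : (Finset.univ.filter fun t : Fin N => ¬ Summit.AtomisticToContinuum.Crystallization.Theorems.DefectFreeCrystallizes.Negative.PredicateAPI.Good (block s N) t) ⊆
      (Finset.univ.filter fun t : Fin N =>
        ¬ Interior N (dec (side N) t).1 (dec (side N) t).2.1 (dec (side N) t).2.2) := by
    intro t ht
    rw [Finset.mem_filter] at ht ⊢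
    exact ⟨ht.1, fun hint => ht.2 (good_block hs t hint)⟩
  exact_mod_cast Finset.card_le_card hsub

/-- **Zero defect density of the witness.** [folklore] -/
theorem tendsto_defects_block (hs : IsHaggSeq s) :
    Tendsto (fun N : ℕ => (Summit.AtomisticToContinuum.Crystallization.Theorems.DefectFreeCrystallizes.Negative.PredicateAPI.defects (block s N) : ℝ) / N) atTop (nhds 0) := by
  rw [Metric.tendsto_atTop]
  intro ε hε
  obtain ⟨M, hM⟩ := exists_nat_gt (400 / ε)
  refine ⟨(2 * M + 1) ^ 3 + 1, fun N hN => ?_⟩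
  have hside : M < side N := lt_side_of_cube_lt (by omega)
  have hn1 : 1 ≤ side N := by omega
  -- N > (2 n - 1)^3 ≥ n^3
  have hNlow : (2 * (side N - 1) + 1) ^ 3 < N := cube_lt_of_lt_side (by omega)
  have hNpos : (0 : ℝ) < N := by exact_mod_cast (show 0 < N by omega)
  have hdef : (Summit.AtomisticToContinuum.Crystallization.Theorems.DefectFreeCrystallizes.Negative.PredicateAPI.defects (block s N) : ℝ) ≤ 100 * ((side N : ℝ) + 1) ^ 2 := by
    exact_mod_cast defects_block_le hs N
  have hd0 : (0 : ℝ) ≤ Summit.AtomisticToContinuum.Crystallization.Theorems.DefectFreeCrystallizes.Negative.PredicateAPI.defects (block s N) := by positivity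
  rw [Real.dist_eq, sub_zero, abs_of_nonneg (div_nonneg hd0 hNpos.le), div_lt_iff₀ hNpos]
  have hn : (1 : ℝ) ≤ side N := by exact_mod_cast hn1
  have hNlow' : ((side N : ℝ)) ^ 3 ≤ N := by
    have h1 : (side N) ^ 3 ≤ (2 * (side N - 1) + 1) ^ 3 := Nat.pow_le_pow_left (by omega) 3
    have : (side N) ^ 3 < N := lt_of_le_of_lt h1 hNlow
    exact_mod_cast this.le
  have hMε : 400 / ε < side N := hM.trans (by exact_mod_cast hside)
  have h400 : 400 < ε * side N := by rwa [div_lt_iff₀ hε, mul_comm] at hMε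
  calc (Summit.AtomisticToContinuum.Crystallization.Theorems.DefectFreeCrystallizes.Negative.PredicateAPI.defects (block s N) : ℝ) ≤ 100 * ((side N : ℝ) + 1) ^ 2 := hdef
    _ ≤ 400 * (side N : ℝ) ^ 2 := by nlinarith
    _ < ε * (side N : ℝ) ^ 3 := by nlinarith [pow_pos (by linarith : (0 : ℝ) < side N) 2]
    _ ≤ ε * N := by gcongr

end Summit.AtomisticToContinuum.Crystallization.Cruxes.DefectFreeCrystallizes.Disproof.StackingBlocks

end

/-! ## §8.5 The crux without ground states: statement, reduction of the crux to it, and its REFUTATION (`not_defectFreeCrystallizesWithoutGroundStates`) -/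

noncomputable section

namespace Summit.AtomisticToContinuum.Crystallization.Cruxes.DefectFreeCrystallizes.Disproof.WithoutGroundStates

open Literature.MathematicalPhysics.StatisticalMechanics Literature.Geometry.DiscreteGeometry
open Summit.AtomisticToContinuum.Crystallization.Theses.ReggeStarCoercivity
open scoped BigOperators Topology
open Filter Set Metric

local notation "E3" => EuclideanSpace ℝ (Fin 3)

/-- **The crux WITHOUT ground states** (per sequence): for every sequence of injective, `δ`-separated finite
configurations whose fraction of `1/20`-defective first shells tends to `0`, some translated subsequence converges
locally to a non-zero periodic point measure — the hypothesis and the conclusion of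
`ReggeStarCoercivity.DefectFreeCrystallizes` (= `ZeroDefectDensity → IsCrystallizing lennardJones 3`) with the class of
Lennard-Jones ground-state sequences REPLACED by the class of injective `δ`-separated sequences (the defect predicate and
the convergence clause are verbatim). For `δ = 1/3` it implies the crux (`defectFreeCrystallizes_of_without`); it is
FALSE for every `δ ≤ 1` (`not_defectFreeCrystallizesWithoutGroundStates`). -/
def DefectFreeCrystallizesWithoutGroundStates (δ : ℝ) : Prop :=
  ∀ x : (N : ℕ) → (Fin N → EuclideanSpace ℝ (Fin 3)),
    (∀ N, Function.Injective (x N) ∧ ∀ i j : Fin N, i ≠ j → δ ≤ dist (x N i) (x N j)) →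
    Filter.Tendsto (fun N : ℕ => (Nat.card {i : Fin N // ¬ ∃ a : ℝ, 9 / 10 ≤ a ∧ a ≤ 11 / 10 ∧
      (Literature.Geometry.DiscreteGeometry.ShellCloseTo (1 / 20) ((Finset.univ.filter fun j : Fin N => j ≠ i ∧
        dist (x N i) (x N j) ≤ 6 / 5).image fun j => a⁻¹ • (x N j - x N i)) Literature.Geometry.DiscreteGeometry.fccKissingPattern ∨
      Literature.Geometry.DiscreteGeometry.ShellCloseTo (1 / 20) ((Finset.univ.filter fun j : Fin N => j ≠ i ∧
        dist (x N i) (x N j) ≤ 6 / 5).image fun j => a⁻¹ • (x N j - x N i)) Literature.Geometry.DiscreteGeometry.hcpKissingPattern)} : ℝ) / N)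
      Filter.atTop (nhds 0) →
    ∃ (φ : ℕ → ℕ) (τ : ℕ → EuclideanSpace ℝ (Fin 3)) (P : PeriodicConfiguration 3) (m : EuclideanSpace ℝ (Fin 3) → ℕ),
      StrictMono φ ∧ (∀ s ∈ P.points, 1 ≤ m s) ∧ (∀ g ∈ P.lattice, ∀ s, m (s + g) = m s) ∧
      ∀ f : EuclideanSpace ℝ (Fin 3) → ℝ, Continuous f → HasCompactSupport f →
        Filter.Tendsto (fun j => ∑ i : Fin (φ j), f (x (φ j) i + τ j)) Filter.atTop
          (nhds (∑' s : P.points, (m s : ℝ) * f s))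

/-- Monotonicity in `δ`: a larger separation is a stronger hypothesis on the sequences. [folklore] -/
theorem DefectFreeCrystallizesWithoutGroundStates.mono {δ δ' : ℝ} (hle : δ ≤ δ')
    (h : DefectFreeCrystallizesWithoutGroundStates δ) : DefectFreeCrystallizesWithoutGroundStates δ' :=
  fun x hx hd => h x (fun N => ⟨(hx N).1, fun i j hij => hle.trans ((hx N).2 i j hij)⟩) hd

/-- **The geometric bridge would imply the crux**: Lennard-Jones ground states are injective and uniformly separated
(`LennardJonesMinimalDistance_holds`, some `δ₀ > 0`; `min δ₀ 1 ≤ 1`), so the per-sequence statement at every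
admissible separation `δ ≤ 1` yields `IsCrystallizing lennardJones 3` from `ZeroDefectDensity`. [folklore] -/
theorem defectFreeCrystallizes_of_without
    (h : ∀ δ : ℝ, 0 < δ → δ ≤ 1 → DefectFreeCrystallizesWithoutGroundStates δ) : DefectFreeCrystallizes := by
  intro hZ x hx
  obtain ⟨δ₀, hδ₀, hsep⟩ := LennardJonesMinimalDistance_holds
  have hh := h (min δ₀ 1) (lt_min hδ₀ one_pos) (min_le_right _ _)
  exact hh x (fun N => ⟨(hx N).1, fun i j hij => (min_le_left _ _).trans (hsep N (x N) (hx N) i j hij)⟩) (hZ x hx)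

/-! ### Periodic configurations: covering radius, a vertical period, translation invariance of the limit -/

/-- **Covering radius**: every point of space is within some `ρ` of the periodic configuration. [folklore] -/
theorem exists_covering_radius (P : PeriodicConfiguration 3) :
    ∃ ρ : ℝ, 0 ≤ ρ ∧ ∀ z : E3, ∃ s ∈ P.points, dist s z ≤ ρ := by
  haveI : Module.Finite ℤ P.lattice := ZLattice.module_finite ℝ P.lattice
  let b₀ := Module.Free.chooseBasis ℤ P.lattice
  let B := b₀.ofZLatticeBasis ℝ P.lattice
  obtain ⟨D, hD⟩ := (ZSpan.fundamentalDomain_isBounded B).exists_norm_le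
  obtain ⟨y₀, hy₀⟩ := P.motif_nonempty
  refine ⟨|D| + ‖y₀‖, by positivity, fun z => ?_⟩
  have hfl : (ZSpan.floor B (z - y₀) : E3) ∈ P.lattice :=
    (b₀.ofZLatticeBasis_span ℝ (L := P.lattice)).le (ZSpan.floor B (z - y₀)).2
  refine ⟨y₀ + ZSpan.floor B (z - y₀), ⟨y₀, hy₀, _, hfl, rfl⟩, ?_⟩
  have hfr := hD _ (ZSpan.fract_mem_fundamentalDomain B (z - y₀))
  rw [ZSpan.fract_apply] at hfr
  calc dist (y₀ + (ZSpan.floor B (z - y₀) : E3)) z = ‖z - y₀ - ZSpan.floor B (z - y₀)‖ := by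
        rw [dist_comm, dist_eq_norm]; congr 1; abel
    _ ≤ D := hfr
    _ ≤ |D| + ‖y₀‖ := by linarith [le_abs_self D, norm_nonneg y₀]

/-- **A vertical period**: the lattice of a periodic configuration of `ℝ³` contains a vector with non-zero third
coordinate (it spans `ℝ³`). [folklore] -/
theorem exists_lattice_vertical (P : PeriodicConfiguration 3) : ∃ g ∈ P.lattice, g 2 ≠ 0 := by
  by_contra hno
  push Not at hno
  have hspan : Submodule.span ℝ (P.lattice : Set E3) = ⊤ := P.isZLattice.span_top
  -- the coordinate functional vanishes on the lattice, hence on its span, hence on `e₃`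
  let ℓ : E3 →ₗ[ℝ] ℝ := (EuclideanSpace.proj (2 : Fin 3) : E3 →L[ℝ] ℝ)
  have hle : Submodule.span ℝ (P.lattice : Set E3) ≤ LinearMap.ker ℓ := by
    rw [Submodule.span_le]
    intro g hg
    simp only [SetLike.mem_coe, LinearMap.mem_ker]
    exact hno g hg
  rw [hspan, top_le_iff, LinearMap.ker_eq_top] at hle
  have := LinearMap.congr_fun hle (EuclideanSpace.single (2 : Fin 3) (1 : ℝ))
  simp [ℓ] at this

/-- Translating the test function by a lattice vector does not change the limit functional. [folklore] -/
theorem tsum_translate (P : PeriodicConfiguration 3) (m : E3 → ℕ) (hm : ∀ g ∈ P.lattice, ∀ s, m (s + g) = m s)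
    {g : E3} (hg : g ∈ P.lattice) (f : E3 → ℝ) :
    (∑' s : P.points, (m s : ℝ) * f (s - g)) = ∑' s : P.points, (m s : ℝ) * f s := by
  have hneg : -g ∈ P.lattice := P.lattice.neg_mem hg
  -- the shift `s ↦ s - g` is a permutation of `P.points`
  let e : P.points ≃ P.points :=
    { toFun := fun s => ⟨s.1 - g, by rw [sub_eq_add_neg]; exact P.add_mem_points s.2 hneg⟩
      invFun := fun s => ⟨s.1 + g, P.add_mem_points s.2 hg⟩
      left_inv := fun s => Subtype.ext (by simp)
      right_inv := fun s => Subtype.ext (by simp) }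
  calc (∑' s : P.points, (m s : ℝ) * f (s - g)) = ∑' s : P.points, (m (e s) : ℝ) * f (e s) := by
        refine tsum_congr fun s => ?_
        have : m (s.1 - g) = m s := by
          have := hm (-g) hneg s.1
          rw [← sub_eq_add_neg] at this
          exact this
        simp only [e, Equiv.coe_fn_mk, this]
    _ = ∑' s : P.points, (m s : ℝ) * f s := e.tsum_eq (fun s => (m s : ℝ) * f s)

/-! ### The witness blocks are bulk-complete where they are dense -/

section Bulk

open StackingBlocks
open Summit.AtomisticToContinuum.Crystallization.Cruxes.DefectFreeCrystallizes.Disproof.StackingShift (hI hI_sq hI_pos hI_lt_one bp)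

variable {s : ℤ → ℤ}

/-- Index triples inside the complete layers of the box are present. [folklore] -/
theorem exists_block_eq_of_index_bounds {N : ℕ} {k i j : ℤ} (hk : -(side N : ℤ) ≤ k)
    (hk2 : k + side N + 1 ≤ ((N / (2 * side N + 1) ^ 2 : ℕ) : ℤ)) (hi : -(side N : ℤ) ≤ i) (hi' : i ≤ side N)
    (hj : -(side N : ℤ) ≤ j) (hj' : j ≤ side N) : ∃ t : Fin N, block s N t = bq s k i j := by
  have hk' : k ≤ side N := by have := layers_le N; omega
  refine ⟨⟨enc (side N) k i j, enc_lt_N hk hk2 hi hi' hj hj'⟩, ?_⟩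
  unfold block
  simp only []
  rw [dec_enc hk hk' hi hi' hj hj']

/-- The lateral functionals `F(p) = x − y/√3`, `G(p) = 2y/√3`. -/
def Fℓ (p : EuclideanSpace ℝ (Fin 3)) : ℝ := p 0 - p 1 / Real.sqrt 3
/-- See `Fℓ`. -/
def Gℓ (p : EuclideanSpace ℝ (Fin 3)) : ℝ := 2 * p 1 / Real.sqrt 3

/-- `√3 > 0`. [folklore] -/
theorem sqrt3_pos : (0 : ℝ) < Real.sqrt 3 := by positivity
/-- `1 < √3`. [folklore] -/
theorem one_lt_sqrt3 : (1 : ℝ) < Real.sqrt 3 := by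
  rw [show (1:ℝ) = Real.sqrt 1 by simp]; exact Real.sqrt_lt_sqrt (by norm_num) (by norm_num)

/-- `F` is `2`-Lipschitz (crudely). [folklore] -/
theorem abs_Fℓ_sub_le (p q : E3) : |Fℓ p - Fℓ q| ≤ 2 * dist p q := by
  have h0 : |p 0 - q 0| ≤ dist p q := by
    have := PiLp.dist_apply_le p q 0; rwa [Real.dist_eq] at this
  have h1 : |p 1 - q 1| ≤ dist p q := by
    have := PiLp.dist_apply_le p q 1; rwa [Real.dist_eq] at this
  have h1' : |(p 1 - q 1) / Real.sqrt 3| ≤ dist p q := by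
    rw [abs_div, abs_of_pos sqrt3_pos, div_le_iff₀ sqrt3_pos]
    nlinarith [one_lt_sqrt3, dist_nonneg (x := p) (y := q)]
  unfold Fℓ
  calc |p 0 - p 1 / Real.sqrt 3 - (q 0 - q 1 / Real.sqrt 3)| = |(p 0 - q 0) - (p 1 - q 1) / Real.sqrt 3| := by ring_nf
    _ ≤ |p 0 - q 0| + |(p 1 - q 1) / Real.sqrt 3| := abs_sub _ _
    _ ≤ 2 * dist p q := by linarith

/-- `G` is `2`-Lipschitz (crudely). [folklore] -/
theorem abs_Gℓ_sub_le (p q : E3) : |Gℓ p - Gℓ q| ≤ 2 * dist p q := by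
  have h1 : |p 1 - q 1| ≤ dist p q := by
    have := PiLp.dist_apply_le p q 1; rwa [Real.dist_eq] at this
  unfold Gℓ
  rw [← sub_div, ← mul_sub, abs_div, abs_mul, abs_two, abs_of_pos sqrt3_pos, div_le_iff₀ sqrt3_pos]
  nlinarith [one_lt_sqrt3, dist_nonneg (x := p) (y := q), abs_nonneg (p 1 - q 1)]

/-- `F` along `e_x` grows at rate `1`. [folklore] -/
theorem Fℓ_add_single_zero (p : E3) (r : ℝ) : Fℓ (p + r • EuclideanSpace.single 0 1) = Fℓ p + r := by
  simp [Fℓ]; ring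

/-- `G` along `e_y` grows at rate `2/√3 ≥ 1`. [folklore] -/
theorem Gℓ_add_single_one (p : E3) (r : ℝ) : Gℓ (p + r • EuclideanSpace.single 1 1) = Gℓ p + 2 * r / Real.sqrt 3 := by
  simp [Gℓ]; ring

/-- The third coordinate along `e_z`. [folklore] -/
theorem apply_two_add_single_two (p : E3) (r : ℝ) : (p + r • EuclideanSpace.single 2 1 : E3) 2 = p 2 + r := by simp

/-- The coordinate vectors have norm `1`. [folklore] -/
theorem norm_single (l : Fin 3) : ‖(EuclideanSpace.single l (1 : ℝ) : E3)‖ = 1 := by simp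

/-- Coordinates of reduced-label points: `F = i + r/3`, `G = j + r/3`, `z = k hI`, `r = L mod 3 ∈ [0, 2]`. [folklore] -/
theorem coords_bq (s : ℤ → ℤ) (k i j : ℤ) :
    Fℓ (bq s k i j) = i + ((haggLabel s k % 3 : ℤ) : ℝ) / 3 ∧ Gℓ (bq s k i j) = j + ((haggLabel s k % 3 : ℤ) : ℝ) / 3 ∧
      (bq s k i j) 2 = k * hI := by
  have hmod : ((haggLabel s k % 3 : ℤ) : ℝ) = (haggLabel s k : ℝ) - 3 * ((haggLabel s k / 3 : ℤ) : ℝ) := by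
    have := Int.emod_add_ediv_mul (haggLabel s k) 3   -- L % 3 + L / 3 * 3 = L
    have h' : ((haggLabel s k % 3 : ℤ) : ℝ) + ((haggLabel s k / 3 : ℤ) : ℝ) * 3 = (haggLabel s k : ℝ) := by
      exact_mod_cast this
    linarith
  refine ⟨?_, ?_, ?_⟩
  · unfold Fℓ bq bp
    simp only [barlowPos_apply_zero, barlowPos_apply_one, one_mul]
    rw [hmod]; field_simp; push_cast; ring
  · unfold Gℓ bq bp
    simp only [barlowPos_apply_one, one_mul]
    rw [hmod]; field_simp; push_cast; ring
  · unfold bq bp; simp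

/-- `L % 3 ∈ [0, 2]`. [folklore] -/
theorem emod_three_bounds (L : ℤ) : 0 ≤ L % 3 ∧ L % 3 ≤ 2 := ⟨Int.emod_nonneg _ (by norm_num), by omega⟩

/-- Coordinates of a particle: `F, G ∈ [-n, n + 2/3]`, `z ∈ [-n hI, (Kf - n) hI]`. [folklore] -/
theorem coords_block {N : ℕ} (t : Fin N) :
    -(side N : ℝ) ≤ Fℓ (block s N t) ∧ Fℓ (block s N t) ≤ side N + 2 / 3 ∧
    -(side N : ℝ) ≤ Gℓ (block s N t) ∧ Gℓ (block s N t) ≤ side N + 2 / 3 ∧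
    -(side N : ℝ) * hI ≤ (block s N t) 2 ∧ (block s N t) 2 ≤ (((N / (2 * side N + 1) ^ 2 : ℕ) : ℝ) - side N) * hI := by
  have ht : (t : ℕ) < (2 * side N + 1) ^ 3 := lt_of_lt_of_le t.2 (le_cube_side N)
  obtain ⟨b1, b2, b3, b4, b5, b6⟩ := dec_mem_box (n := side N) ht
  obtain ⟨cF, cG, cz⟩ := coords_bq s (dec (side N) t).1 (dec (side N) t).2.1 (dec (side N) t).2.2
  have hr := emod_three_bounds (haggLabel s (dec (side N) t).1)
  have hr0 : (0 : ℝ) ≤ ((haggLabel s (dec (side N) t).1 % 3 : ℤ) : ℝ) := by exact_mod_cast hr.1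
  have hr2 : ((haggLabel s (dec (side N) t).1 % 3 : ℤ) : ℝ) ≤ 2 := by exact_mod_cast hr.2
  -- top layer index
  have hk : (dec (side N) t).1 ≤ ((N / (2 * side N + 1) ^ 2 : ℕ) : ℤ) - side N := by
    unfold dec
    simp only
    have : (t : ℕ) / (2 * side N + 1) ^ 2 ≤ N / (2 * side N + 1) ^ 2 := Nat.div_le_div_right t.2.le
    omega
  unfold block
  rw [cF, cG, cz]
  have hi1 : (-(side N : ℤ) : ℝ) ≤ (dec (side N) t).2.1 := by exact_mod_cast b3
  have hi2 : ((dec (side N) t).2.1 : ℝ) ≤ side N := by exact_mod_cast b4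
  have hj1 : (-(side N : ℤ) : ℝ) ≤ (dec (side N) t).2.2 := by exact_mod_cast b5
  have hj2 : ((dec (side N) t).2.2 : ℝ) ≤ side N := by exact_mod_cast b6
  have hk1 : (-(side N : ℤ) : ℝ) ≤ (dec (side N) t).1 := by exact_mod_cast b1
  have hk2 : ((dec (side N) t).1 : ℝ) ≤ ((N / (2 * side N + 1) ^ 2 : ℕ) : ℝ) - side N := by exact_mod_cast hk
  push_cast at hi1 hj1 hk1
  refine ⟨by linarith, by linarith, by linarith, by linarith, ?_, ?_⟩
  · nlinarith [hI_pos]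
  · exact mul_le_mul_of_nonneg_right hk2 hI_pos.le

end Bulk

section MainBulk

open StackingBlocks
open Summit.AtomisticToContinuum.Crystallization.Cruxes.DefectFreeCrystallizes.Disproof.StackingShift (hI hI_sq hI_pos hI_lt_one bp)

variable {s : ℤ → ℤ}

/-- An axis probe at parameter `r` is at distance `|r|` from the centre. [folklore] -/
theorem dist_add_smul_single (c : E3) (r : ℝ) (l : Fin 3) :
    dist (c + r • EuclideanSpace.single l 1) c = |r| := by
  rw [dist_eq_norm, add_sub_cancel_left, norm_smul, norm_single, mul_one, Real.norm_eq_abs]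

/-- A coordinate difference is bounded by the distance. [folklore] -/
theorem abs_apply_sub_le_dist (p q : E3) (l : Fin 3) : |p l - q l| ≤ dist p q := by
  have := PiLp.dist_apply_le p q l; rwa [Real.dist_eq] at this

/-- **Dense blocks are bulk-complete.** If every point of `B̄(c, R₁)` has a particle of `block s N` within `ρ'`
(`R₁ ≥ 2ρ' + 6`), then every STACKING point of `B̄(c, (R₁ − 2ρ' − 6)/2)` is a particle of the block: the six
axis probes at distance `R₁` locate the faces of the filled box far from `c`. [folklore] -/
theorem bulk_of_dense {N : ℕ} {c : E3} {ρ' R₁ : ℝ} (hρ : 0 ≤ ρ') (hR : 2 * ρ' + 6 ≤ R₁)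
    (hdense : ∀ y : E3, dist y c ≤ R₁ → ∃ t : Fin N, dist (block s N t) y ≤ ρ') :
    ∀ k i j : ℤ, dist (bp s k i j) c ≤ (R₁ - 2 * ρ' - 6) / 2 → ∃ t : Fin N, block s N t = bp s k i j := by
  intro k i j hp
  have hR0 : 0 ≤ R₁ := by linarith
  have habs : |R₁| = R₁ := abs_of_nonneg hR0
  have habs' : |-R₁| = R₁ := by rw [abs_neg, habs]
  -- six probes
  obtain ⟨t₁, ht₁⟩ := hdense (c + R₁ • EuclideanSpace.single 0 1) (by rw [dist_add_smul_single, habs])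
  obtain ⟨t₂, ht₂⟩ := hdense (c + (-R₁) • EuclideanSpace.single 0 1) (by rw [dist_add_smul_single, habs'])
  obtain ⟨t₃, ht₃⟩ := hdense (c + R₁ • EuclideanSpace.single 1 1) (by rw [dist_add_smul_single, habs])
  obtain ⟨t₄, ht₄⟩ := hdense (c + (-R₁) • EuclideanSpace.single 1 1) (by rw [dist_add_smul_single, habs'])
  obtain ⟨t₅, ht₅⟩ := hdense (c + R₁ • EuclideanSpace.single 2 1) (by rw [dist_add_smul_single, habs])
  obtain ⟨t₆, ht₆⟩ := hdense (c + (-R₁) • EuclideanSpace.single 2 1) (by rw [dist_add_smul_single, habs'])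
  obtain ⟨a1, a2, -, -, -, -⟩ := coords_block (s := s) t₁
  obtain ⟨b1, b2, -, -, -, -⟩ := coords_block (s := s) t₂
  obtain ⟨-, -, c1, c2, -, -⟩ := coords_block (s := s) t₃
  obtain ⟨-, -, d1, d2, -, -⟩ := coords_block (s := s) t₄
  obtain ⟨-, -, -, -, e1, e2⟩ := coords_block (s := s) t₅
  obtain ⟨-, -, -, -, f1, f2⟩ := coords_block (s := s) t₆
  have hF1 := abs_Fℓ_sub_le (block s N t₁) (c + R₁ • EuclideanSpace.single 0 1)
  have hF2 := abs_Fℓ_sub_le (block s N t₂) (c + (-R₁) • EuclideanSpace.single 0 1)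
  rw [Fℓ_add_single_zero] at hF1 hF2
  have hG3 := abs_Gℓ_sub_le (block s N t₃) (c + R₁ • EuclideanSpace.single 1 1)
  have hG4 := abs_Gℓ_sub_le (block s N t₄) (c + (-R₁) • EuclideanSpace.single 1 1)
  rw [Gℓ_add_single_one] at hG3 hG4
  have hz5 := abs_apply_sub_le_dist (block s N t₅) (c + R₁ • EuclideanSpace.single 2 1) 2
  have hz6 := abs_apply_sub_le_dist (block s N t₆) (c + (-R₁) • EuclideanSpace.single 2 1) 2
  rw [apply_two_add_single_two] at hz5 hz6
  rw [abs_le] at hF1 hF2 hG3 hG4 hz5 hz6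
  have hs3 : R₁ ≤ 2 * R₁ / Real.sqrt 3 := by
    rw [le_div_iff₀ sqrt3_pos]
    have : Real.sqrt 3 ≤ 2 := by
      have h4 : Real.sqrt 4 = 2 := by rw [show (4:ℝ) = 2 ^ 2 by norm_num, Real.sqrt_sq (by norm_num)]
      rw [← h4]; exact Real.sqrt_le_sqrt (by norm_num)
    nlinarith
  -- bounds on the window centre
  have cF_hi : Fℓ c ≤ side N + 2 / 3 - R₁ + 2 * ρ' := by linarith [hF1.1, hF1.2]
  have cF_lo : -(side N : ℝ) + R₁ - 2 * ρ' ≤ Fℓ c := by linarith [hF2.1, hF2.2]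
  have cG_hi : Gℓ c ≤ side N + 2 / 3 - R₁ + 2 * ρ' := by linarith [hG3.1, hG3.2]
  have cG_lo : -(side N : ℝ) + R₁ - 2 * ρ' ≤ Gℓ c := by
    have : 2 * -R₁ / Real.sqrt 3 = -(2 * R₁ / Real.sqrt 3) := by ring
    rw [this] at hG4; linarith [hG4.1, hG4.2]
  have cz_hi : c 2 ≤ (((N / (2 * side N + 1) ^ 2 : ℕ) : ℝ) - side N) * hI - R₁ + ρ' := by linarith [hz5.1, hz5.2]
  have cz_lo : -(side N : ℝ) * hI + R₁ - ρ' ≤ c 2 := by linarith [hz6.1, hz6.2]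
  -- the stacking point in reduced coordinates
  set q := haggLabel s k / 3 with hq
  have hpq : bp s k i j = bq s k (i + q) (j + q) := bp_eq_bq s k i j
  obtain ⟨pF, pG, pz⟩ := coords_bq s k (i + q) (j + q)
  rw [← hpq] at pF pG pz
  have hr := emod_three_bounds (haggLabel s k)
  have hr0 : (0 : ℝ) ≤ ((haggLabel s k % 3 : ℤ) : ℝ) := by exact_mod_cast hr.1
  have hr2 : ((haggLabel s k % 3 : ℤ) : ℝ) ≤ 2 := by exact_mod_cast hr.2
  have dF := abs_Fℓ_sub_le (bp s k i j) c
  have dG := abs_Gℓ_sub_le (bp s k i j) c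
  have dz := abs_apply_sub_le_dist (bp s k i j) c 2
  rw [abs_le] at dF dG dz
  rw [pF] at dF; rw [pG] at dG; rw [pz] at dz
  push_cast at dF dG
  -- integer index bounds
  have hi1 : -(side N : ℤ) ≤ i + q := by
    have : (-(side N : ℤ) : ℝ) ≤ ((i + q : ℤ) : ℝ) := by push_cast; linarith [dF.1]
    exact_mod_cast this
  have hi2 : i + q ≤ side N := by
    have : ((i + q : ℤ) : ℝ) ≤ (side N : ℤ) := by push_cast; linarith [dF.2]
    exact_mod_cast this
  have hj1 : -(side N : ℤ) ≤ j + q := by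
    have : (-(side N : ℤ) : ℝ) ≤ ((j + q : ℤ) : ℝ) := by push_cast; linarith [dG.1]
    exact_mod_cast this
  have hj2 : j + q ≤ side N := by
    have : ((j + q : ℤ) : ℝ) ≤ (side N : ℤ) := by push_cast; linarith [dG.2]
    exact_mod_cast this
  have hk1 : -(side N : ℤ) ≤ k := by
    have h1 : (-(side N : ℝ) - k) * hI ≤ -3 := by linarith [dz.1, hp, cz_lo]
    have h2 : (-(side N : ℝ) - k) < 0 := by
      by_contra h0
      push Not at h0
      have := mul_nonneg h0 hI_pos.le
      linarith
    have : (-(side N : ℤ) : ℝ) ≤ (k : ℝ) := by push_cast; linarith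
    exact_mod_cast this
  have hk2 : k + side N + 1 ≤ ((N / (2 * side N + 1) ^ 2 : ℕ) : ℤ) := by
    set u : ℝ := (k : ℝ) - (((N / (2 * side N + 1) ^ 2 : ℕ) : ℝ) - side N) with hu
    have h1 : u * hI ≤ -3 := by rw [hu]; linarith [dz.2, hp, cz_hi]
    have hneg : u < 0 := by
      by_contra h0
      push Not at h0
      have := mul_nonneg h0 hI_pos.le
      linarith
    have h3 : (-u) * hI ≤ (-u) * 1 := mul_le_mul_of_nonneg_left hI_lt_one.le (by linarith)
    have h2 : u + 3 ≤ 0 := by linarith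
    have : (k : ℝ) + (side N : ℝ) + 1 ≤ ((N / (2 * side N + 1) ^ 2 : ℕ) : ℝ) := by linarith
    refine (Int.cast_le (R := ℝ)).1 ?_
    simpa only [Int.cast_add, Int.cast_one, Int.cast_natCast] using this
  obtain ⟨t, ht⟩ := exists_block_eq_of_index_bounds (s := s) hk1 hk2 hi1 hi2 hj1 hj2
  exact ⟨t, by rw [ht, hpq]⟩

end MainBulk

section Main

open StackingBlocks
open Summit.AtomisticToContinuum.Crystallization.Cruxes.DefectFreeCrystallizes.Disproof.StackingShift (hI hI_sq hI_pos hI_lt_one bp)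

/-- `|p₂| ≤ ‖p‖` for the third coordinate. -/
theorem abs_apply_two_le_norm (p : E3) : |p 2| ≤ ‖p‖ := by
  have h := PiLp.dist_apply_le p (0 : E3) 2
  rwa [Real.dist_eq, dist_zero_right, show (0 : E3) 2 = 0 from rfl, sub_zero] at h

/-- **The geometric bridge is FALSE without exact minimality** (load-bearing analysis of the crux, kernel-checked):
for every separation `δ ≤ 1` the per-sequence statement `DefectFreeCrystallizesWithoutGroundStates δ` fails.
Witness: the lexicographically filled boxes `block rulerHagg N` of the unit Barlow stacking of the RULER (2-adic)
Hägg word.  They are injective and `1`-separated (`one_le_dist_block`) with `O(N^{2/3})` defective shells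
(`tendsto_defects_block`).  If some translated subsequence converged locally to a periodic point measure `P`
(multiplicities `≥ 1`), then (`eventually_ballMatch`) a large window would be two-way `1/100`-matched to `P`;
the covering radius of `P` makes the block dense there, density makes it bulk-complete (`bulk_of_dense`), a
vertical period `g` of `P` makes the window forward-self-matched by `g`, whence (`periodic_of_selfmatch`) the Hägg
word is `Δk`-periodic (`Δk ≠ 0`) on `≥ 4|Δk| + 1` consecutive layers — impossible for the ruler word
(`rulerHagg_periodic_stretch_lt`).  Hence any proof of the crux must use a property of Lennard-Jones ground states
beyond injectivity, separation and zero defect density: exact minimality has to select the stacking. -/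
theorem not_defectFreeCrystallizesWithoutGroundStates {δ : ℝ} (hδ : δ ≤ 1) :
    ¬ DefectFreeCrystallizesWithoutGroundStates δ := by
  intro h
  set s : ℤ → ℤ := RulerHagg.rulerHagg with hs_def
  have hs : IsHaggSeq s := RulerHagg.isHaggSeq_rulerHagg
  obtain ⟨φ, τ, P, m, -, hm1, -, hconv⟩ := h (fun N => block s N)
    (fun N => ⟨block_injective hs N, fun i i' hii' => hδ.trans (one_le_dist_block hs N hii')⟩)
    (tendsto_defects_block hs)
  -- geometry of the limit configuration
  obtain ⟨ρP, hρP0, hcov⟩ := exists_covering_radius P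
  obtain ⟨g₀, hg₀L, hg₀2⟩ := exists_lattice_vertical P
  obtain ⟨n₀, hn₀⟩ : ∃ n₀ : ℕ, 1 ≤ n₀ * |g₀ 2| := by
    have hpos : 0 < |g₀ 2| := abs_pos.2 hg₀2
    obtain ⟨n, hn⟩ := exists_nat_gt (1 / |g₀ 2|)
    refine ⟨n, ?_⟩
    rw [div_lt_iff₀ hpos] at hn
    linarith
  set g : E3 := (n₀ : ℝ) • g₀ with hg_def
  have hgL : g ∈ P.lattice := by
    rw [hg_def, Nat.cast_smul_eq_nsmul]; exact nsmul_mem hg₀L n₀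
  have hg2 : 1 ≤ |g 2| := by
    rw [hg_def, PiLp.smul_apply, smul_eq_mul, abs_mul, Nat.abs_cast]; exact hn₀
  set K : ℝ := ‖g‖ with hK
  have hK0 : 0 ≤ K := norm_nonneg _
  have hK2 : |g 2| ≤ K := abs_apply_two_le_norm g
  -- radii
  set R₂ : ℝ := 3 * K + ρP + 11 with hR₂
  set ρ' : ℝ := ρP + 1 / 100 with hρ'
  set R₁ : ℝ := 2 * R₂ + 2 * ρ' + 6 with hR₁
  set R : ℝ := R₁ + ρP with hR
  have hρ'0 : 0 ≤ ρ' := by rw [hρ']; linarith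
  have hR₂0 : 0 ≤ R₂ := by rw [hR₂]; linarith
  -- two-way matching of a translate of a large block with `P` on `B(0, R)`
  have hev := VagueToMatching.eventually_ballMatch P m hm1 (fun j i => block s (φ j) i + τ j) hconv R (1 / 100)
    (by norm_num)
  obtain ⟨j, hA1, hA2⟩ := hev.exists
  set N : ℕ := φ j with hN
  set c : E3 := -τ j with hc
  have hdistc : ∀ p : E3, dist p c = ‖p + τ j‖ := fun p => by rw [hc, dist_eq_norm, sub_neg_eq_add]
  have A1 : ∀ q ∈ P.points, ‖q‖ ≤ R → ∃ t : Fin N, dist (block s N t + τ j) q ≤ 1 / 100 := by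
    intro q hq hqR
    obtain ⟨a, ⟨t, rfl⟩, ha⟩ := hA1 q hq (by rwa [dist_zero_right])
    exact ⟨t, ha⟩
  have A2 : ∀ t : Fin N, ‖block s N t + τ j‖ ≤ R → ∃ q ∈ P.points, dist (block s N t + τ j) q ≤ 1 / 100 := by
    intro t ht
    obtain ⟨q, hq, hd⟩ := hA2 (block s N t + τ j) ⟨t, rfl⟩ (by rwa [dist_zero_right])
    exact ⟨q, hq, hd⟩
  -- density of the block in `B(c, R₁)`
  have hdense : ∀ y : E3, dist y c ≤ R₁ → ∃ t : Fin N, dist (block s N t) y ≤ ρ' := by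
    intro y hy
    rw [hdistc] at hy
    obtain ⟨q, hq, hqy⟩ := hcov (y + τ j)
    have hqR : ‖q‖ ≤ R := by
      calc ‖q‖ = dist q 0 := (dist_zero_right q).symm
        _ ≤ dist q (y + τ j) + dist (y + τ j) 0 := dist_triangle _ _ _
        _ ≤ ρP + R₁ := by rw [dist_zero_right]; exact add_le_add hqy hy
        _ = R := by rw [hR]; ring
    obtain ⟨t, ht⟩ := A1 q hq hqR
    refine ⟨t, ?_⟩
    calc dist (block s N t) y = dist (block s N t + τ j) (y + τ j) := (dist_add_right _ _ _).symm
      _ ≤ dist (block s N t + τ j) q + dist q (y + τ j) := dist_triangle _ _ _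
      _ ≤ 1 / 100 + ρP := add_le_add ht hqy
      _ = ρ' := by rw [hρ']; ring
  -- bulk completeness on `B(c, R₂)`
  have hbulk0 := bulk_of_dense (s := s) hρ'0 (by rw [hR₁]; linarith) hdense
  have hR₂eq : (R₁ - 2 * ρ' - 6) / 2 = R₂ := by rw [hR₁]; ring
  rw [hR₂eq] at hbulk0
  have hbulk : ∀ k i i' : ℤ, dist (bp s k i i') c ≤ R₂ → bp s k i i' ∈ Set.range (block s N) := by
    intro k i i' hd
    obtain ⟨t, ht⟩ := hbulk0 k i i' hd
    exact ⟨t, ht⟩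
  -- forward self-matching by `g` on `B(c, R₂)`
  have hR₂R : R₂ ≤ R := by rw [hR, hR₁]; linarith
  have hmatch : ∀ p ∈ Set.range (block s N), dist p c ≤ R₂ →
      ∃ k' i' j' : ℤ, dist (bp s k' i' j') (p + g) ≤ 1 / 50 := by
    rintro p ⟨t, rfl⟩ hp
    rw [hdistc] at hp
    obtain ⟨q, hq, hdq⟩ := A2 t (hp.trans hR₂R)
    have hqg : q + g ∈ P.points := P.add_mem_points hq hgL
    have hq1 : ‖q‖ ≤ R₂ + 1 / 100 := by
      calc ‖q‖ = dist q 0 := (dist_zero_right q).symm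
        _ ≤ dist q (block s N t + τ j) + dist (block s N t + τ j) 0 := dist_triangle _ _ _
        _ ≤ 1 / 100 + R₂ := by rw [dist_comm, dist_zero_right]; exact add_le_add hdq hp
        _ = R₂ + 1 / 100 := add_comm _ _
    have hqgR : ‖q + g‖ ≤ R := by
      calc ‖q + g‖ ≤ ‖q‖ + ‖g‖ := norm_add_le _ _
        _ ≤ R₂ + 1 / 100 + K := by rw [hK]; linarith
        _ ≤ R := by rw [hR, hR₁, hρ', hR₂]; linarith
    obtain ⟨t', ht'⟩ := A1 (q + g) hqg hqgR
    obtain ⟨k', i', j', hk'⟩ := block_mem s N t'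
    refine ⟨k', i', j', ?_⟩
    rw [show bp s k' i' j' = block s N t' from hk'.symm]
    calc dist (block s N t') (block s N t + g)
        = dist (block s N t' + τ j) (block s N t + τ j + g) := by
          rw [← dist_add_right (block s N t') (block s N t + g) (τ j)]; congr 1; abel
      _ ≤ dist (block s N t' + τ j) (q + g) + dist (q + g) (block s N t + τ j + g) := dist_triangle _ _ _
      _ ≤ 1 / 100 + 1 / 100 := by
          gcongr
          rw [dist_add_right, dist_comm]; exact hdq
      _ = 1 / 50 := by norm_num
  -- one matched pair near the centre fixes the layer shift `Δk`
  obtain ⟨t₀, ht₀⟩ := hdense c (by rw [dist_self, hR₁]; linarith)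
  obtain ⟨k₁, i₁, j₁, hm₀⟩ := hmatch (block s N t₀) ⟨t₀, rfl⟩ (ht₀.trans (by rw [hρ', hR₂]; linarith))
  obtain ⟨k₀, i₀, j₀, hb₀⟩ := block_mem s N t₀
  set Δk : ℤ := k₁ - k₀ with hΔk
  have hgz : |g 2 - (Δk : ℝ) * hI| ≤ 1 / 50 := by
    have e1 : (bp s k₁ i₁ j₁) 2 = k₁ * hI := by simp [bp]
    have e2 : (block s N t₀ + g) 2 = k₀ * hI + g 2 := by rw [hb₀]; simp
    have h1 := (abs_apply_sub_le_dist (bp s k₁ i₁ j₁) (block s N t₀ + g) 2).trans hm₀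
    rw [e1, e2] at h1
    have : g 2 - (Δk : ℝ) * hI = -((k₁ : ℝ) * hI - ((k₀ : ℝ) * hI + g 2)) := by rw [hΔk]; push_cast; ring
    rw [this, abs_neg]; exact h1
  have hΔk0 : Δk ≠ 0 := by
    intro h0
    rw [h0, Int.cast_zero, zero_mul, sub_zero] at hgz
    linarith
  -- periodicity of the Hägg word across the window
  have hper := StackingShift.periodic_of_selfmatch hs (by norm_num) hbulk hmatch hgz
  -- the window contains `4|Δk| + 1` consecutive layers
  set p : ℕ := Δk.natAbs with hp
  have hp0 : 0 < p := Int.natAbs_pos.2 hΔk0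
  have hpK : (p : ℝ) * hI ≤ K + 1 := by
    have h1 : |(Δk : ℝ) * hI| - |g 2| ≤ |(Δk : ℝ) * hI - g 2| := abs_sub_abs_le_abs_sub _ _
    rw [abs_sub_comm] at hgz
    have h3 : |(Δk : ℝ) * hI| = p * hI := by rw [abs_mul, abs_of_pos hI_pos, hp, Nat.cast_natAbs, Int.cast_abs]
    linarith
  set kc : ℤ := ⌊c 2 / hI⌋ with hkc
  have hkc1 : |(kc : ℝ) * hI - c 2| ≤ 1 := by
    have h1 : (kc : ℝ) ≤ c 2 / hI := Int.floor_le _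
    have h2 : c 2 / hI < kc + 1 := Int.lt_floor_add_one _
    have h1' : (kc : ℝ) * hI ≤ c 2 := by
      have := mul_le_mul_of_nonneg_right h1 hI_pos.le; rwa [div_mul_cancel₀ _ hI_pos.ne'] at this
    have h2' : c 2 < ((kc : ℝ) + 1) * hI := by
      have := mul_lt_mul_of_pos_right h2 hI_pos; rwa [div_mul_cancel₀ _ hI_pos.ne'] at this
    rw [abs_le]; constructor <;> nlinarith [hI_lt_one, hI_pos]
  have hwin : ∀ k : ℤ, |k - kc| ≤ 3 * p → |(k : ℝ) * hI - c 2| ≤ R₂ - 3 := by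
    intro k hk
    have hk' : |(k : ℝ) - kc| ≤ 3 * p := by exact_mod_cast hk
    have h2 : |(k : ℝ) * hI - c 2| ≤ |((k : ℝ) - kc) * hI| + |(kc : ℝ) * hI - c 2| := by
      have e : (k : ℝ) * hI - c 2 = ((k : ℝ) - kc) * hI + ((kc : ℝ) * hI - c 2) := by ring
      rw [e]; exact abs_add_le _ _
    have h3 : |((k : ℝ) - kc) * hI| ≤ 3 * p * hI := by
      rw [abs_mul, abs_of_pos hI_pos]; exact mul_le_mul_of_nonneg_right hk' hI_pos.le
    rw [hR₂]
    nlinarith [hpK, hρP0, hkc1]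
  have key : ∀ k : ℤ, kc - 3 * p ≤ k → k < kc - 3 * p + ((4 * p + 1 : ℕ) : ℤ) → s (k + (p : ℤ)) = s k := by
    intro k hk1 hk2
    push_cast at hk2
    rcases Int.natAbs_eq Δk with hΔ | hΔ
    · have := hper k (hwin k (abs_le.2 ⟨by omega, by omega⟩))
      rw [hΔ] at this; exact this
    · have := hper (k + p) (hwin (k + p) (abs_le.2 ⟨by omega, by omega⟩))
      rw [hΔ] at this
      have e : k + (p : ℤ) + -(p : ℤ) = k := by ring
      rw [e] at this; exact this.symm
  have := RulerHagg.rulerHagg_periodic_stretch_lt hp0 key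
  omega

end Main

end Summit.AtomisticToContinuum.Crystallization.Cruxes.DefectFreeCrystallizes.Disproof.WithoutGroundStates

end
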